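import Summits.HodgeConjecture.HodgeConjecture.Cruxes.BlochSeedDiscOne.RuleDPlate

/-!
# DeepLayerLaws — the DEEP-LAYER LETTER CALCULUS of the live room `Disj ∧ RuleD (∧ Hall⁺ₖ)`, uniform in RING and HEIGHT
(v1.3: + §8 COMPLETENESS — the SUM-RULE rooms `SumN ∕ SumP` are RULE-D-consistent at EVERY ring `1 ≤ c ≤ h`; see the §8 docstring;
v1.4: + §9 WEAK CONES ARE UP-CLOSED — `notDead_trans` (integer Minkowski), one-slot cones `SlotCone g ℓ` and full cones `WeakLive x` give
order-ideal Hall rows `hallPlusUp_slotCone ∕ _slotCone_and ∕ _cone`; the hub-column row cuts anomaly's box64 RULE-D inhabitant, which passes every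
singleton Hall⁺₈ row — so this row family is not implied by singletons;
v1.5: + §10 THE RING-2 SUPPLIER TABLE — negation g21's room facts R2–R6 (`BBPAIR-LAW-negation-g21.md` §1) as design-level theorems for
every height, no (A1): `unit4_suppliers`, `hook_witnesses`, `topHub_suppliers`, `topUnit_suppliers`, `twoTop_witnesses` + existence halves;
v1.6: + §11 THE PER-PAIR BB LAW — clause 2 of (A1) ALONE makes every two-slot e-free coefficient pair-independent (`T_wd_indep`), hence
`Σ_N − Σ_P` of `|x_g y_g|·|x_h y_h|` is the same for all six pairs at every height (`bbpair_law`), and on a ring-2 RULE-D room the P-mass of «B at g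
and B at h» is pair-independent (`bbpair_massP`) — the slot-aware refinement of `RingTwoMassLaw.unit4_balance'` = negation g21's L3, kernel;
v1.7: + §11c the lower-degree companions at every height (P1) `colevel_mass_slot_indep` (the signed co-level mass is slot-independent) and
(P2) «CC = 2ΔB» `cc_mass_law` (`Σ_N − Σ_P` of `c_g·c_h` = `Σ_N − Σ_P` of `2|x_p y_p|`, every pair, every slot); + §12 THE RING-2 «N ∋ unit⁴» DOOR
SKELETON (director R19.674 (1)(e)): negation g21's §5 arithmetic PROVED from DISPLAYED pen hypotheses L2∕L5∕§4 over six kernel P-families whose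
disjointness and `Σ ≤ Σ_P m` are proved (`six_families_le_total`), with `m_P(BB cells) = 6·m_P(BB 0 1)` kernel (`anyBB_massP`):
`ring2_unit4_door_skeleton`, `ring2_unit4_door_closed_of` — what remains pen is exactly the displayed list; + §12b BRANCH A IN KERNEL
(R19.679 (A)): R2 ⇒ hooks under a supported unit⁴ N-cell at three slots (`three_hook_slots`, `three_le_hook_mass`), R3 ⇒ nine pairwise different
witnesses `(T, H, H, u)` of one site (`exists_wit`, `three_le_witG`), hence `Σ_N m ≥ 7·|S| + 9` over any set `S` of F⁺-sites (`branchA_sigmaN`) and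
`|S| ≥ 8` contradicts the door (`branchA_closed`, `ring2_unit4_closed_of_branchA`: the only displayed inputs left are «`|supp F⁺| ≥ 8`» — i.e. σ = 0
(dual `door_law`) + the finite box certificate — and the F⁺-site inequality `m_N(y) ≥ 1 + 2·m_P(hooks under y)`))
(planner `plan-lens-HodgeAV-strengthen` g17, lens «strengthen», 2026-08-31; crux `BlochSeedDiscOne` = item `stmt-HodgeConjecture-18881`)

line stmt-HodgeConjecture-18881 Cruxes/BlochSeedDiscOne/Lines/birth.lean 814a6a70c14e831a stub_rung_pad4_seedAt

HONEST LABEL.  Letter-model statements about `DepthBoundA4.Design` (integer letter designs ≠ bundles ≠ sheaves ≠ a SEED).  CENSUS-NEUTRAL: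
no design is exhibited or excluded at any copy count; `(A1)` enters ONLY in §11–§11c and `anyBB_massP` ∕ `ring2_unit4_door_closed_of` of §12
(its clause 2: e-free words of equal degree agree), no
`μ`-arithmetic beyond «`μ ≠ 0` ⇒ a fully charged cell», no budget.  NOTHING here
is proved toward HC ∕ HC_CM ∕ HC_AV ∕ №4 ∕ 26512 ∕ 18881 ∕ H2, and no S⁺ is registered: these are the COVER LEMMAS — the finite letter calculus that
every ring-step certificate for the statement of record `RuleDPlate.SPlus 14 sigmaH 0` (copies form: `SPlusB 14 (CopiesLe 116)`) has to import,
typed once for EVERY height `h` and EVERY ring, kernel-checked, `sorry`-free.  Words by director-hodge only.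

THE LAWS (all under `Disj D ∧ RuleD D` unless said; `D.OnAlphabet h` where co-levels are compared; NO (A1) except §11–§12, NO Hall except §5, §9):
* §1 LETTER GEOMETRY.  `colevel = h − a` on the alphabet; a NULL step strictly LOWERS the co-level (`nullStep_colevel_lt`); the letters that
  null-step to the hub are exactly the AXIS letters (`nullStep_hub_iff`: `NullStep ℓ (hub h) ↔ a < h ∧ x·y = 0`); **AXIAL REGIME** (`nullStep_axial`):
  a null step with `Δa ≤ 4` moves ONE coordinate only (`p² + q² = d²`, `0 ≤ d ≤ 4` ⇒ `p = 0 ∨ q = 0` — the first Pythagorean step `(3,4,5)` needs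
  `Δa ≥ 5`), and on the alphabet the moving coordinate moves TOWARD the axis by exactly `Δa` (`nullStep_axial_onAlphabet`); so inside the rings
  `≤ 4` of any height every supplier ∕ witness step of RULE D is taxicab-monotone.
* §2 N-SIDE (RuleD-N ∧ Disj).  `PFloor D g ℓ` := no supported P-cell carries at slot `g` a letter null-below `ℓ`.  (A) `no_two_pFloor_slots`: a
  supported N-cell never has two distinct P-floor slots forming a detecting block (its supplier could lower neither ⇒ equals it ⇒ ¬Disj);
  `pFloor_slot_supplier`: one P-floor slot `g` ⇒ for every `j ≠ g` with `(g,j)` detecting, a supported P-cell equal to it off `j` and STRICTLY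
  null-below it at `j`.  Co-level packaging (`pFloor_of_colevel_ge`): an N-letter at least as deep as every P-letter of its slot is a P-floor letter;
  hence (B) `deepestN_mem_P`: such a letter (if charged) OCCURS at the same slot of a supported P-cell, and `exists_P_colevel_ge`: EVERY charged
  N-letter is matched or out-deepened by a P-letter IN THE SAME SLOT (slotwise max co-level is attained on the P side); `deepest_unique_N`: no
  supported N-cell carries slotwise-deepest letters at two slots.
* §3 P-SIDE (RuleD-P ∧ Disj), the mirror with `NCeil D g ℓ` := no supported N-letter at slot `g` is null-above `ℓ`: `no_two_nCeil_slots`,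
  `nCeil_slot_witness`; packaging `nCeil_of_nonaxis_shallowest` (a NON-AXIS letter with no N-letter of strictly smaller co-level in its slot — the hub
  is excluded automatically because only axis letters null-step to it); (C) `hubFree_of_nonaxis_shallowest`: a supported P-cell carrying such a
  letter is FULLY CHARGED (every slot has level `< h`).
* §4 TOTAL LEVEL.  `levelSum`; every slot of a supplier pair is level-monotone (`level_le_of_supplies`), a proper pair raises the total level
  (`levelSum_lt_of_supplies_ne`), `WeakLive` never lowers it; every supported N-cell with a detecting block lies strictly above (in total level)
  some supported P-cell and dually (`exists_P_below`, `exists_N_above`).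
* §5 ORDER-IDEAL HALL CUTS (door 1 only).  For every cell predicate `U` closed upward under `WeakLive` (`UpClosed U`; instances: total level `≥ s`,
  slot level `≥ s`, intersections, unions) (D) `hallPlusUp_cut`: `0 < m_P(U) ⇒ m_P(U) + k ≤ m_N(U)` from `HallPlusUp D k` (`hallUp_cut`: `m_P(U) ≤ m_N(U)`
  from `HallUp`), in the RELATIVE form `UpClosedOn E U` (closure only from supported P-cells to supported N-cells — what the rows see; zero entries
  are padded away by `mass_filter_and_pos` ∕ `mass_filter_or_zero`); the dual (D′) `hallUp_down_cut` ∕ `hallPlusUp_down_cut`: on every relatively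
  DOWN-closed `L`, `m_N(L) − m_P(L) ≤ rank` (`≤ rank − k` once a positive P-entry avoids `L`); corollary `deepN_mass_le`: the N-entries of total level
  below EVERY supported P-cell weigh at most `Σ_N − Σ_P − k` (= `rank − 8` in the room of record).  Valid rows for every LP ∕ MILP seat, support-free.
* §6 THE RING FRAME.  `RingLe c D` (all support letters of co-level `≤ c`; `c = 2` is `RingTwoMassLaw.Ring2`'s shape), `TouchesP`∕`TouchesN`;
  (E) `touchesP_of_touchesN`: in a `RingLe c` room (`0 < c`) an N-letter of co-level `c` at slot `g` is the slot-`g` letter of a supported P-cell — the TOP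
  RING IS A P-RING, (`ring_top_unique_N`) no supported N-cell has two top-ring letters, (`ring_top_three_legs`) a top-ring N-cell stands on three
  pairwise different strict suppliers, all touching the top ring; TYPE SHAPES AT THE TOP RING (every ring, every height): a supported P-cell has
  at most TWO top-ring letters and with two it is `(top, top, hub, hub)` (`two_tops_P_hub`, `not_three_tops_P`), a supported N-cell with a top letter
  and a co-level-`(c−1)` letter is `(top, c−1, hub, hub)` (`topN_subtop_hub`) — strengthen g16's ring-2 pen laws F1–F3 (= anomaly's gfp digits) for
  ALL rings; §6c THE SUM RULE completes them to the full type-local theory of the two top co-levels: for two slots of co-levels `p, q` of a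
  supported cell, N side `p + q ≤ 2c − 1`, `= 2c − 1 ⇒` the other two letters are hubs, `= 2c − 2 ⇒` axis (`sum_rule_N_lt ∕ _hub ∕ _axis`, from
  `top_subsub_N_axis`, `two_subtops_N_axis`); P side no three tops, `p + q = 2c ⇒` hubs, `= 2c − 1 ⇒` axis (`sum_rule_P_three ∕ _hub ∕ _axis`, from
  `top_subtop_P_axis`) — and (machine, `eng/gfpsym2.py`) the SUM-RULE ROOM is EXACTLY the type-level greatest fixpoint of RULE D at rings 2, 3, 4, 5
  (N 1041 ∕ 22913 ∕ 274721 ∕ 2106353, P 5009 ∕ 78817 ∕ 751137 ∕ 4782161) and a post-fixpoint at ring 6: RULE D ∧ Disj imply NOTHING ELSE type-locally;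
  the top shell is a relative DOWN-set (`downClosedOn_touches`), so
  `top_shell_excess_le_rank(_sub)`: `m_N(touch c) − m_P(touch c) ≤ rank (− 8)`; `exists_full_of_mu_ne` + `one_le_colevel_of_full`: `μ ≠ 0`
  forces a fully charged supported cell, all of whose letters have co-level `≥ 1` (so ring 0 is empty: `ringRoomB_zero`).  `RingRoomB h Budget c` :=
  the v4.1 room (`SPlusB` hypotheses) restricted to `RingLe c`; `ringRoomB_anti` (monotone in `c`), `sPlusB_iff_ringRoomB` (`SPlusB h B ↔ RingRoomB h B h`),
  and the LEDGER STEP `ringRoomB_succ_iff : RingRoomB h B (c+1) ↔ RingRoomB h B c ∧ RingShellB h B (c+1)` where the shell hypothesis is delivered in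
  the strong form «some supported P-cell touches co-level `c+1`» — the director's ring ledger («ring 1 ∅ · ring 2 … · rings ≥ 3») as ONE kernel
  conjunction at fixed height (the tree's tower `RuleDPlate.sPlusB_succ_iff` is the HEIGHT-indexed companion).
* §7 THE DICTIONARY (live-room analogue of `HeightTower.ringsEmpty_iff_nonex`): for a shift-invariant budget and `c ≤ h`,
  `ringRoomB_iff_sPlusB : RingRoomB h B c ↔ SPlusB c B` and, for `1 ≤ c`, `ringShellB_iff_floorFreeB : RingShellB h B c ↔ FloorFreeB c B` (shift by
  `h − c`; a co-level-`c` letter at height `c` is a FLOOR letter); `ring_ledger_dictionary`: at `h = 14` «ring 2 closed at copies ≤ B» IS `SPlusB 2 (CopiesLe B)`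
  and «shell c closed» IS `FloorFreeB c (CopiesLe B)` — the register's ring ledger and the tree's height tower are the same fourteen statements.

PROVENANCE ∕ CHECKS.  Pen laws of strengthen g15–g17; sanity-run (not needed for validity) by the seat's stdlib script `eng/layerstats.py` on four
inhabitants of the doors `Disj ∧ RuleD` (E39-SYM648 ∕ SYM656 ring 2, anomaly box64 13 106 copies ring 2, strengthen memo-25 ring-3 inhabitant 2.1·10¹⁴):
(A)(B)(C)(E) hold on all four, as they must; the tempting quantitative companion «the top ring is P-HEAVY in mass» is FALSE (ring-3 inhabitant:
N∕P letter incidence at co-level 3 = 1.4·10¹⁴ ∕ 1.7·10⁸) and is NOT stated.  Imports `RuleDPlate` (→ `HallB136`, `LeggedFloor`, `DepthBoundA4`).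
No `sorry`, no `axiom`, no `instance`, no `notation`, no `native_decide`, no `decide` on designs, no unsafe reducibility.
-/

set_option linter.dupNamespace false
set_option autoImplicit false

namespace Summit.HodgeConjecture.HodgeConjecture.Cruxes.BlochSeedDiscOne.DeepLayerLaws

open Summit.HodgeConjecture.HodgeConjecture.Cruxes.BlochSeedDiscOne.DepthBoundA4
open Summit.HodgeConjecture.HodgeConjecture.Cruxes.BlochSeedDiscOne.LeggedFloor
  (NullStep Supplies Detects RuleDP RuleD Disj FullBelow level_le_of_onAlphabet xy_eq_zero_of_not_lt charged_of_lt
    mem_supp_of_memP mem_supp_of_memN level_le_of_eq_or_null cellCoef_eeee_eq_zero_of_not_full listSum_eeee_eq_zero)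
open Summit.HodgeConjecture.HodgeConjecture.Cruxes.BlochSeedDiscOne.HeightTower
  (shiftL shiftCell shiftD suppN_shift suppP_shift onAlphabet_shift onAlphabet_shift_up colevel_shift shiftL_colevel a1_shiftD mu_shiftD)
open Summit.HodgeConjecture.HodgeConjecture.Cruxes.BlochSeedDiscOne.HallB136 (HallUp)
open Summit.HodgeConjecture.HodgeConjecture.Cruxes.BlochSeedDiscOne.RuleDPlate
  (HallPlusUp SPlusB CopiesLe FloorFreeR FloorFreeB disj_shiftD ruleD_shiftD hallUp_shiftD hallPlusUp_shiftD copiesLe_shiftD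
    sPlusB_copiesLe_succ_iff)

/-! ## §1 Letter geometry on the height-`h` alphabet -/

theorem colevel_eq_of_onAlphabet {h : ℤ} {ℓ : Letter} (hℓ : ℓ.OnAlphabet h) : ℓ.colevel = h - ℓ.a := by
  have h1 := hℓ.1
  unfold Letter.height at h1
  unfold Letter.colevel
  linarith

theorem colevel_nonneg (ℓ : Letter) : 0 ≤ ℓ.colevel := by
  unfold Letter.colevel
  have := abs_nonneg ℓ.x
  have := abs_nonneg ℓ.y
  linarith

/-- a letter is CHARGED (`β ≠ 0`) iff its co-level is positive. -/
theorem colevel_pos_iff (ℓ : Letter) : 0 < ℓ.colevel ↔ ¬ (ℓ.x = 0 ∧ ℓ.y = 0) := by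
  unfold Letter.colevel
  constructor
  · rintro hpos ⟨hx, hy⟩
    rw [hx, hy] at hpos
    simp at hpos
  · intro hne
    by_contra hle
    push Not at hle
    have hx := abs_nonneg ℓ.x
    have hy := abs_nonneg ℓ.y
    have hx0 : |ℓ.x| = 0 := by linarith
    have hy0 : |ℓ.y| = 0 := by linarith
    exact hne ⟨abs_eq_zero.mp hx0, abs_eq_zero.mp hy0⟩

theorem colevel_eq_zero_iff (ℓ : Letter) : ℓ.colevel = 0 ↔ ℓ.x = 0 ∧ ℓ.y = 0 := by
  have h0 := colevel_nonneg ℓ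
  have h1 := colevel_pos_iff ℓ
  constructor
  · intro he
    by_contra hne
    have := h1.mpr hne
    omega
  · intro hxy
    by_contra hne
    exact (h1.mp (by omega)) hxy

/-- on the alphabet: level `< h` iff charged iff co-level positive. -/
theorem level_lt_iff_colevel_pos {h : ℤ} {ℓ : Letter} (hℓ : ℓ.OnAlphabet h) : ℓ.a < h ↔ 0 < ℓ.colevel := by
  rw [colevel_eq_of_onAlphabet hℓ]
  omega

/-- the hub is the only letter of co-level `0` on the alphabet. -/
theorem eq_hub_of_colevel_eq_zero {h : ℤ} {ℓ : Letter} (hℓ : ℓ.OnAlphabet h) (h0 : ℓ.colevel = 0) : ℓ = Letter.hub h := by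
  obtain ⟨hx, hy⟩ := (colevel_eq_zero_iff ℓ).mp h0
  have ha : ℓ.a = h := by have := colevel_eq_of_onAlphabet hℓ; omega
  cases ℓ
  simp only [Letter.hub, Letter.mk.injEq]
  exact ⟨ha, hx, hy⟩

theorem colevel_hub {h : ℤ} : (Letter.hub h).colevel = 0 := by
  simp [Letter.hub, Letter.colevel]

/-- a NULL step raises the level … -/
theorem level_lt_of_nullStep {ℓ ℓ' : Letter} (hs : NullStep ℓ ℓ') : ℓ.a < ℓ'.a := hs.1

/-- … hence strictly LOWERS the co-level (both letters on the same alphabet). -/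
theorem nullStep_colevel_lt {h : ℤ} {ℓ ℓ' : Letter} (hℓ : ℓ.OnAlphabet h) (hℓ' : ℓ'.OnAlphabet h) (hs : NullStep ℓ ℓ') :
    ℓ'.colevel < ℓ.colevel := by
  rw [colevel_eq_of_onAlphabet hℓ, colevel_eq_of_onAlphabet hℓ']
  have := hs.1
  omega

theorem not_nullStep_of_colevel_le {h : ℤ} {ℓ ℓ' : Letter} (hℓ : ℓ.OnAlphabet h) (hℓ' : ℓ'.OnAlphabet h)
    (hc : ℓ.colevel ≤ ℓ'.colevel) : ¬ NullStep ℓ ℓ' :=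
  fun hs => absurd (nullStep_colevel_lt hℓ hℓ' hs) (not_lt.mpr hc)

/-- nothing null-steps up from the hub. -/
theorem not_nullStep_hub {h : ℤ} {ℓ' : Letter} (hℓ' : ℓ'.OnAlphabet h) : ¬ NullStep (Letter.hub h) ℓ' := by
  intro hs
  have h1 := hs.1
  have h2 := level_le_of_onAlphabet hℓ'
  simp only [Letter.hub] at h1
  omega

/-- **the letters that null-step to the hub are exactly the charged AXIS letters** (`|β|² = (h − a)² = (|x| + |y|)²` iff `x·y = 0`). -/
theorem nullStep_hub_iff {h : ℤ} {ℓ : Letter} (hℓ : ℓ.OnAlphabet h) :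
    NullStep ℓ (Letter.hub h) ↔ ℓ.a < h ∧ ℓ.x * ℓ.y = 0 := by
  have e : h - ℓ.a = |ℓ.x| + |ℓ.y| := by have := colevel_eq_of_onAlphabet hℓ; unfold Letter.colevel at this; omega
  have sx := sq_abs ℓ.x
  have sy := sq_abs ℓ.y
  have hx := abs_nonneg ℓ.x
  have hy := abs_nonneg ℓ.y
  unfold NullStep
  simp only [Letter.hub, zero_sub, even_two, Even.neg_pow]
  rw [e]
  constructor
  · rintro ⟨ha, hq⟩
    refine ⟨by omega, ?_⟩
    have hxy : |ℓ.x| * |ℓ.y| = 0 := by nlinarith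
    rw [← abs_mul] at hxy
    exact abs_eq_zero.mp hxy
  · rintro ⟨ha, hxy⟩
    refine ⟨by omega, ?_⟩
    have habs : |ℓ.x| * |ℓ.y| = 0 := by rw [← abs_mul, hxy, abs_zero]
    nlinarith

/-- **AXIAL REGIME** (pure arithmetic): `p² + q² = d²` with `0 ≤ d ≤ 4` forces `p = 0 ∨ q = 0`. -/
theorem sq_add_sq_eq_sq_axial {p q d : ℤ} (hpq : p ^ 2 + q ^ 2 = d ^ 2) (hd0 : 0 ≤ d) (hd4 : d ≤ 4) : p = 0 ∨ q = 0 := by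
  by_contra hcon
  push Not at hcon
  obtain ⟨hp, hq⟩ := hcon
  have hp1 : 1 ≤ p ^ 2 := by
    rcases lt_or_gt_of_ne hp with h | h <;> nlinarith
  have hq1 : 1 ≤ q ^ 2 := by
    rcases lt_or_gt_of_ne hq with h | h <;> nlinarith
  have hd2 : d ^ 2 ≤ 16 := by nlinarith
  have hpb : p ^ 2 ≤ 15 := by linarith
  have hqb : q ^ 2 ≤ 15 := by linarith
  have hp3 : -3 ≤ p ∧ p ≤ 3 := by constructor <;> nlinarith
  have hq3 : -3 ≤ q ∧ q ≤ 3 := by constructor <;> nlinarith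
  obtain ⟨hpl, hpu⟩ := hp3
  obtain ⟨hql, hqu⟩ := hq3
  interval_cases p <;> interval_cases q <;> simp at hp hq <;> interval_cases d <;> omega

/-- **a null step with `Δa ≤ 4` is AXIAL**: one coordinate of `β` is unchanged. -/
theorem nullStep_axial {ℓ ℓ' : Letter} (hs : NullStep ℓ ℓ') (hd : ℓ'.a - ℓ.a ≤ 4) : ℓ'.x = ℓ.x ∨ ℓ'.y = ℓ.y := by
  obtain ⟨ha, hq⟩ := hs
  rcases sq_add_sq_eq_sq_axial hq (by omega) hd with h | h
  · left; omega
  · right; omega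

/-- on the alphabet the hypothesis `Δa ≤ 4` reads `colevel ℓ ≤ colevel ℓ′ + 4`; in particular it holds whenever `colevel ℓ ≤ 4` (rings `≤ 4`),
and then the moving coordinate moves TOWARD the axis by exactly `Δa` (it does not cross it). -/
theorem nullStep_axial_onAlphabet {h : ℤ} {ℓ ℓ' : Letter} (hℓ : ℓ.OnAlphabet h) (hℓ' : ℓ'.OnAlphabet h) (hs : NullStep ℓ ℓ')
    (hc : ℓ.colevel ≤ ℓ'.colevel + 4) :
    (ℓ'.y = ℓ.y ∧ |ℓ'.x| + (ℓ'.a - ℓ.a) = |ℓ.x|) ∨ (ℓ'.x = ℓ.x ∧ |ℓ'.y| + (ℓ'.a - ℓ.a) = |ℓ.y|) := by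
  have e := colevel_eq_of_onAlphabet hℓ
  have e' := colevel_eq_of_onAlphabet hℓ'
  have hd : ℓ'.a - ℓ.a ≤ 4 := by omega
  unfold Letter.colevel at e e'
  rcases nullStep_axial hs hd with hx | hy
  · right
    refine ⟨hx, ?_⟩
    rw [hx] at e'
    omega
  · left
    refine ⟨hy, ?_⟩
    rw [hy] at e'
    omega

theorem nullStep_axial_of_colevel_le_four {h : ℤ} {ℓ ℓ' : Letter} (hℓ : ℓ.OnAlphabet h) (hℓ' : ℓ'.OnAlphabet h)
    (hs : NullStep ℓ ℓ') (hc : ℓ.colevel ≤ 4) : ℓ'.x = ℓ.x ∨ ℓ'.y = ℓ.y := by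
  have := colevel_nonneg ℓ'
  rcases nullStep_axial_onAlphabet hℓ hℓ' hs (by omega) with h1 | h1
  · exact Or.inr h1.1
  · exact Or.inl h1.1

/-! ## §1b Block symmetries and RULE D for unordered slot pairs -/

theorem supplies_comm {x y : Cell} {g j : Fin 4} (hs : Supplies x y g j) : Supplies x y j g :=
  ⟨fun f h1 h2 => hs.1 f h2 h1, hs.2.2, hs.2.1⟩

theorem detects_comm {c : Cell} {g j : Fin 4} (hd : Detects c g j) : Detects c j g := by
  intro h5
  exact hd ⟨h5.2.2.1, h5.2.2.2.1, h5.1, h5.2.1, h5.2.2.2.2.symm⟩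

/-- a block one of whose letters is charged detects. -/
theorem detects_of_charged_left {c : Cell} {g j : Fin 4} (hg : ¬ ((c g).x = 0 ∧ (c g).y = 0)) : Detects c g j :=
  fun h5 => hg ⟨h5.1, h5.2.1⟩

theorem detects_of_charged_right {c : Cell} {g j : Fin 4} (hj : ¬ ((c j).x = 0 ∧ (c j).y = 0)) : Detects c g j :=
  fun h5 => hj ⟨h5.2.2.1, h5.2.2.2.1⟩

theorem detects_of_colevel_pos {c : Cell} {g : Fin 4} (j : Fin 4) (hg : 0 < (c g).colevel) : Detects c g j :=
  detects_of_charged_left ((colevel_pos_iff _).mp hg)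

/-- RULE D (N side) for an unordered pair of distinct slots. -/
theorem ruleDN_any {D : Design} (hr : RuleD D) {y : Cell} (hy : y ∈ D.suppN) {g j : Fin 4} (hgj : g ≠ j)
    (hdet : Detects y g j) : ∃ x ∈ D.suppP, Supplies x y g j := by
  rcases lt_or_gt_of_ne hgj with hlt | hlt
  · exact hr.1 y hy g j hlt hdet
  · obtain ⟨x, hx, hs⟩ := hr.1 y hy j g hlt (detects_comm hdet)
    exact ⟨x, hx, supplies_comm hs⟩

/-- RULE D (P side) for an unordered pair of distinct slots. -/
theorem ruleDP_any {D : Design} (hr : RuleDP D) {x : Cell} (hx : x ∈ D.suppP) {g j : Fin 4} (hgj : g ≠ j)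
    (hdet : Detects x g j) : ∃ y ∈ D.suppN, Supplies x y g j := by
  rcases lt_or_gt_of_ne hgj with hlt | hlt
  · exact hr x hx g j hlt hdet
  · obtain ⟨y, hy, hs⟩ := hr x hx j g hlt (detects_comm hdet)
    exact ⟨y, hy, supplies_comm hs⟩

/-- a supplier pair equal on both block slots is the same cell. -/
theorem eq_of_supplies_eq {x y : Cell} {g j : Fin 4} (hs : Supplies x y g j) (hg : x g = y g) (hj : x j = y j) : x = y := by
  funext f
  by_cases hfg : f = g
  · subst hfg; exact hg
  by_cases hfj : f = j
  · subst hfj; exact hj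
  exact hs.1 f hfg hfj

/-- every slot has another slot. -/
theorem exists_ne_slot (g : Fin 4) : ∃ j : Fin 4, g ≠ j := by
  by_cases hg : g = 0
  · exact ⟨1, by subst hg; decide⟩
  · exact ⟨0, hg⟩

/-! ## §2 N-side laws: P-FLOOR letters (RuleD-N ∧ Disj) -/

/-- `ℓ` is a slot-`g` P-FLOOR letter of `D`: no supported P-cell carries at slot `g` a letter from which `ℓ` is a NULL step up. -/
def PFloor (D : Design) (g : Fin 4) (ℓ : Letter) : Prop := ∀ x ∈ D.suppP, ¬ NullStep (x g) ℓ

/-- **(A) no supported N-cell has two P-floor slots forming a detecting block.** -/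
theorem no_two_pFloor_slots {D : Design} (hdis : Disj D) (hr : RuleD D) {y : Cell} (hy : y ∈ D.suppN) {g j : Fin 4}
    (hgj : g ≠ j) (hdet : Detects y g j) (hg : PFloor D g (y g)) (hj : PFloor D j (y j)) : False := by
  obtain ⟨x, hx, hs⟩ := ruleDN_any hr hy hgj hdet
  have exg : x g = y g := hs.2.1.resolve_right (hg x hx)
  have exj : x j = y j := hs.2.2.resolve_right (hj x hx)
  have hxy : x = y := eq_of_supplies_eq hs exg exj
  exact hdis y hy (hxy ▸ hx)

/-- **one P-floor slot forces STRICT suppliers through every other detecting slot**: a supported P-cell equal to `y` off `j`, null-below it at `j`. -/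
theorem pFloor_slot_supplier {D : Design} (hdis : Disj D) (hr : RuleD D) {y : Cell} (hy : y ∈ D.suppN) {g j : Fin 4}
    (hgj : g ≠ j) (hdet : Detects y g j) (hg : PFloor D g (y g)) :
    ∃ x ∈ D.suppP, (∀ f : Fin 4, f ≠ j → x f = y f) ∧ NullStep (x j) (y j) ∧ x ≠ y := by
  obtain ⟨x, hx, hs⟩ := ruleDN_any hr hy hgj hdet
  have exg : x g = y g := hs.2.1.resolve_right (hg x hx)
  have hne : x ≠ y := fun hxy => hdis y hy (hxy ▸ hx)
  have hnj : NullStep (x j) (y j) := by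
    rcases hs.2.2 with h | h
    · exact absurd (eq_of_supplies_eq hs exg h) hne
    · exact h
  refine ⟨x, hx, fun f hfj => ?_, hnj, hne⟩
  by_cases hfg : f = g
  · subst hfg; exact exg
  · exact hs.1 f hfg hfj

/-- co-level packaging: an N-letter at least as deep as every P-letter of its slot is a P-floor letter. -/
theorem pFloor_of_colevel_ge {h : ℤ} {D : Design} (hA : D.OnAlphabet h) {y : Cell} (hy : y ∈ D.suppN) (g : Fin 4)
    (hmax : ∀ x ∈ D.suppP, (x g).colevel ≤ (y g).colevel) : PFloor D g (y g) :=
  fun x hx => not_nullStep_of_colevel_le (hA x (mem_supp_of_memP D hx) g) (hA y (mem_supp_of_memN D hy) g) (hmax x hx)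

/-- **(A′) ONE DEEPEST LETTER PER N-CELL**: no supported N-cell carries, at two distinct slots, letters each at least as deep as every
P-letter of that slot (one of them charged). -/
theorem deepest_unique_N {h : ℤ} {D : Design} (hA : D.OnAlphabet h) (hdis : Disj D) (hr : RuleD D) {y : Cell}
    (hy : y ∈ D.suppN) {g j : Fin 4} (hgj : g ≠ j) (hpos : 0 < (y g).colevel)
    (hg : ∀ x ∈ D.suppP, (x g).colevel ≤ (y g).colevel) (hj : ∀ x ∈ D.suppP, (x j).colevel ≤ (y j).colevel) : False :=
  no_two_pFloor_slots hdis hr hy hgj (detects_of_colevel_pos j hpos) (pFloor_of_colevel_ge hA hy g hg)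
    (pFloor_of_colevel_ge hA hy j hj)

/-- **(B) DEEPEST N-LETTERS ARE P-LETTERS**: a charged N-letter at slot `g` at least as deep as every P-letter at slot `g` IS the slot-`g`
letter of a supported P-cell (any of its suppliers), which differs from the N-cell elsewhere. -/
theorem deepestN_mem_P {h : ℤ} {D : Design} (hA : D.OnAlphabet h) (hdis : Disj D) (hr : RuleD D) {y : Cell}
    (hy : y ∈ D.suppN) (g : Fin 4) (hpos : 0 < (y g).colevel) (hmax : ∀ x ∈ D.suppP, (x g).colevel ≤ (y g).colevel) :
    ∃ x ∈ D.suppP, x g = y g ∧ x ≠ y := by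
  obtain ⟨j, hgj⟩ := exists_ne_slot g
  obtain ⟨x, hx, hoff, -, hne⟩ :=
    pFloor_slot_supplier hdis hr hy hgj (detects_of_colevel_pos j hpos) (pFloor_of_colevel_ge hA hy g hmax)
  exact ⟨x, hx, hoff g hgj, hne⟩

/-- **slotwise max co-level is attained on the P side**: every charged N-letter is matched or out-deepened by a P-letter in the SAME slot. -/
theorem exists_P_colevel_ge {h : ℤ} {D : Design} (hA : D.OnAlphabet h) (hdis : Disj D) (hr : RuleD D) {y : Cell}
    (hy : y ∈ D.suppN) (g : Fin 4) (hpos : 0 < (y g).colevel) : ∃ x ∈ D.suppP, (y g).colevel ≤ (x g).colevel := by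
  by_contra hcon
  push Not at hcon
  obtain ⟨x, hx, hxg, -⟩ := deepestN_mem_P hA hdis hr hy g hpos fun x hx => le_of_lt (hcon x hx)
  have hlt := hcon x hx
  rw [hxg] at hlt
  exact lt_irrefl _ hlt

/-- cells that agree with `y` off two different slots and both differ from `y` are different cells. -/
theorem ne_of_offslot_ne {y x x' : Cell} {j j' : Fin 4} (hjj : j ≠ j') (hx : ∀ f : Fin 4, f ≠ j → x f = y f)
    (hx'off : ∀ f : Fin 4, f ≠ j' → x' f = y f) (hx' : x' ≠ y) : x ≠ x' := by
  intro hxx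
  apply hx'
  funext f
  by_cases hf : f = j'
  · subst hf
    rw [← hxx]
    exact hx f (Ne.symm hjj)
  · exact hx'off f hf

/-- **THREE LEGS**: a supported N-cell carrying at slot `g` a charged letter at least as deep as every P-letter of slot `g` (e.g. a TOP-RING letter)
stands on a STRICT supplier through EACH of its three other slots — three pairwise different supported P-cells (`ne_of_offslot_ne`), each equal
to it off one slot and null-below it there; in particular every other letter of the N-cell is strictly shallower than some P-letter of its slot. -/
theorem three_legs_of_deepestN {h : ℤ} {D : Design} (hA : D.OnAlphabet h) (hdis : Disj D) (hr : RuleD D) {y : Cell}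
    (hy : y ∈ D.suppN) (g : Fin 4) (hpos : 0 < (y g).colevel) (hmax : ∀ x ∈ D.suppP, (x g).colevel ≤ (y g).colevel)
    (j : Fin 4) (hgj : g ≠ j) :
    ∃ x ∈ D.suppP, (∀ f : Fin 4, f ≠ j → x f = y f) ∧ NullStep (x j) (y j) ∧ x ≠ y ∧ (y j).colevel < (x j).colevel := by
  obtain ⟨x, hx, hoff, hnull, hne⟩ :=
    pFloor_slot_supplier hdis hr hy hgj (detects_of_colevel_pos j hpos) (pFloor_of_colevel_ge hA hy g hmax)
  exact ⟨x, hx, hoff, hnull, hne,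
    nullStep_colevel_lt (hA x (mem_supp_of_memP D hx) j) (hA y (mem_supp_of_memN D hy) j) hnull⟩

/-! ## §3 P-side laws: N-CEILING letters (RuleD-P ∧ Disj) -/

/-- `ℓ` is a slot-`g` N-CEILING letter of `D`: no supported N-cell carries at slot `g` a letter to which `ℓ` null-steps up. -/
def NCeil (D : Design) (g : Fin 4) (ℓ : Letter) : Prop := ∀ y ∈ D.suppN, ¬ NullStep ℓ (y g)

theorem no_two_nCeil_slots {D : Design} (hdis : Disj D) (hr : RuleDP D) {x : Cell} (hx : x ∈ D.suppP) {g j : Fin 4}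
    (hgj : g ≠ j) (hdet : Detects x g j) (hg : NCeil D g (x g)) (hj : NCeil D j (x j)) : False := by
  obtain ⟨y, hy, hs⟩ := ruleDP_any hr hx hgj hdet
  have exg : x g = y g := hs.2.1.resolve_right (hg y hy)
  have exj : x j = y j := hs.2.2.resolve_right (hj y hy)
  have hxy : x = y := eq_of_supplies_eq hs exg exj
  exact hdis x (hxy ▸ hy) hx

/-- one N-ceiling slot forces STRICT witnesses through every other detecting slot. -/
theorem nCeil_slot_witness {D : Design} (hdis : Disj D) (hr : RuleDP D) {x : Cell} (hx : x ∈ D.suppP) {g j : Fin 4}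
    (hgj : g ≠ j) (hdet : Detects x g j) (hg : NCeil D g (x g)) :
    ∃ y ∈ D.suppN, (∀ f : Fin 4, f ≠ j → x f = y f) ∧ NullStep (x j) (y j) ∧ x ≠ y := by
  obtain ⟨y, hy, hs⟩ := ruleDP_any hr hx hgj hdet
  have exg : x g = y g := hs.2.1.resolve_right (hg y hy)
  have hne : x ≠ y := fun hxy => hdis x (hxy ▸ hy) hx
  have hnj : NullStep (x j) (y j) := by
    rcases hs.2.2 with h | h
    · exact absurd (eq_of_supplies_eq hs exg h) hne
    · exact h
  refine ⟨y, hy, fun f hfj => ?_, hnj, hne⟩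
  by_cases hfg : f = g
  · subst hfg; exact exg
  · exact hs.1 f hfg hfj

/-- co-level packaging: a NON-AXIS letter with no N-letter of strictly smaller co-level in its slot other than (possibly) the hub is an
N-ceiling letter — the hub is harmless because only axis letters null-step to it (`nullStep_hub_iff`). -/
theorem nCeil_of_nonaxis_shallowest {h : ℤ} {D : Design} (hA : D.OnAlphabet h) {x : Cell} (hx : x ∈ D.suppP) (g : Fin 4)
    (hnon : (x g).x * (x g).y ≠ 0)
    (hmin : ∀ y ∈ D.suppN, (x g).colevel ≤ (y g).colevel ∨ y g = Letter.hub h) : NCeil D g (x g) := by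
  intro y hy hs
  have hxA := hA x (mem_supp_of_memP D hx) g
  have hyA := hA y (mem_supp_of_memN D hy) g
  rcases hmin y hy with hle | hhub
  · exact not_nullStep_of_colevel_le hxA hyA hle hs
  · rw [hhub] at hs
    exact hnon ((nullStep_hub_iff hxA).mp hs).2

/-- **(C) a supported P-cell carrying a NON-AXIS slotwise-shallowest charged letter is FULLY CHARGED** (every slot has level `< h`). -/
theorem hubFree_of_nonaxis_shallowest {h : ℤ} {D : Design} (hA : D.OnAlphabet h) (hdis : Disj D) (hr : RuleDP D) {x : Cell}
    (hx : x ∈ D.suppP) (g : Fin 4) (hnon : (x g).x * (x g).y ≠ 0)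
    (hmin : ∀ y ∈ D.suppN, (x g).colevel ≤ (y g).colevel ∨ y g = Letter.hub h) : FullBelow h x := by
  have hxA : ∀ f : Fin 4, (x f).OnAlphabet h := hA x (mem_supp_of_memP D hx)
  have hch : ¬ ((x g).x = 0 ∧ (x g).y = 0) := fun hz => hnon (by rw [hz.1, zero_mul])
  have hceil := nCeil_of_nonaxis_shallowest hA hx g hnon hmin
  intro j
  by_cases hjg : j = g
  · subst hjg
    by_contra hn
    exact hch (xy_eq_zero_of_not_lt (hxA j) hn)
  · obtain ⟨y, hy, -, hnull, -⟩ := nCeil_slot_witness hdis hr hx (Ne.symm hjg) (detects_of_charged_left hch) hceil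
    have hyA := hA y (mem_supp_of_memN D hy) j
    exact lt_of_lt_of_le hnull.1 (level_le_of_onAlphabet hyA)

/-! ## §4 Total level -/

/-- total level `Σ_f a_f` of a cell (on the alphabet `= 4h −` total co-level). -/
def levelSum (c : Cell) : ℤ := (c 0).a + (c 1).a + (c 2).a + (c 3).a

theorem levelSum_eq_of_onAlphabet {h : ℤ} {c : Cell} (hc : ∀ f : Fin 4, (c f).OnAlphabet h) :
    levelSum c = 4 * h - ((c 0).colevel + (c 1).colevel + (c 2).colevel + (c 3).colevel) := by
  unfold levelSum
  rw [colevel_eq_of_onAlphabet (hc 0), colevel_eq_of_onAlphabet (hc 1), colevel_eq_of_onAlphabet (hc 2),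
    colevel_eq_of_onAlphabet (hc 3)]
  ring

theorem sum4_pos_of_nonneg {d : Fin 4 → ℤ} (hd : ∀ f : Fin 4, 0 ≤ d f) {g : Fin 4} (hg : 0 < d g) :
    0 < d 0 + d 1 + d 2 + d 3 := by
  have h0 := hd 0; have h1 := hd 1; have h2 := hd 2; have h3 := hd 3
  fin_cases g <;> simp at hg <;> omega

theorem level_le_of_notDead {ℓ ℓ' : Letter} (h : NotDead ℓ ℓ') : ℓ.a ≤ ℓ'.a := by
  rcases h with h | h
  · rw [h]
  · exact le_of_lt h.1

theorem levelSum_le_of_weakLive {x y : Cell} (h : WeakLive x y) : levelSum x ≤ levelSum y := by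
  unfold levelSum
  have h0 := level_le_of_notDead (h 0)
  have h1 := level_le_of_notDead (h 1)
  have h2 := level_le_of_notDead (h 2)
  have h3 := level_le_of_notDead (h 3)
  omega

/-- every slot of a supplier pair is level-monotone. -/
theorem level_le_of_supplies {x y : Cell} {g j : Fin 4} (hs : Supplies x y g j) (f : Fin 4) : (x f).a ≤ (y f).a := by
  by_cases hfg : f = g
  · subst hfg; exact level_le_of_eq_or_null hs.2.1
  by_cases hfj : f = j
  · subst hfj; exact level_le_of_eq_or_null hs.2.2
  rw [hs.1 f hfg hfj]

/-- a proper supplier pair raises the TOTAL level (cell form of `LeggedFloor.levelSum_lt_of_supplies_ne`). -/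
theorem levelSum_lt_of_supplies_ne {x y : Cell} {g j : Fin 4} (hs : Supplies x y g j) (hne : x ≠ y) :
    levelSum x < levelSum y := by
  have hb := LeggedFloor.levelSum_lt_of_supplies_ne hs hne
  have hd : ∀ f : Fin 4, 0 ≤ (y f).a - (x f).a := fun f => by have := level_le_of_supplies hs f; omega
  have hgj : 0 < (y g).a - (x g).a ∨ 0 < (y j).a - (x j).a := by omega
  have key : 0 < ((y 0).a - (x 0).a) + ((y 1).a - (x 1).a) + ((y 2).a - (x 2).a) + ((y 3).a - (x 3).a) := by
    rcases hgj with hg | hj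
    · exact sum4_pos_of_nonneg (d := fun f => (y f).a - (x f).a) hd hg
    · exact sum4_pos_of_nonneg (d := fun f => (y f).a - (x f).a) hd hj
  unfold levelSum
  omega

/-- every supported N-cell with a detecting block lies strictly above some supported P-cell in total level … -/
theorem exists_P_below {D : Design} (hdis : Disj D) (hr : RuleD D) {y : Cell} (hy : y ∈ D.suppN) {g j : Fin 4}
    (hgj : g ≠ j) (hdet : Detects y g j) : ∃ x ∈ D.suppP, levelSum x < levelSum y := by
  obtain ⟨x, hx, hs⟩ := ruleDN_any hr hy hgj hdet
  exact ⟨x, hx, levelSum_lt_of_supplies_ne hs fun hxy => hdis y hy (hxy ▸ hx)⟩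

/-- … and every supported P-cell with a detecting block lies strictly below some supported N-cell. -/
theorem exists_N_above {D : Design} (hdis : Disj D) (hr : RuleDP D) {x : Cell} (hx : x ∈ D.suppP) {g j : Fin 4}
    (hgj : g ≠ j) (hdet : Detects x g j) : ∃ y ∈ D.suppN, levelSum x < levelSum y := by
  obtain ⟨y, hy, hs⟩ := ruleDP_any hr hx hgj hdet
  exact ⟨y, hy, levelSum_lt_of_supplies_ne hs fun hxy => hdis x (hxy ▸ hy) hx⟩

/-! ## §5 Order-ideal Hall cuts (door 1) -/

/-- a cell predicate closed upward under `WeakLive` (globally) … -/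
def UpClosed (U : Cell → Prop) : Prop := ∀ x y : Cell, WeakLive x y → U x → U y

/-- … or only RELATIVE to the supports of `E` (what the Hall rows actually see): from a supported P-cell to a supported N-cell. -/
def UpClosedOn (E : Design) (U : Cell → Prop) : Prop := ∀ x ∈ E.suppP, ∀ y ∈ E.suppN, WeakLive x y → U x → U y

/-- the dual notion: closed downward from supported N-cells to supported P-cells. -/
def DownClosedOn (E : Design) (L : Cell → Prop) : Prop := ∀ x ∈ E.suppP, ∀ y ∈ E.suppN, WeakLive x y → L y → L x

theorem upClosedOn_of_upClosed (E : Design) {U : Cell → Prop} (hU : UpClosed U) : UpClosedOn E U :=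
  fun x _ y _ hw hx => hU x y hw hx

theorem upClosedOn_not_of_downClosedOn {E : Design} {L : Cell → Prop} (hL : DownClosedOn E L) : UpClosedOn E fun c => ¬ L c :=
  fun x hx y hy hw hnx hy' => hnx (hL x hx y hy hw hy')

theorem downClosedOn_not_of_upClosedOn {E : Design} {U : Cell → Prop} (hU : UpClosedOn E U) : DownClosedOn E fun c => ¬ U c :=
  fun x hx y hy hw hny hx' => hny (hU x hx y hy hw hx')

/-- the mass of the entries of `L` whose cell satisfies `U`. -/
def massOn (L : List (Cell × ℕ)) (U : Cell → Prop) [DecidablePred U] : ℕ :=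
  ((L.filter fun cm => decide (U cm.1)).map Prod.snd).sum

theorem upClosed_levelSum_ge (s : ℤ) : UpClosed fun c => s ≤ levelSum c :=
  fun _ _ hw hx => le_trans hx (levelSum_le_of_weakLive hw)

theorem upClosed_slot_ge (f : Fin 4) (s : ℤ) : UpClosed fun c => s ≤ (c f).a :=
  fun _ _ hw hx => le_trans hx (level_le_of_notDead (hw f))

theorem upClosed_and {U V : Cell → Prop} (hU : UpClosed U) (hV : UpClosed V) : UpClosed fun c => U c ∧ V c :=
  fun x y hw hx => ⟨hU x y hw hx.1, hV x y hw hx.2⟩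

theorem upClosed_or {U V : Cell → Prop} (hU : UpClosed U) (hV : UpClosed V) : UpClosed fun c => U c ∨ V c :=
  fun x y hw hx => hx.elim (fun h => Or.inl (hU x y hw h)) (fun h => Or.inr (hV x y hw h))

theorem upClosedOn_and {E : Design} {U V : Cell → Prop} (hU : UpClosedOn E U) (hV : UpClosedOn E V) :
    UpClosedOn E fun c => U c ∧ V c :=
  fun x hx y hy hw h => ⟨hU x hx y hy hw h.1, hV x hx y hy hw h.2⟩

theorem upClosedOn_or {E : Design} {U V : Cell → Prop} (hU : UpClosedOn E U) (hV : UpClosedOn E V) :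
    UpClosedOn E fun c => U c ∨ V c :=
  fun x hx y hy hw h => h.elim (fun h => Or.inl (hU x hx y hy hw h)) (fun h => Or.inr (hV x hx y hy hw h))

/-- bookkeeping: restricting the `U`-filter to positive entries, or padding it with zero entries, does not change the mass. -/
theorem mass_filter_and_pos (L : List (Cell × ℕ)) (U : Cell → Prop) [DecidablePred U] :
    ((L.filter fun cm => decide (U cm.1) && decide (0 < cm.2)).map Prod.snd).sum = massOn L U := by
  induction L with
  | nil => simp [massOn]
  | cons a t ih =>
    unfold massOn at ih ⊢
    by_cases ha : U a.1
    · by_cases h0 : a.2 = 0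
      · simp [ha, h0] at ih ⊢; omega
      · have hpos : 0 < a.2 := Nat.pos_of_ne_zero h0
        simp [ha, hpos] at ih ⊢; omega
    · simp [ha] at ih ⊢; omega

theorem mass_filter_or_zero (L : List (Cell × ℕ)) (U : Cell → Prop) [DecidablePred U] :
    ((L.filter fun cm => decide (U cm.1) || decide (cm.2 = 0)).map Prod.snd).sum = massOn L U := by
  induction L with
  | nil => simp [massOn]
  | cons a t ih =>
    unfold massOn at ih ⊢
    by_cases ha : U a.1
    · simp [ha] at ih ⊢; omega
    · by_cases h0 : a.2 = 0
      · simp [ha, h0] at ih ⊢; omega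
      · simp [ha, h0] at ih ⊢; omega

/-- **(D) the ORDER-IDEAL HALL CUT**: `0 < m_P(U) ⇒ m_P(U) + k ≤ m_N(U)` for every `U` up-closed relative to the supports. -/
theorem hallPlusUp_cut_on (E : Design) (k : ℕ) (hH : HallPlusUp E k) (U : Cell → Prop) [DecidablePred U] (hU : UpClosedOn E U)
    (hpos : 0 < massOn E.P U) : massOn E.P U + k ≤ massOn E.N U := by
  rw [← mass_filter_and_pos E.P U] at hpos ⊢
  rw [← mass_filter_or_zero E.N U]
  refine hH _ List.filter_sublist hpos _ List.filter_sublist ?_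
  rintro cn hcn ⟨cm, hcm, hw⟩
  rw [List.mem_filter] at hcm ⊢
  refine ⟨hcn, ?_⟩
  have hUm : U cm.1 ∧ 0 < cm.2 := by simpa using hcm.2
  by_cases hn0 : cn.2 = 0
  · simp [hn0]
  · have hyN : cn.1 ∈ E.suppN := (mem_suppN_iff E cn.1).mpr ⟨cn.2, hcn, Nat.pos_of_ne_zero hn0⟩
    have hxP : cm.1 ∈ E.suppP := (mem_suppP_iff E cm.1).mpr ⟨cm.2, hcm.1, hUm.2⟩
    have := hU cm.1 hxP cn.1 hyN hw hUm.1
    simp [this]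

theorem hallPlusUp_cut (E : Design) (k : ℕ) (hH : HallPlusUp E k) (U : Cell → Prop) [DecidablePred U] (hU : UpClosed U)
    (hpos : 0 < massOn E.P U) : massOn E.P U + k ≤ massOn E.N U :=
  hallPlusUp_cut_on E k hH U (upClosedOn_of_upClosed E hU) hpos

/-- the surplus-free cut from `HallUp`: `m_P(U) ≤ m_N(U)`. -/
theorem hallUp_cut_on (E : Design) (hH : HallUp E) (U : Cell → Prop) [DecidablePred U] (hU : UpClosedOn E U) :
    massOn E.P U ≤ massOn E.N U := by
  rw [← mass_filter_and_pos E.P U, ← mass_filter_or_zero E.N U]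
  refine hH _ List.filter_sublist _ List.filter_sublist ?_
  rintro cn hcn ⟨cm, hcm, hw⟩
  rw [List.mem_filter] at hcm ⊢
  refine ⟨hcn, ?_⟩
  have hUm : U cm.1 ∧ 0 < cm.2 := by simpa using hcm.2
  by_cases hn0 : cn.2 = 0
  · simp [hn0]
  · have hyN : cn.1 ∈ E.suppN := (mem_suppN_iff E cn.1).mpr ⟨cn.2, hcn, Nat.pos_of_ne_zero hn0⟩
    have hxP : cm.1 ∈ E.suppP := (mem_suppP_iff E cm.1).mpr ⟨cm.2, hcm.1, hUm.2⟩
    have := hU cm.1 hxP cn.1 hyN hw hUm.1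
    simp [this]

theorem hallUp_cut (E : Design) (hH : HallUp E) (U : Cell → Prop) [DecidablePred U] (hU : UpClosed U) :
    massOn E.P U ≤ massOn E.N U :=
  hallUp_cut_on E hH U (upClosedOn_of_upClosed E hU)

theorem massOn_add_massOn_not (L : List (Cell × ℕ)) (U : Cell → Prop) [DecidablePred U] :
    massOn L U + massOn L (fun c => ¬ U c) = (L.map Prod.snd).sum := by
  induction L with
  | nil => simp [massOn]
  | cons a t ih =>
    unfold massOn at ih ⊢
    by_cases ha : U a.1
    · simp [ha] at ih ⊢; omega
    · simp [ha] at ih ⊢; omega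

theorem massOn_le_total (L : List (Cell × ℕ)) (U : Cell → Prop) [DecidablePred U] : massOn L U ≤ (L.map Prod.snd).sum := by
  have := massOn_add_massOn_not L U; omega

/-- if every positive entry satisfies `U`, the `U`-mass is the whole mass. -/
theorem massOn_eq_total_of (L : List (Cell × ℕ)) (U : Cell → Prop) [DecidablePred U]
    (hL : ∀ cm ∈ L, 0 < cm.2 → U cm.1) : massOn L U = (L.map Prod.snd).sum := by
  induction L with
  | nil => simp [massOn]
  | cons a t ih =>
    have iht := ih (fun cm hcm => hL cm (List.mem_cons_of_mem a hcm))
    unfold massOn at iht ⊢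
    by_cases ha : U a.1
    · simp [ha] at iht ⊢; omega
    · have ha0 : a.2 = 0 := by
        by_contra hne
        exact ha (hL a List.mem_cons_self (Nat.pos_of_ne_zero hne))
      simp [ha, ha0] at iht ⊢; omega

/-- **(D′) the DOWN-SET HALL CUT**: on every `L` down-closed relative to the supports, the N-mass exceeds the P-mass by at most the rank:
`m_N(L) − m_P(L) ≤ Σ_N − Σ_P` (from `HallUp`) … -/
theorem hallUp_down_cut (E : Design) (hH : HallUp E) (L : Cell → Prop) [DecidablePred L] (hL : DownClosedOn E L) :
    (massOn E.N L : ℤ) - massOn E.P L ≤ E.rank := by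
  have hcut := hallUp_cut_on E hH (fun c => ¬ L c) (upClosedOn_not_of_downClosedOn hL)
  have hN := massOn_add_massOn_not E.N L
  have hP := massOn_add_massOn_not E.P L
  unfold Design.rank
  omega

/-- … and by at most `rank − k` from `HallPlusUp E k`, as soon as some positive P-entry lies OUTSIDE `L`. -/
theorem hallPlusUp_down_cut (E : Design) (k : ℕ) (hH : HallPlusUp E k) (L : Cell → Prop) [DecidablePred L]
    (hL : DownClosedOn E L) (hpos : 0 < massOn E.P fun c => ¬ L c) :
    (massOn E.N L : ℤ) - massOn E.P L + k ≤ E.rank := by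
  have hcut := hallPlusUp_cut_on E k hH (fun c => ¬ L c) (upClosedOn_not_of_downClosedOn hL) hpos
  have hN := massOn_add_massOn_not E.N L
  have hP := massOn_add_massOn_not E.P L
  unfold Design.rank
  omega

/-- **corollary: DEEP N-MASS IS BOUNDED BY THE RANK SURPLUS** — if every supported P-cell has total level `≥ s`, the N-entries of total
level `< s` weigh at most `Σ_N − Σ_P − k`. -/
theorem deepN_mass_le (E : Design) (k : ℕ) (hH : HallPlusUp E k) (s : ℤ) (hs : ∀ x ∈ E.suppP, s ≤ levelSum x)
    (hpos : 0 < (E.P.map Prod.snd).sum) :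
    massOn E.N (fun c => ¬ s ≤ levelSum c) + (E.P.map Prod.snd).sum + k ≤ (E.N.map Prod.snd).sum := by
  have hPU : massOn E.P (fun c => s ≤ levelSum c) = (E.P.map Prod.snd).sum := by
    apply massOn_eq_total_of
    intro cm hcm h0
    exact hs cm.1 ((mem_suppP_iff E cm.1).mpr ⟨cm.2, hcm, h0⟩)
  have hcut := hallPlusUp_cut E k hH (fun c => s ≤ levelSum c) (upClosed_levelSum_ge s) (by rw [hPU]; exact hpos)
  have hsplit := massOn_add_massOn_not E.N (fun c => s ≤ levelSum c)
  rw [hPU] at hcut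
  omega

/-! ## §6 The ring frame -/

/-- every support letter has co-level `≤ c` (`c = 2`: ring 2 of the register). -/
def RingLe (c : ℤ) (D : Design) : Prop := ∀ x ∈ D.suppN ++ D.suppP, ∀ f : Fin 4, (x f).colevel ≤ c

/-- some supported P-cell ∕ N-cell carries a letter of co-level exactly `c`. -/
def TouchesP (c : ℤ) (D : Design) : Prop := ∃ x ∈ D.suppP, ∃ f : Fin 4, (x f).colevel = c

def TouchesN (c : ℤ) (D : Design) : Prop := ∃ y ∈ D.suppN, ∃ f : Fin 4, (y f).colevel = c

theorem ringLe_mono {c c' : ℤ} (hcc : c ≤ c') {D : Design} (hR : RingLe c D) : RingLe c' D :=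
  fun x hx f => le_trans (hR x hx f) hcc

theorem ringLe_self {h : ℤ} {D : Design} (hA : D.OnAlphabet h) : RingLe h D :=
  fun x hx f => colevel_le_of_onAlphabet (hA x hx f)

/-- **(E) THE TOP RING IS A P-RING**: in a `RingLe c` room with `0 < c`, an N-letter of co-level `c` at slot `g` is the slot-`g` letter of a supported
P-cell different from the N-cell. -/
theorem touchesP_of_touchesN {h c : ℤ} {D : Design} (hA : D.OnAlphabet h) (hdis : Disj D) (hr : RuleD D) (hR : RingLe c D)
    (hc : 0 < c) {y : Cell} (hy : y ∈ D.suppN) {g : Fin 4} (hg : (y g).colevel = c) :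
    ∃ x ∈ D.suppP, x g = y g ∧ x ≠ y :=
  deepestN_mem_P hA hdis hr hy g (by rw [hg]; exact hc) fun x hx => by rw [hg]; exact hR x (mem_supp_of_memP D hx) g

theorem touchesP_of_touchesN' {h c : ℤ} {D : Design} (hA : D.OnAlphabet h) (hdis : Disj D) (hr : RuleD D) (hR : RingLe c D)
    (hc : 0 < c) (hN : TouchesN c D) : TouchesP c D := by
  obtain ⟨y, hy, g, hg⟩ := hN
  obtain ⟨x, hx, hxg, -⟩ := touchesP_of_touchesN hA hdis hr hR hc hy hg
  exact ⟨x, hx, g, by rw [hxg, hg]⟩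

/-- no supported N-cell carries two TOP-RING letters. -/
theorem ring_top_unique_N {h c : ℤ} {D : Design} (hA : D.OnAlphabet h) (hdis : Disj D) (hr : RuleD D) (hR : RingLe c D)
    (hc : 0 < c) {y : Cell} (hy : y ∈ D.suppN) {g j : Fin 4} (hgj : g ≠ j) (hg : (y g).colevel = c) (hj : (y j).colevel = c) :
    False :=
  deepest_unique_N hA hdis hr hy hgj (by rw [hg]; exact hc) (fun x hx => by rw [hg]; exact hR x (mem_supp_of_memP D hx) g)
    (fun x hx => by rw [hj]; exact hR x (mem_supp_of_memP D hx) j)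

/-- ring form of THREE LEGS: an N-cell touching the top ring `c` at slot `g` has, through every other slot `j`, a strict supplier whose slot-`j`
letter is STRICTLY deeper than its own (so its other letters have co-level `≤ c − 1`, and `|supp P| ≥ 3`). -/
theorem ring_top_three_legs {h c : ℤ} {D : Design} (hA : D.OnAlphabet h) (hdis : Disj D) (hr : RuleD D) (hR : RingLe c D)
    (hc : 0 < c) {y : Cell} (hy : y ∈ D.suppN) {g : Fin 4} (hg : (y g).colevel = c) (j : Fin 4) (hgj : g ≠ j) :
    ∃ x ∈ D.suppP, (∀ f : Fin 4, f ≠ j → x f = y f) ∧ NullStep (x j) (y j) ∧ x ≠ y ∧ (y j).colevel < (x j).colevel ∧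
      (x j).colevel ≤ c :=
  by
  obtain ⟨x, hx, hoff, hnull, hne, hlt⟩ := three_legs_of_deepestN hA hdis hr hy g (by rw [hg]; exact hc)
    (fun x hx => by rw [hg]; exact hR x (mem_supp_of_memP D hx) g) j hgj
  exact ⟨x, hx, hoff, hnull, hne, hlt, hR x (mem_supp_of_memP D hx) j⟩

/-- if ring `c + 1` is not touched on the P side, the design lives in the rings `≤ c`. -/
theorem ringLe_of_not_touchesP {h c : ℤ} {D : Design} (hA : D.OnAlphabet h) (hdis : Disj D) (hr : RuleD D) (hc : 0 ≤ c)
    (hR : RingLe (c + 1) D) (hn : ¬ TouchesP (c + 1) D) : RingLe c D := by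
  intro z hz f
  have hle := hR z hz f
  rcases lt_or_eq_of_le hle with hlt | heq
  · omega
  · exfalso
    rcases List.mem_append.mp hz with hN | hP
    · exact hn (touchesP_of_touchesN' hA hdis hr hR (by omega) ⟨z, hN, f, heq⟩)
    · exact hn ⟨z, hP, f, heq⟩

/-- an undetecting block on the alphabet is a HUB PAIR. -/
theorem hub_pair_of_not_detects {h : ℤ} {x : Cell} (hxA : ∀ f : Fin 4, (x f).OnAlphabet h) {j₁ j₂ : Fin 4}
    (hnd : ¬ Detects x j₁ j₂) : x j₁ = Letter.hub h ∧ x j₂ = Letter.hub h := by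
  unfold Detects at hnd
  push Not at hnd
  obtain ⟨h1, h2, h3, h4, -⟩ := hnd
  exact ⟨eq_hub_of_colevel_eq_zero (hxA j₁) ((colevel_eq_zero_iff _).mpr ⟨h1, h2⟩),
    eq_hub_of_colevel_eq_zero (hxA j₂) ((colevel_eq_zero_iff _).mpr ⟨h3, h4⟩)⟩

/-- **TWO TOPS (P side)**: a supported P-cell with top-ring letters at two slots `g₁ ≠ g₂` has an UNDETECTING complementary block — i.e. it is
`(top, top, hub, hub)` (`two_tops_P_hub`); its RULE-D witness through the complementary block would be an N-cell with two top-ring letters. -/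
theorem two_tops_P_not_detects {h c : ℤ} {D : Design} (hA : D.OnAlphabet h) (hdis : Disj D) (hr : RuleD D) (hR : RingLe c D)
    (hc : 0 < c) {x : Cell} (hx : x ∈ D.suppP) {g₁ g₂ j₁ j₂ : Fin 4} (hg : g₁ ≠ g₂) (hj : j₁ ≠ j₂)
    (h11 : j₁ ≠ g₁) (h12 : j₁ ≠ g₂) (h21 : j₂ ≠ g₁) (h22 : j₂ ≠ g₂)
    (ht1 : (x g₁).colevel = c) (ht2 : (x g₂).colevel = c) : ¬ Detects x j₁ j₂ := by
  intro hdet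
  obtain ⟨y, hy, hs⟩ := ruleDP_any hr.2 hx hj hdet
  have e1 : x g₁ = y g₁ := hs.1 g₁ h11.symm h21.symm
  have e2 : x g₂ = y g₂ := hs.1 g₂ h12.symm h22.symm
  exact ring_top_unique_N hA hdis hr hR hc hy hg (by rw [← e1, ht1]) (by rw [← e2, ht2])

theorem two_tops_P_hub {h c : ℤ} {D : Design} (hA : D.OnAlphabet h) (hdis : Disj D) (hr : RuleD D) (hR : RingLe c D)
    (hc : 0 < c) {x : Cell} (hx : x ∈ D.suppP) {g₁ g₂ j₁ j₂ : Fin 4} (hg : g₁ ≠ g₂) (hj : j₁ ≠ j₂)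
    (h11 : j₁ ≠ g₁) (h12 : j₁ ≠ g₂) (h21 : j₂ ≠ g₁) (h22 : j₂ ≠ g₂)
    (ht1 : (x g₁).colevel = c) (ht2 : (x g₂).colevel = c) : x j₁ = Letter.hub h ∧ x j₂ = Letter.hub h :=
  hub_pair_of_not_detects (hA x (mem_supp_of_memP D hx))
    (two_tops_P_not_detects hA hdis hr hR hc hx hg hj h11 h12 h21 h22 ht1 ht2)

/-- hence **NO supported P-cell has THREE top-ring letters**. -/
theorem not_three_tops_P {h c : ℤ} {D : Design} (hA : D.OnAlphabet h) (hdis : Disj D) (hr : RuleD D) (hR : RingLe c D)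
    (hc : 0 < c) {x : Cell} (hx : x ∈ D.suppP) {g₁ g₂ g₃ j : Fin 4} (h12 : g₁ ≠ g₂) (h13 : g₁ ≠ g₃) (h23 : g₂ ≠ g₃)
    (hj1 : j ≠ g₁) (hj2 : j ≠ g₂) (hj3 : j ≠ g₃)
    (ht1 : (x g₁).colevel = c) (ht2 : (x g₂).colevel = c) (ht3 : (x g₃).colevel = c) : False := by
  have hh := (two_tops_P_hub hA hdis hr hR hc hx h12 (Ne.symm hj3) (Ne.symm h13) (Ne.symm h23) hj1 hj2 ht1 ht2).1
  rw [hh, colevel_hub] at ht3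
  omega

/-- **TOP + SUB-TOP (N side)**: a supported N-cell with a top-ring letter at `g` and a letter of co-level `c − 1` at `s ≠ g` is
`(top, c − 1, hub, hub)`: its strict supplier through `s` is a P-cell with two tops. -/
theorem topN_subtop_hub {h c : ℤ} {D : Design} (hA : D.OnAlphabet h) (hdis : Disj D) (hr : RuleD D) (hR : RingLe c D)
    (hc : 0 < c) {y : Cell} (hy : y ∈ D.suppN) {g s j₁ j₂ : Fin 4} (hgs : g ≠ s) (hj : j₁ ≠ j₂)
    (h11 : j₁ ≠ g) (h12 : j₁ ≠ s) (h21 : j₂ ≠ g) (h22 : j₂ ≠ s)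
    (hg : (y g).colevel = c) (hsub : (y s).colevel = c - 1) : y j₁ = Letter.hub h ∧ y j₂ = Letter.hub h := by
  obtain ⟨x, hx, hoff, -, -, hlt, hle⟩ := ring_top_three_legs hA hdis hr hR hc hy hg s hgs
  have hxs : (x s).colevel = c := by omega
  have hxg : (x g).colevel = c := by rw [hoff g hgs, hg]
  obtain ⟨e1, e2⟩ := two_tops_P_hub hA hdis hr hR hc hx hgs hj h11 h12 h21 h22 hxg hxs
  exact ⟨by rw [← hoff j₁ h12, e1], by rw [← hoff j₂ h22, e2]⟩

/-! ## §6c THE SUM RULE — the type-local theory of RULE D ∧ Disj at the two top co-levels of a ring (pen: every ring, every height)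

For a supported cell and two of its slots with co-levels `p, q` (both `≤ c` in a ring-`≤ c` design):
* N side: `p + q ≤ 2c − 1` (`ring_top_unique_N`); `p + q = 2c − 1` ⇒ the other two letters are HUBS (`topN_subtop_hub`);
  `p + q = 2c − 2` ⇒ the other two letters are AXIS letters (`top_subsub_N_axis` for `{c, c−2}`, `two_subtops_N_axis` for `{c−1, c−1}`);
* P side: no three tops; `p + q = 2c` ⇒ the other two letters are hubs (`two_tops_P_hub`); `p + q = 2c − 1` ⇒ the other two are axis
  (`top_subtop_P_axis`).
MACHINE FACT (stdlib, `eng/gfpsym2.py`, bitmap + `D₄ × S₄` orbit engine, 5–25 s per ring): at height 14 the room cut out by these seven laws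
(the SUM-RULE ROOM) IS the greatest fixpoint of type-level RULE-D-with-distinct-supplier consistency computed from the FULL type room at rings
`c = 2, 3, 4, 5` (N 1041 ∕ 22913 ∕ 274721 ∕ 2106353, P 5009 ∕ 78817 ∕ 751137 ∕ 4782161 types; ring 2 = anomaly's ∕ g16's gfp digits
1041 ∕ 5009, fully charged 256 ∕ 2304) and is a post-fixpoint at ring 6 (N 11388209, P 22214833): NO further type-local law follows from RULE D ∧ Disj
alone at those rings — every further pruning of the type room needs (A1), Hall or the budget. -/

/-- four slots: a fourth slot avoiding three given ones. -/
theorem exists_fourth_slot (p q s : Fin 4) : ∃ t : Fin 4, t ≠ p ∧ t ≠ q ∧ t ≠ s := by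
  revert p q s; decide

/-- a ONE-STEP null move down from an AXIS letter starts at an axis letter (on the alphabet). -/
theorem axis_of_nullStep_axis_one {h : ℤ} {ℓ₀ ℓ : Letter} (h₀ : ℓ₀.OnAlphabet h) (hℓ : ℓ.OnAlphabet h) (hs : NullStep ℓ₀ ℓ)
    (hd : ℓ.a = ℓ₀.a + 1) (hax : ℓ₀.x * ℓ₀.y = 0) : ℓ.x * ℓ.y = 0 := by
  have e₀ := colevel_eq_of_onAlphabet h₀
  have e := colevel_eq_of_onAlphabet hℓ
  have hx := abs_nonneg ℓ.x
  have hy := abs_nonneg ℓ.y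
  rcases nullStep_axial_onAlphabet h₀ hℓ hs (by omega) with ⟨h1, h2⟩ | ⟨h1, h2⟩
  · rcases mul_eq_zero.mp hax with h0 | h0
    · exfalso
      rw [h0, abs_zero] at h2
      omega
    · rw [h1, h0, mul_zero]
  · rcases mul_eq_zero.mp hax with h0 | h0
    · rw [h1, h0, zero_mul]
    · exfalso
      rw [h0, abs_zero] at h2
      omega

theorem hub_axis (h : ℤ) : (Letter.hub h).x * (Letter.hub h).y = 0 := by
  simp [Letter.hub]

/-- **P (c, c−1) ⇒ AXIS**: a supported P-cell with a top-ring letter at `g` and a co-level-`(c−1)` letter at `j ≠ g` has AXIS letters at the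
other two slots — its RULE-D witness through the other block keeps top and sub-top, so is `(top, c−1, hub, hub)` (`topN_subtop_hub`), and a letter
equal to or null-below the hub is an axis letter. -/
theorem top_subtop_P_axis {h c : ℤ} {D : Design} (hA : D.OnAlphabet h) (hdis : Disj D) (hr : RuleD D) (hR : RingLe c D)
    (hc : 2 ≤ c) {x : Cell} (hx : x ∈ D.suppP) {g j s k : Fin 4} (hgj : g ≠ j) (hsg : s ≠ g) (hsj : s ≠ j)
    (hkg : k ≠ g) (hkj : k ≠ j) (hsk : s ≠ k)
    (hg : (x g).colevel = c) (hjc : (x j).colevel = c - 1) : (x s).x * (x s).y = 0 := by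
  by_cases hdet : Detects x s k
  · obtain ⟨y, hy, hsup⟩ := ruleDP_any hr.2 hx hsk hdet
    have eg : x g = y g := hsup.1 g hsg.symm hkg.symm
    have ej : x j = y j := hsup.1 j hsj.symm hkj.symm
    have hyg : (y g).colevel = c := by rw [← eg, hg]
    have hyj : (y j).colevel = c - 1 := by rw [← ej, hjc]
    obtain ⟨hys, -⟩ := topN_subtop_hub hA hdis hr hR (by omega) hy hgj hsk hsg hsj hkg hkj hyg hyj
    rcases hsup.2.1 with hxs | hns
    · rw [hxs, hys]; exact hub_axis h
    · rw [hys] at hns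
      exact ((nullStep_hub_iff (hA x (mem_supp_of_memP D hx) s)).mp hns).2
  · rw [(hub_pair_of_not_detects (hA x (mem_supp_of_memP D hx)) hdet).1]
    exact hub_axis h

/-- **N (c−1, c−1) ⇒ AXIS**: a supported N-cell with two co-level-`(c−1)` letters at `j ≠ k` has axis letters at the other two slots — its
strict supplier through `(j, k)` deepens one of them to a top: with the other kept it is a `(c, c−1)` P-cell (axis elsewhere), with both deepened a
two-top P-cell (hubs elsewhere). -/
theorem two_subtops_N_axis {h c : ℤ} {D : Design} (hA : D.OnAlphabet h) (hdis : Disj D) (hr : RuleD D) (hR : RingLe c D)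
    (hc : 2 ≤ c) {y : Cell} (hy : y ∈ D.suppN) {j k s : Fin 4} (hjk : j ≠ k) (hsj : s ≠ j) (hsk : s ≠ k)
    (hj : (y j).colevel = c - 1) (hk : (y k).colevel = c - 1) : (y s).x * (y s).y = 0 := by
  have hdet : Detects y j k := detects_of_colevel_pos k (by rw [hj]; omega)
  obtain ⟨x, hx, hsup⟩ := ruleDN_any hr hy hjk hdet
  have hxy : x ≠ y := fun e => hdis y hy (e ▸ hx)
  have hxA := hA x (mem_supp_of_memP D hx)
  have hyA := hA y (mem_supp_of_memN D hy)
  -- the generic step: `p` deepened (hence a top), `q` kept or deepened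
  have key : ∀ {p q : Fin 4}, p ≠ q → s ≠ p → s ≠ q → (y p).colevel = c - 1 → (y q).colevel = c - 1 →
      NullStep (x p) (y p) → (x q = y q ∨ NullStep (x q) (y q)) → (∀ f : Fin 4, f ≠ p → f ≠ q → x f = y f) →
      (y s).x * (y s).y = 0 := by
    intro p q hpq hsp hsq hp hq hnp hq' hoff
    have hcp : (x p).colevel = c := by
      have h1 := nullStep_colevel_lt (hxA p) (hyA p) hnp
      have h2 := hR x (mem_supp_of_memP D hx) p
      omega
    obtain ⟨t, htp, htq, hts⟩ := exists_fourth_slot p q s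
    rcases hq' with heq | hnq
    · have hxq : (x q).colevel = c - 1 := by rw [heq, hq]
      have := top_subtop_P_axis hA hdis hr hR hc hx hpq hsp hsq htp htq (Ne.symm hts) hcp hxq
      rwa [hoff s hsp hsq] at this
    · have hcq : (x q).colevel = c := by
        have h1 := nullStep_colevel_lt (hxA q) (hyA q) hnq
        have h2 := hR x (mem_supp_of_memP D hx) q
        omega
      have hh := (two_tops_P_hub hA hdis hr hR (by omega) hx hpq (Ne.symm hts) hsp hsq htp htq hcp hcq).1
      rw [← hoff s hsp hsq, hh]
      exact hub_axis h
  rcases hsup.2.1 with hej | hnj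
  · rcases hsup.2.2 with hek | hnk
    · exact absurd (eq_of_supplies_eq hsup hej hek) hxy
    · exact key hjk.symm hsk hsj hk hj hnk (Or.inl hej) (fun f h1 h2 => hsup.1 f h2 h1)
  · exact key hjk hsj hsk hj hk hnj hsup.2.2 hsup.1

/-- **N (c, c−2) ⇒ AXIS**: a supported N-cell with a top-ring letter at `g` and a co-level-`(c−2)` letter at `j ≠ g` has axis letters at the other
two slots — its supplier through `(g, j)` keeps the top (nothing is deeper) and deepens slot `j` to co-level `c − 1` (then `top_subtop_P_axis`) or
`c` (then `two_tops_P_hub`). -/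
theorem top_subsub_N_axis {h c : ℤ} {D : Design} (hA : D.OnAlphabet h) (hdis : Disj D) (hr : RuleD D) (hR : RingLe c D)
    (hc : 2 ≤ c) {y : Cell} (hy : y ∈ D.suppN) {g j s : Fin 4} (hgj : g ≠ j) (hsg : s ≠ g) (hsj : s ≠ j)
    (hg : (y g).colevel = c) (hj : (y j).colevel = c - 2) : (y s).x * (y s).y = 0 := by
  have hdet : Detects y g j := detects_of_colevel_pos j (by rw [hg]; omega)
  obtain ⟨x, hx, hsup⟩ := ruleDN_any hr hy hgj hdet
  have hxy : x ≠ y := fun e => hdis y hy (e ▸ hx)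
  have hxA := hA x (mem_supp_of_memP D hx)
  have hyA := hA y (mem_supp_of_memN D hy)
  have eg : x g = y g := by
    rcases hsup.2.1 with he | hn
    · exact he
    · exfalso
      have h1 := nullStep_colevel_lt (hxA g) (hyA g) hn
      have h2 := hR x (mem_supp_of_memP D hx) g
      omega
  have hnj : NullStep (x j) (y j) := by
    rcases hsup.2.2 with he | hn
    · exact absurd (eq_of_supplies_eq hsup eg he) hxy
    · exact hn
  have hxg : (x g).colevel = c := by rw [eg, hg]
  have h1 := nullStep_colevel_lt (hxA j) (hyA j) hnj
  have h2 := hR x (mem_supp_of_memP D hx) j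
  obtain ⟨t, htg, htj, hts⟩ := exists_fourth_slot g j s
  by_cases htop : (x j).colevel = c
  · have hh := (two_tops_P_hub hA hdis hr hR (by omega) hx hgj (Ne.symm hts) hsg hsj htg htj hxg htop).1
    rw [← hsup.1 s hsg hsj, hh]
    exact hub_axis h
  · have hxj : (x j).colevel = c - 1 := by omega
    have := top_subtop_P_axis hA hdis hr hR hc hx hgj hsg hsj htg htj (Ne.symm hts) hxg hxj
    rwa [hsup.1 s hsg hsj] at this

/-- **THE SUM RULE, N side.** -/
theorem sum_rule_N_lt {h c : ℤ} {D : Design} (hA : D.OnAlphabet h) (hdis : Disj D) (hr : RuleD D) (hR : RingLe c D)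
    (hc : 0 < c) {y : Cell} (hy : y ∈ D.suppN) {j k : Fin 4} (hjk : j ≠ k) : (y j).colevel + (y k).colevel < 2 * c := by
  have h1 := hR y (mem_supp_of_memN D hy) j
  have h2 := hR y (mem_supp_of_memN D hy) k
  by_contra hge
  exact ring_top_unique_N hA hdis hr hR hc hy hjk (by omega) (by omega)

theorem sum_rule_N_hub {h c : ℤ} {D : Design} (hA : D.OnAlphabet h) (hdis : Disj D) (hr : RuleD D) (hR : RingLe c D)
    (hc : 0 < c) {y : Cell} (hy : y ∈ D.suppN) {j k s : Fin 4} (hjk : j ≠ k) (hsj : s ≠ j) (hsk : s ≠ k)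
    (hsum : (y j).colevel + (y k).colevel = 2 * c - 1) : y s = Letter.hub h := by
  have h1 := hR y (mem_supp_of_memN D hy) j
  have h2 := hR y (mem_supp_of_memN D hy) k
  obtain ⟨t, htj, htk, hts⟩ := exists_fourth_slot j k s
  rcases (show ((y j).colevel = c ∧ (y k).colevel = c - 1) ∨ ((y j).colevel = c - 1 ∧ (y k).colevel = c) by omega) with
    ⟨hj, hk⟩ | ⟨hj, hk⟩
  · exact (topN_subtop_hub hA hdis hr hR hc hy hjk (Ne.symm hts) hsj hsk htj htk hj hk).1
  · exact (topN_subtop_hub hA hdis hr hR hc hy hjk.symm (Ne.symm hts) hsk hsj htk htj hk hj).1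

theorem sum_rule_N_axis {h c : ℤ} {D : Design} (hA : D.OnAlphabet h) (hdis : Disj D) (hr : RuleD D) (hR : RingLe c D)
    (hc : 2 ≤ c) {y : Cell} (hy : y ∈ D.suppN) {j k s : Fin 4} (hjk : j ≠ k) (hsj : s ≠ j) (hsk : s ≠ k)
    (hsum : (y j).colevel + (y k).colevel = 2 * c - 2) : (y s).x * (y s).y = 0 := by
  have h1 := hR y (mem_supp_of_memN D hy) j
  have h2 := hR y (mem_supp_of_memN D hy) k
  rcases (show ((y j).colevel = c ∧ (y k).colevel = c - 2) ∨ ((y j).colevel = c - 2 ∧ (y k).colevel = c) ∨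
      ((y j).colevel = c - 1 ∧ (y k).colevel = c - 1) by omega) with ⟨hj, hk⟩ | ⟨hj, hk⟩ | ⟨hj, hk⟩
  · exact top_subsub_N_axis hA hdis hr hR hc hy hjk hsj hsk hj hk
  · exact top_subsub_N_axis hA hdis hr hR hc hy hjk.symm hsk hsj hk hj
  · exact two_subtops_N_axis hA hdis hr hR hc hy hjk hsj hsk hj hk

/-- **THE SUM RULE, P side.** -/
theorem sum_rule_P_hub {h c : ℤ} {D : Design} (hA : D.OnAlphabet h) (hdis : Disj D) (hr : RuleD D) (hR : RingLe c D)
    (hc : 0 < c) {x : Cell} (hx : x ∈ D.suppP) {j k s : Fin 4} (hjk : j ≠ k) (hsj : s ≠ j) (hsk : s ≠ k)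
    (hsum : (x j).colevel + (x k).colevel = 2 * c) : x s = Letter.hub h := by
  have h1 := hR x (mem_supp_of_memP D hx) j
  have h2 := hR x (mem_supp_of_memP D hx) k
  obtain ⟨t, htj, htk, hts⟩ := exists_fourth_slot j k s
  exact (two_tops_P_hub hA hdis hr hR hc hx hjk (Ne.symm hts) hsj hsk htj htk (by omega) (by omega)).1

theorem sum_rule_P_axis {h c : ℤ} {D : Design} (hA : D.OnAlphabet h) (hdis : Disj D) (hr : RuleD D) (hR : RingLe c D)
    (hc : 2 ≤ c) {x : Cell} (hx : x ∈ D.suppP) {j k s : Fin 4} (hjk : j ≠ k) (hsj : s ≠ j) (hsk : s ≠ k)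
    (hsum : (x j).colevel + (x k).colevel = 2 * c - 1) : (x s).x * (x s).y = 0 := by
  have h1 := hR x (mem_supp_of_memP D hx) j
  have h2 := hR x (mem_supp_of_memP D hx) k
  obtain ⟨t, htj, htk, hts⟩ := exists_fourth_slot j k s
  rcases (show ((x j).colevel = c ∧ (x k).colevel = c - 1) ∨ ((x j).colevel = c - 1 ∧ (x k).colevel = c) by omega) with
    ⟨hj, hk⟩ | ⟨hj, hk⟩
  · exact top_subtop_P_axis hA hdis hr hR hc hx hjk hsj hsk htj htk (Ne.symm hts) hj hk
  · exact top_subtop_P_axis hA hdis hr hR hc hx hjk.symm hsk hsj htk htj (Ne.symm hts) hk hj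

/-- no supported P-cell has three top-ring letters, in SUM form: three slots of co-level `c` are impossible (= `not_three_tops_P`). -/
theorem sum_rule_P_three {h c : ℤ} {D : Design} (hA : D.OnAlphabet h) (hdis : Disj D) (hr : RuleD D) (hR : RingLe c D)
    (hc : 0 < c) {x : Cell} (hx : x ∈ D.suppP) {g₁ g₂ g₃ : Fin 4} (h12 : g₁ ≠ g₂) (h13 : g₁ ≠ g₃) (h23 : g₂ ≠ g₃)
    (ht1 : (x g₁).colevel = c) (ht2 : (x g₂).colevel = c) (ht3 : (x g₃).colevel = c) : False := by
  obtain ⟨t, h1, h2, h3⟩ := exists_fourth_slot g₁ g₂ g₃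
  exact not_three_tops_P hA hdis hr hR hc hx h12 h13 h23 h1 h2 h3 ht1 ht2 ht3

/-- the TOP SHELL is a DOWN-SET: below a supported cell touching ring `c` (weakly live, from a supported P-cell) one touches ring `c` at the same slot. -/
theorem downClosedOn_touches {h c : ℤ} {D : Design} (hA : D.OnAlphabet h) (hR : RingLe c D) :
    DownClosedOn D fun z => ∃ f : Fin 4, (z f).colevel = c := by
  rintro x hx y hy hw ⟨f, hf⟩
  refine ⟨f, ?_⟩
  have hxA := hA x (mem_supp_of_memP D hx) f
  have hyA := hA y (mem_supp_of_memN D hy) f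
  rcases hw f with he | ⟨hlt, -⟩
  · rw [he, hf]
  · exfalso
    have e1 := colevel_eq_of_onAlphabet hxA
    have e2 := colevel_eq_of_onAlphabet hyA
    have h3 := hR x (mem_supp_of_memP D hx) f
    omega

/-- **THE TOP SHELL'S N-EXCESS IS AT MOST THE RANK**: `m_N(touch c) − m_P(touch c) ≤ Σ_N − Σ_P` (door 1 `HallUp`) … -/
theorem top_shell_excess_le_rank {h c : ℤ} {D : Design} (hA : D.OnAlphabet h) (hR : RingLe c D) (hH : HallUp D) :
    (massOn D.N (fun z => ∃ f : Fin 4, (z f).colevel = c) : ℤ) - massOn D.P (fun z => ∃ f : Fin 4, (z f).colevel = c) ≤ D.rank :=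
  hallUp_down_cut D hH _ (downClosedOn_touches hA hR)

/-- … and at most `rank − k` under `HallPlusUp D k` when some positive P-entry avoids ring `c`. -/
theorem top_shell_excess_le_rank_sub {h c : ℤ} {D : Design} (hA : D.OnAlphabet h) (hR : RingLe c D) (k : ℕ) (hH : HallPlusUp D k)
    (hpos : 0 < massOn D.P fun z => ¬ ∃ f : Fin 4, (z f).colevel = c) :
    (massOn D.N (fun z => ∃ f : Fin 4, (z f).colevel = c) : ℤ) - massOn D.P (fun z => ∃ f : Fin 4, (z f).colevel = c) + k ≤ D.rank :=
  hallPlusUp_down_cut D k hH _ (downClosedOn_touches hA hR) hpos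

/-- `μ ≠ 0` forces a FULLY CHARGED supported cell (contrapositive of `LeggedFloor.cellCoef_eeee_eq_zero_of_not_full`). -/
theorem exists_full_of_mu_ne {h : ℤ} (D : Design) (hA : D.OnAlphabet h) (hμ : D.mu ≠ 0) :
    ∃ c ∈ D.suppN ++ D.suppP, FullBelow h c := by
  by_contra hno
  push Not at hno
  apply hμ
  have hN : (D.N.map fun cm => (cm.2 : GaussianInt) * cellCoef cm.1 Word.eeee).sum = 0 := by
    apply listSum_eeee_eq_zero
    intro cm hcm h0
    have hmem : cm.1 ∈ D.suppN := List.mem_map.mpr ⟨cm, List.mem_filter.mpr ⟨hcm, by simpa using h0⟩, rfl⟩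
    exact cellCoef_eeee_eq_zero_of_not_full (hA cm.1 (mem_supp_of_memN D hmem)) (hno cm.1 (mem_supp_of_memN D hmem))
  have hP : (D.P.map fun cm => (cm.2 : GaussianInt) * cellCoef cm.1 Word.eeee).sum = 0 := by
    apply listSum_eeee_eq_zero
    intro cm hcm h0
    have hmem : cm.1 ∈ D.suppP := List.mem_map.mpr ⟨cm, List.mem_filter.mpr ⟨hcm, by simpa using h0⟩, rfl⟩
    exact cellCoef_eeee_eq_zero_of_not_full (hA cm.1 (mem_supp_of_memP D hmem)) (hno cm.1 (mem_supp_of_memP D hmem))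
  show D.T Word.eeee = 0
  rw [Design.T, hN, hP, sub_zero]

/-- a fully charged cell on the alphabet has all co-levels `≥ 1`. -/
theorem one_le_colevel_of_full {h : ℤ} {c : Cell} (hc : ∀ f : Fin 4, (c f).OnAlphabet h) (hfull : FullBelow h c) (f : Fin 4) :
    1 ≤ (c f).colevel := by
  have := (level_lt_iff_colevel_pos (hc f)).mp (hfull f)
  omega

/-- **the RING ROOM**: the v4.1 room of `RuleDPlate.SPlusB h Budget` restricted to designs living in the rings `≤ c`. -/
def RingRoomB (h : ℤ) (Budget : Design → Prop) (c : ℤ) : Prop :=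
  ∀ D : Design, D.OnAlphabet h → Disj D → D.A1 → RuleD D → HallUp D → HallPlusUp D 8 → D.mu ≠ 0 → Budget D → RingLe c D → False

/-- **the RING SHELL**: the same room restricted to designs of the rings `≤ c` that TOUCH ring `c` on the P side (by (E), equivalently on either side). -/
def RingShellB (h : ℤ) (Budget : Design → Prop) (c : ℤ) : Prop :=
  ∀ D : Design, D.OnAlphabet h → Disj D → D.A1 → RuleD D → HallUp D → HallPlusUp D 8 → D.mu ≠ 0 → Budget D → RingLe c D →
    TouchesP c D → False

theorem ringRoomB_anti {h : ℤ} {Budget : Design → Prop} {c c' : ℤ} (hcc : c ≤ c') (H : RingRoomB h Budget c') :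
    RingRoomB h Budget c :=
  fun D hA hd h1 hr hu hp hμ hb hR => H D hA hd h1 hr hu hp hμ hb (ringLe_mono hcc hR)

theorem ringShellB_of_ringRoomB {h : ℤ} {Budget : Design → Prop} {c : ℤ} (H : RingRoomB h Budget c) : RingShellB h Budget c :=
  fun D hA hd h1 hr hu hp hμ hb hR _ => H D hA hd h1 hr hu hp hμ hb hR

/-- `S⁺_B(h)` IS the full ring room `c = h`. -/
theorem sPlusB_iff_ringRoomB (h : ℤ) (Budget : Design → Prop) : SPlusB h Budget ↔ RingRoomB h Budget h :=
  ⟨fun H D hA hd h1 hr hu hp hμ hb _ => H D hA hd h1 hr hu hp hμ hb,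
    fun H D hA hd h1 hr hu hp hμ hb => H D hA hd h1 hr hu hp hμ hb (ringLe_self hA)⟩

theorem ringRoomB_of_sPlusB {h : ℤ} {Budget : Design → Prop} (H : SPlusB h Budget) (c : ℤ) : RingRoomB h Budget c :=
  fun D hA hd h1 hr hu hp hμ hb _ => H D hA hd h1 hr hu hp hμ hb

/-- **RING 0 IS EMPTY** at every height, for every budget: `μ ≠ 0` needs a fully charged cell. -/
theorem ringRoomB_zero (h : ℤ) (Budget : Design → Prop) : RingRoomB h Budget 0 := by
  intro D hA _ _ _ _ _ hμ _ hR
  obtain ⟨c, hc, hfull⟩ := exists_full_of_mu_ne D hA hμ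
  have h1 := one_le_colevel_of_full (hA c hc) hfull 0
  have h0 := hR c hc 0
  omega

/-- **THE LEDGER STEP**: closing ring `c + 1` on top of the rings `≤ c` is exactly closing the `c + 1` shell. -/
theorem ringRoomB_succ_iff (h : ℤ) (Budget : Design → Prop) {c : ℤ} (hc : 0 ≤ c) :
    RingRoomB h Budget (c + 1) ↔ RingRoomB h Budget c ∧ RingShellB h Budget (c + 1) := by
  constructor
  · intro H
    exact ⟨ringRoomB_anti (by omega) H, ringShellB_of_ringRoomB H⟩
  · rintro ⟨HR, HS⟩ D hA hd h1 hr hu hp hμ hb hR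
    by_cases ht : TouchesP (c + 1) D
    · exact HS D hA hd h1 hr hu hp hμ hb hR ht
    · exact HR D hA hd h1 hr hu hp hμ hb (ringLe_of_not_touchesP hA hd hr hc hR ht)

/-- the ledger as a finite conjunction: `S⁺_B(h) ↔ ⋀_{1 ≤ c ≤ h} RingShellB h B c` — stated as: all shells up to `c` close the ring room `c`. -/
theorem ringRoomB_of_shells (h : ℤ) (Budget : Design → Prop) :
    ∀ n : ℕ, (∀ c : ℤ, 1 ≤ c → c ≤ n → RingShellB h Budget c) → RingRoomB h Budget n := by
  intro n
  induction n with
  | zero => intro _; exact_mod_cast ringRoomB_zero h Budget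
  | succ m ih =>
    intro hS
    have hm : RingRoomB h Budget (m : ℤ) := ih fun c h1 h2 => hS c h1 (by push_cast; omega)
    have step := (ringRoomB_succ_iff h Budget (c := (m : ℤ)) (by positivity)).mpr
      ⟨hm, hS ((m : ℤ) + 1) (by omega) (by push_cast; omega)⟩
    exact_mod_cast step

theorem sPlusB_of_shells {h : ℤ} (hh : 0 ≤ h) (Budget : Design → Prop)
    (hS : ∀ c : ℤ, 1 ≤ c → c ≤ h → RingShellB h Budget c) : SPlusB h Budget := by
  rw [sPlusB_iff_ringRoomB]
  obtain ⟨n, rfl⟩ := Int.eq_ofNat_of_zero_le hh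
  exact ringRoomB_of_shells (n : ℤ) Budget n hS

theorem shells_of_sPlusB {h : ℤ} {Budget : Design → Prop} (H : SPlusB h Budget) (c : ℤ) : RingShellB h Budget c :=
  ringShellB_of_ringRoomB (ringRoomB_of_sPlusB H c)

/-- the copies form of record: `SPlusB 14 (CopiesLe 116)` is the conjunction of the fourteen shells `RingShellB 14 (CopiesLe 116) c`, `1 ≤ c ≤ 14`
(the register: `c = 1` closed — `RingTwoEffEmpty`; `c = 2` = «ring 2»; `c ≥ 3` = «rings ≥ 3»). -/
theorem sPlusB_fourteen_iff_shells (B : ℕ) :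
    SPlusB 14 (CopiesLe B) ↔ ∀ c : ℤ, 1 ≤ c → c ≤ 14 → RingShellB 14 (CopiesLe B) c :=
  ⟨fun H c _ _ => shells_of_sPlusB H c, fun hS => sPlusB_of_shells (by norm_num) (CopiesLe B) hS⟩


/-! ## §7 The dictionary: RING `c` AT HEIGHT `h` = HEIGHT `c` OF THE TOWER (live room; cf. `HeightTower.ringsEmpty_iff_nonex` for the (A4) room) -/

theorem touchesP_shiftD (t c : ℤ) (D : Design) : TouchesP c (shiftD t D) ↔ TouchesP c D := by
  unfold TouchesP
  rw [suppP_shift]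
  constructor
  · rintro ⟨x', hx', f, hf⟩
    obtain ⟨x, hx, rfl⟩ := List.mem_map.mp hx'
    exact ⟨x, hx, f, by simpa [shiftCell] using hf⟩
  · rintro ⟨x, hx, f, hf⟩
    exact ⟨shiftCell t x, List.mem_map.mpr ⟨x, hx, rfl⟩, f, by simpa [shiftCell] using hf⟩

theorem ringLe_shiftD (t c : ℤ) {D : Design} (hR : RingLe c D) : RingLe c (shiftD t D) :=
  colevel_shift D t c hR

/-- a height-`h` design of the rings `≤ c` shifts DOWN to the height-`c` alphabet … -/
theorem onAlphabet_shift_down {h c : ℤ} {D : Design} (hA : D.OnAlphabet h) (hR : RingLe c D) :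
    (shiftD (c - h) D).OnAlphabet c := by
  have hA' := onAlphabet_shift D h (c - h) hA (fun c' hc' f => by
    have e1 := colevel_eq_of_onAlphabet (hA c' hc' f)
    have h2 := hR c' hc' f
    omega)
  have e : h + (c - h) = c := by ring
  rw [e] at hA'
  exact hA'

/-- … and a height-`c` design shifts UP into the rings `≤ c` of the height-`h` alphabet. -/
theorem onAlphabet_shift_up' {h c : ℤ} (hch : c ≤ h) {D : Design} (hA : D.OnAlphabet c) :
    (shiftD (h - c) D).OnAlphabet h ∧ RingLe c (shiftD (h - c) D) := by
  refine ⟨?_, ringLe_shiftD _ _ (ringLe_self hA)⟩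
  have hA' := onAlphabet_shift_up D c (h - c) (by linarith) hA
  have e : c + (h - c) = h := by ring
  rw [e] at hA'
  exact hA'

/-- **RING ROOM = LOW-HEIGHT `S⁺`**: for a shift-invariant budget and `c ≤ h`, `RingRoomB h Budget c ↔ SPlusB c Budget`. -/
theorem ringRoomB_iff_sPlusB {h c : ℤ} (hch : c ≤ h) {Budget : Design → Prop}
    (hB : ∀ (t : ℤ) (D : Design), Budget (shiftD t D) ↔ Budget D) : RingRoomB h Budget c ↔ SPlusB c Budget := by
  constructor
  · intro H D hA hd h1 hr hu hp hμ hb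
    obtain ⟨hA', hR'⟩ := onAlphabet_shift_up' hch hA
    exact H (shiftD (h - c) D) hA' ((disj_shiftD _ D).mpr hd) (a1_shiftD _ D h1) ((ruleD_shiftD _ D).mpr hr)
      ((hallUp_shiftD _ D).mpr hu) ((hallPlusUp_shiftD _ D 8).mpr hp) (by rw [mu_shiftD]; exact hμ) ((hB _ D).mpr hb) hR'
  · intro H D hA hd h1 hr hu hp hμ hb hR
    exact H (shiftD (c - h) D) (onAlphabet_shift_down hA hR) ((disj_shiftD _ D).mpr hd) (a1_shiftD _ D h1)
      ((ruleD_shiftD _ D).mpr hr) ((hallUp_shiftD _ D).mpr hu) ((hallPlusUp_shiftD _ D 8).mpr hp)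
      (by rw [mu_shiftD]; exact hμ) ((hB _ D).mpr hb)

/-- **RING SHELL = FLOOR-FREENESS ONE HEIGHT DOWN THE DICTIONARY**: for `1 ≤ c ≤ h`, `RingShellB h Budget c ↔ FloorFreeB c Budget`
(a letter of co-level `c` at height `c` is a FLOOR letter `a = 0`; the N-side floor letters are P-side floor letters by (E)). -/
theorem ringShellB_iff_floorFreeB {h c : ℤ} (h1c : 1 ≤ c) (hch : c ≤ h) {Budget : Design → Prop}
    (hB : ∀ (t : ℤ) (D : Design), Budget (shiftD t D) ↔ Budget D) : RingShellB h Budget c ↔ FloorFreeB c Budget := by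
  constructor
  · intro H D hA h1 hdoor hu hp hμ hb z hz f
    have hzA := hA z hz f
    by_contra hnot
    have ha0 : (z f).a = 0 := by have := hzA.2; omega
    have hcol : (z f).colevel = c := by have := colevel_eq_of_onAlphabet hzA; omega
    have hT : TouchesP c D := by
      rcases List.mem_append.mp hz with hN | hP
      · exact touchesP_of_touchesN' hA hdoor.1 hdoor.2 (ringLe_self hA) (by omega) ⟨z, hN, f, hcol⟩
      · exact ⟨z, hP, f, hcol⟩
    obtain ⟨hA', hR'⟩ := onAlphabet_shift_up' hch hA
    exact H (shiftD (h - c) D) hA' ((disj_shiftD _ D).mpr hdoor.1) (a1_shiftD _ D h1) ((ruleD_shiftD _ D).mpr hdoor.2)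
      ((hallUp_shiftD _ D).mpr hu) ((hallPlusUp_shiftD _ D 8).mpr hp) (by rw [mu_shiftD]; exact hμ) ((hB _ D).mpr hb) hR'
      ((touchesP_shiftD _ _ D).mpr hT)
  · intro H D hA hd h1 hr hu hp hμ hb hR hT
    have hpos := H (shiftD (c - h) D) (onAlphabet_shift_down hA hR) (a1_shiftD _ D h1)
      ⟨(disj_shiftD _ D).mpr hd, (ruleD_shiftD _ D).mpr hr⟩ ((hallUp_shiftD _ D).mpr hu) ((hallPlusUp_shiftD _ D 8).mpr hp)
      (by rw [mu_shiftD]; exact hμ) ((hB _ D).mpr hb)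
    obtain ⟨x, hx, f, hf⟩ := hT
    have hxA := hA x (mem_supp_of_memP D hx) f
    have hx' : shiftCell (c - h) x ∈ (shiftD (c - h) D).suppN ++ (shiftD (c - h) D).suppP := by
      rw [suppN_shift, suppP_shift, ← List.map_append]
      exact List.mem_map.mpr ⟨x, mem_supp_of_memP D hx, rfl⟩
    have h0 := hpos _ hx' f
    have e1 := colevel_eq_of_onAlphabet hxA
    simp only [shiftCell, shiftL] at h0
    omega

/-- THE REGISTER'S DICTIONARY at `h = 14`, copies budget `B`: «ring 2 closed» = `S⁺(2)`, and for every `c` the shell `c` = `FloorFreeB c`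
(so «rings ≥ 3 closed» = the floors `3, …, 14` of `RuleDPlate`'s tower are free); both ledgers are the same fourteen statements. -/
theorem ring_ledger_dictionary (B : ℕ) :
    (RingRoomB 14 (CopiesLe B) 2 ↔ SPlusB 2 (CopiesLe B)) ∧
      ∀ c : ℤ, 1 ≤ c → c ≤ 14 → (RingShellB 14 (CopiesLe B) c ↔ FloorFreeB c (CopiesLe B)) :=
  ⟨ringRoomB_iff_sPlusB (by norm_num) (copiesLe_shiftD B),
    fun _ h1 h14 => ringShellB_iff_floorFreeB h1 h14 (copiesLe_shiftD B)⟩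

/-- consistency with the tree's tower: the ring step at height 14 IS `RuleDPlate.sPlusB_copiesLe_succ_iff` read through the dictionary. -/
theorem ringRoomB_succ_iff' (B : ℕ) {c : ℤ} (h14 : c + 1 ≤ 14) :
    RingRoomB 14 (CopiesLe B) (c + 1) ↔ SPlusB c (CopiesLe B) ∧ FloorFreeB (c + 1) (CopiesLe B) := by
  rw [ringRoomB_iff_sPlusB h14 (copiesLe_shiftD B)]
  exact sPlusB_copiesLe_succ_iff c B


/-! ## §8 (v1.3) COMPLETENESS OF THE SUM RULE AT EVERY RING

`SumN h c`, `SumP h c` — the SUM-RULE rooms of ring `c` on the height-`h` alphabet as TYPE-LEVEL predicates on cells; SOUNDNESS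
(`sumN_of_memN`, `sumP_of_memP`, `design_supports_in_sum_rooms`): every supported cell of an `OnAlphabet h ∧ Disj ∧ RuleD ∧ RingLe c` design
lies in them (§6c repackaged); COMPLETENESS (`sumN_supplied`, `sumP_witnessed`, `sum_rooms_consistent`): for `1 ≤ c ≤ h` the pair of rooms is
itself closed under RULE D with DISTINCT partners — every block of every `SumN` type is supplied by a `SumP` type `≠` it (deepen one block letter by
one level, axis-preserving), every detecting block of every `SumP` type is witnessed by a `SumN` type `≠` it (replace every charged block letter by
its SMALL AXIS PROJECTION `(a; x, y) ↦ (a + |x|; 0, y)` resp. `(a + |y|; x, 0)`, the hub for an axis letter).  Hence RULE D ∧ Disj imply NO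
further type-local law at ANY ring: the seven SUM clauses are the complete list (machine cross-check of both witness rules on all D₄×S₄ orbit
types at `h = 14`, rings 1–6, all allowed choices: `memo-27/eng/sumwitness.py`, 0 failures). -/

/-! ### §8.1 Letter moves on the height-`h` alphabet -/

theorem hub_onAlphabet {h : ℤ} (hh : 0 ≤ h) : (Letter.hub h).OnAlphabet h := by
  refine ⟨?_, ?_⟩
  · show h + |(0 : ℤ)| + |(0 : ℤ)| = h; simp
  · show 0 ≤ h; exact hh

theorem hub_colevel (h : ℤ) : (Letter.hub h).colevel = 0 := by
  show |(0 : ℤ)| + |(0 : ℤ)| = 0; simp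

/-- a letter of co-level `≤ 1` is an axis letter. -/
theorem axis_of_colevel_le_one {ℓ : Letter} (h1 : ℓ.colevel ≤ 1) : ℓ.x * ℓ.y = 0 := by
  unfold Letter.colevel at h1
  by_cases hx : ℓ.x = 0
  · rw [hx]; ring
  · have hxpos := abs_pos.mpr hx
    have hy0 : |ℓ.y| ≤ 0 := by omega
    have hy : ℓ.y = 0 := abs_eq_zero.mp (le_antisymm hy0 (abs_nonneg _))
    rw [hy]; ring

/-- ONE LEVEL DOWN, axis-preserving: a letter of co-level `< h` has a letter one null step below it, of co-level one more, which is an axis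
letter if the given one is. -/
theorem exists_down {h : ℤ} {ℓ : Letter} (hℓ : ℓ.OnAlphabet h) (hlt : ℓ.colevel < h) :
    ∃ ℓ₀ : Letter, ℓ₀.OnAlphabet h ∧ ℓ₀.colevel = ℓ.colevel + 1 ∧ NullStep ℓ₀ ℓ ∧ (ℓ.x * ℓ.y = 0 → ℓ₀.x * ℓ₀.y = 0) := by
  have hh := hℓ.1
  unfold Letter.height at hh
  unfold Letter.colevel at hlt ⊢
  by_cases hy : ℓ.y = 0
  · rcases le_or_gt 0 ℓ.x with hx | hx
    · have h1 : |ℓ.x + 1| = ℓ.x + 1 := abs_of_nonneg (by omega)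
      have h0 : |ℓ.x| = ℓ.x := abs_of_nonneg hx
      refine ⟨⟨ℓ.a - 1, ℓ.x + 1, ℓ.y⟩, ⟨?_, ?_⟩, ?_, ⟨?_, ?_⟩, ?_⟩
      · show ℓ.a - 1 + |ℓ.x + 1| + |ℓ.y| = h; rw [h1]; omega
      · show 0 ≤ ℓ.a - 1; omega
      · show |ℓ.x + 1| + |ℓ.y| = |ℓ.x| + |ℓ.y| + 1; rw [h1, h0]; omega
      · show ℓ.a - 1 < ℓ.a; omega
      · show (ℓ.x - (ℓ.x + 1)) ^ 2 + (ℓ.y - ℓ.y) ^ 2 = (ℓ.a - (ℓ.a - 1)) ^ 2; ring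
      · intro _; show (ℓ.x + 1) * ℓ.y = 0; rw [hy]; ring
    · have h1 : |ℓ.x - 1| = -(ℓ.x - 1) := abs_of_neg (by omega)
      have h0 : |ℓ.x| = -ℓ.x := abs_of_neg hx
      refine ⟨⟨ℓ.a - 1, ℓ.x - 1, ℓ.y⟩, ⟨?_, ?_⟩, ?_, ⟨?_, ?_⟩, ?_⟩
      · show ℓ.a - 1 + |ℓ.x - 1| + |ℓ.y| = h; rw [h1]; omega
      · show 0 ≤ ℓ.a - 1; omega
      · show |ℓ.x - 1| + |ℓ.y| = |ℓ.x| + |ℓ.y| + 1; rw [h1, h0]; omega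
      · show ℓ.a - 1 < ℓ.a; omega
      · show (ℓ.x - (ℓ.x - 1)) ^ 2 + (ℓ.y - ℓ.y) ^ 2 = (ℓ.a - (ℓ.a - 1)) ^ 2; ring
      · intro _; show (ℓ.x - 1) * ℓ.y = 0; rw [hy]; ring
  · rcases lt_or_gt_of_ne hy with hy' | hy'
    · have h1 : |ℓ.y - 1| = -(ℓ.y - 1) := abs_of_neg (by omega)
      have h0 : |ℓ.y| = -ℓ.y := abs_of_neg hy'
      refine ⟨⟨ℓ.a - 1, ℓ.x, ℓ.y - 1⟩, ⟨?_, ?_⟩, ?_, ⟨?_, ?_⟩, ?_⟩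
      · show ℓ.a - 1 + |ℓ.x| + |ℓ.y - 1| = h; rw [h1]; omega
      · show 0 ≤ ℓ.a - 1; omega
      · show |ℓ.x| + |ℓ.y - 1| = |ℓ.x| + |ℓ.y| + 1; rw [h1, h0]; omega
      · show ℓ.a - 1 < ℓ.a; omega
      · show (ℓ.x - ℓ.x) ^ 2 + (ℓ.y - (ℓ.y - 1)) ^ 2 = (ℓ.a - (ℓ.a - 1)) ^ 2; ring
      · intro hax; show ℓ.x * (ℓ.y - 1) = 0
        have hx : ℓ.x = 0 := by rcases mul_eq_zero.mp hax with h | h; exact h; exact absurd h hy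
        rw [hx]; ring
    · have h1 : |ℓ.y + 1| = ℓ.y + 1 := abs_of_nonneg (by omega)
      have h0 : |ℓ.y| = ℓ.y := abs_of_nonneg (by omega)
      refine ⟨⟨ℓ.a - 1, ℓ.x, ℓ.y + 1⟩, ⟨?_, ?_⟩, ?_, ⟨?_, ?_⟩, ?_⟩
      · show ℓ.a - 1 + |ℓ.x| + |ℓ.y + 1| = h; rw [h1]; omega
      · show 0 ≤ ℓ.a - 1; omega
      · show |ℓ.x| + |ℓ.y + 1| = |ℓ.x| + |ℓ.y| + 1; rw [h1, h0]; omega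
      · show ℓ.a - 1 < ℓ.a; omega
      · show (ℓ.x - ℓ.x) ^ 2 + (ℓ.y - (ℓ.y + 1)) ^ 2 = (ℓ.a - (ℓ.a - 1)) ^ 2; ring
      · intro hax; show ℓ.x * (ℓ.y + 1) = 0
        have hx : ℓ.x = 0 := by rcases mul_eq_zero.mp hax with h | h; exact h; exact absurd h hy
        rw [hx]; ring

/-- SMALL AXIS PROJECTION: a charged letter has an AXIS letter one null step above it of at most half its co-level — the hub if the letter is
itself an axis letter (`(a; x, y) ↦ (a + |x|; 0, y)` when `|y| ≤ |x|`, `↦ (a + |y|; x, 0)` otherwise). -/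
theorem exists_axis_above {h : ℤ} {ℓ : Letter} (hℓ : ℓ.OnAlphabet h) (hpos : 0 < ℓ.colevel) :
    ∃ A : Letter, A.OnAlphabet h ∧ A.x * A.y = 0 ∧ NullStep ℓ A ∧ 2 * A.colevel ≤ ℓ.colevel ∧ (ℓ.x * ℓ.y = 0 → A.colevel = 0) := by
  have hh := hℓ.1
  have ha := hℓ.2
  unfold Letter.height at hh
  unfold Letter.colevel at hpos ⊢
  have hax := abs_nonneg ℓ.x
  have hay := abs_nonneg ℓ.y
  rcases le_or_gt |ℓ.y| |ℓ.x| with hyx | hxy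
  · have hx0 : ℓ.x ≠ 0 := by
      intro h0; rw [h0, abs_zero] at hyx hpos; omega
    have hxp := abs_pos.mpr hx0
    refine ⟨⟨ℓ.a + |ℓ.x|, 0, ℓ.y⟩, ⟨?_, ?_⟩, ?_, ⟨?_, ?_⟩, ?_, ?_⟩
    · show ℓ.a + |ℓ.x| + |(0 : ℤ)| + |ℓ.y| = h; simp; omega
    · show 0 ≤ ℓ.a + |ℓ.x|; omega
    · show (0 : ℤ) * ℓ.y = 0; ring
    · show ℓ.a < ℓ.a + |ℓ.x|; omega
    · show (0 - ℓ.x) ^ 2 + (ℓ.y - ℓ.y) ^ 2 = (ℓ.a + |ℓ.x| - ℓ.a) ^ 2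
      have : ℓ.a + |ℓ.x| - ℓ.a = |ℓ.x| := by ring
      rw [this, sq_abs]; ring
    · show 2 * (|(0 : ℤ)| + |ℓ.y|) ≤ |ℓ.x| + |ℓ.y|; simp; omega
    · intro hxy0
      show |(0 : ℤ)| + |ℓ.y| = 0
      have hy : ℓ.y = 0 := by rcases mul_eq_zero.mp hxy0 with h0 | h0; exact absurd h0 hx0; exact h0
      rw [hy]; simp
  · have hy0 : ℓ.y ≠ 0 := by intro h0; rw [h0, abs_zero] at hxy; omega
    have hyp := abs_pos.mpr hy0
    refine ⟨⟨ℓ.a + |ℓ.y|, ℓ.x, 0⟩, ⟨?_, ?_⟩, ?_, ⟨?_, ?_⟩, ?_, ?_⟩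
    · show ℓ.a + |ℓ.y| + |ℓ.x| + |(0 : ℤ)| = h; simp; omega
    · show 0 ≤ ℓ.a + |ℓ.y|; omega
    · show ℓ.x * (0 : ℤ) = 0; ring
    · show ℓ.a < ℓ.a + |ℓ.y|; omega
    · show (ℓ.x - ℓ.x) ^ 2 + (0 - ℓ.y) ^ 2 = (ℓ.a + |ℓ.y| - ℓ.a) ^ 2
      have : ℓ.a + |ℓ.y| - ℓ.a = |ℓ.y| := by ring
      rw [this, sq_abs]; ring
    · show 2 * (|ℓ.x| + |(0 : ℤ)|) ≤ |ℓ.x| + |ℓ.y|; simp; omega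
    · intro hxy0
      show |ℓ.x| + |(0 : ℤ)| = 0
      have hx : ℓ.x = 0 := by rcases mul_eq_zero.mp hxy0 with h0 | h0; exact h0; exact absurd h0 hy0
      rw [hx]; simp

/-- on the alphabet, a block DETECTS iff one of its two letters is charged. -/
theorem colevel_pos_of_detects {h : ℤ} {z : Cell} (hz : ∀ f : Fin 4, (z f).OnAlphabet h) {g j : Fin 4} (hdet : Detects z g j) :
    0 < (z g).colevel ∨ 0 < (z j).colevel := by
  by_contra hcon
  push Not at hcon
  have hg : (z g).colevel = 0 := le_antisymm hcon.1 (colevel_nonneg _)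
  have hj : (z j).colevel = 0 := le_antisymm hcon.2 (colevel_nonneg _)
  have eg := eq_hub_of_colevel_eq_zero (hz g) hg
  have ej := eq_hub_of_colevel_eq_zero (hz j) hj
  apply hdet
  rw [eg, ej]
  exact ⟨rfl, rfl, rfl, rfl, rfl⟩


/-! ### §8.2 The SUM-RULE rooms as type-level predicates; soundness for designs -/

/-- the SUM-RULE **N-room** of ring `c` on the height-`h` alphabet: letters on the alphabet of co-level `≤ c`; for every pair of slots the
co-level sum is `≤ 2c − 1`, `= 2c − 1` forces the other two letters to be hubs, `= 2c − 2` forces them to be axis letters. -/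
def SumN (h c : ℤ) (y : Cell) : Prop :=
  (∀ f : Fin 4, (y f).OnAlphabet h ∧ (y f).colevel ≤ c) ∧
    ∀ j k : Fin 4, j ≠ k →
      (y j).colevel + (y k).colevel ≤ 2 * c - 1 ∧
        ((y j).colevel + (y k).colevel = 2 * c - 1 → ∀ s : Fin 4, s ≠ j → s ≠ k → y s = Letter.hub h) ∧
          ((y j).colevel + (y k).colevel = 2 * c - 2 → ∀ s : Fin 4, s ≠ j → s ≠ k → (y s).x * (y s).y = 0)

/-- the SUM-RULE **P-room** of ring `c`: letters on the alphabet of co-level `≤ c`; a pair sum `= 2c` forces the other two letters to be hubs,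
`= 2c − 1` forces them to be axis letters (hence no three top letters, `SumP.not_three_tops`). -/
def SumP (h c : ℤ) (x : Cell) : Prop :=
  (∀ f : Fin 4, (x f).OnAlphabet h ∧ (x f).colevel ≤ c) ∧
    ∀ j k : Fin 4, j ≠ k →
      ((x j).colevel + (x k).colevel = 2 * c → ∀ s : Fin 4, s ≠ j → s ≠ k → x s = Letter.hub h) ∧
        ((x j).colevel + (x k).colevel = 2 * c - 1 → ∀ s : Fin 4, s ≠ j → s ≠ k → (x s).x * (x s).y = 0)

theorem SumP.not_three_tops {h c : ℤ} (hc : 0 < c) {x : Cell} (hx : SumP h c x) {g₁ g₂ g₃ : Fin 4} (h12 : g₁ ≠ g₂) (h13 : g₁ ≠ g₃)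
    (h23 : g₂ ≠ g₃) (ht1 : (x g₁).colevel = c) (ht2 : (x g₂).colevel = c) : (x g₃).colevel < c := by
  have e3 := (hx.2 g₁ g₂ h12).1 (by omega) g₃ h13.symm h23.symm
  rw [e3, hub_colevel]; exact hc

/-- SOUNDNESS, N side: every supported N-cell of an `OnAlphabet h ∧ Disj ∧ RuleD` design inside ring `c ≥ 1` is a `SumN h c` type. -/
theorem sumN_of_memN {h c : ℤ} {D : Design} (hA : D.OnAlphabet h) (hdis : Disj D) (hr : RuleD D) (hR : RingLe c D) (hc : 0 < c)
    {y : Cell} (hy : y ∈ D.suppN) : SumN h c y := by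
  refine ⟨fun f => ⟨hA y (mem_supp_of_memN D hy) f, hR y (mem_supp_of_memN D hy) f⟩, fun j k hjk => ⟨?_, ?_, ?_⟩⟩
  · have := sum_rule_N_lt hA hdis hr hR hc hy hjk; omega
  · intro hs s hsj hsk; exact sum_rule_N_hub hA hdis hr hR hc hy hjk hsj hsk hs
  · intro hs s hsj hsk
    rcases (show c = 1 ∨ 2 ≤ c by omega) with h1 | h2
    · exact axis_of_colevel_le_one (by have := hR y (mem_supp_of_memN D hy) s; omega)
    · exact sum_rule_N_axis hA hdis hr hR h2 hy hjk hsj hsk hs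

/-- SOUNDNESS, P side. -/
theorem sumP_of_memP {h c : ℤ} {D : Design} (hA : D.OnAlphabet h) (hdis : Disj D) (hr : RuleD D) (hR : RingLe c D) (hc : 0 < c)
    {x : Cell} (hx : x ∈ D.suppP) : SumP h c x := by
  refine ⟨fun f => ⟨hA x (mem_supp_of_memP D hx) f, hR x (mem_supp_of_memP D hx) f⟩, fun j k hjk => ⟨?_, ?_⟩⟩
  · intro hs s hsj hsk; exact sum_rule_P_hub hA hdis hr hR hc hx hjk hsj hsk hs
  · intro hs s hsj hsk
    rcases (show c = 1 ∨ 2 ≤ c by omega) with h1 | h2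
    · exact axis_of_colevel_le_one (by have := hR x (mem_supp_of_memP D hx) s; omega)
    · exact sum_rule_P_axis hA hdis hr hR h2 hx hjk hsj hsk hs

/-! ### §8.3 Completeness, N side: every block of a `SumN` type is supplied from `SumP` (deepen one block letter by one level) -/

/-- deepening ANY slot `p` of a `SumN` type by one co-level (to an axis letter if the old letter was axis), staying inside ring `c`, lands in
the `SumP` room. -/
theorem sumP_update_down {h c : ℤ} {y : Cell} (hy : SumN h c y) (p : Fin 4) {ℓ₀ : Letter} (h0A : ℓ₀.OnAlphabet h)
    (h0c : ℓ₀.colevel = (y p).colevel + 1) (h0le : ℓ₀.colevel ≤ c) (h0ax : (y p).x * (y p).y = 0 → ℓ₀.x * ℓ₀.y = 0) :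
    SumP h c (Function.update y p ℓ₀) := by
  have hup : Function.update y p ℓ₀ p = ℓ₀ := Function.update_self ..
  have hne : ∀ s : Fin 4, s ≠ p → Function.update y p ℓ₀ s = y s := fun s hs => Function.update_of_ne hs ..
  refine ⟨fun f => ?_, fun j k hjk => ⟨?_, ?_⟩⟩
  · by_cases hf : f = p
    · subst hf; rw [hup]; exact ⟨h0A, h0le⟩
    · rw [hne f hf]; exact ⟨(hy.1 f).1, (hy.1 f).2⟩
  · -- pair sum `= 2c` ⇒ the other two letters are hubs
    intro hs s hsj hsk
    by_cases hjp : j = p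
    · subst hjp
      rw [hup, hne k hjk.symm] at hs
      rw [hne s hsj]
      exact (hy.2 j k hjk).2.1 (by omega) s hsj hsk
    by_cases hkp : k = p
    · subst hkp
      rw [hup, hne j hjk] at hs
      rw [hne s hsk]
      exact (hy.2 j k hjk).2.1 (by omega) s hsj hsk
    · rw [hne j hjp, hne k hkp] at hs
      have := (hy.2 j k hjk).1; omega
  · -- pair sum `= 2c − 1` ⇒ the other two letters are axis letters
    intro hs s hsj hsk
    by_cases hjp : j = p
    · subst hjp
      rw [hup, hne k hjk.symm] at hs
      rw [hne s hsj]
      exact (hy.2 j k hjk).2.2 (by omega) s hsj hsk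
    by_cases hkp : k = p
    · subst hkp
      rw [hup, hne j hjk] at hs
      rw [hne s hsk]
      exact (hy.2 j k hjk).2.2 (by omega) s hsj hsk
    · rw [hne j hjp, hne k hkp] at hs
      -- in `y` the pair `(j, k)` has sum `2c − 1`: the other two letters of `y` are hubs, so `y p` is the hub (axis) and `ℓ₀` is axis
      by_cases hsp : s = p
      · subst hsp; rw [hup]
        have ep := (hy.2 j k hjk).2.1 hs s hsj hsk
        exact h0ax (by rw [ep]; exact hub_axis h)
      · rw [hne s hsp]
        have es := (hy.2 j k hjk).2.1 hs s hsj hsk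
        rw [es]; exact hub_axis h

/-- **COMPLETENESS, N side.**  For `c ≤ h`, every block `(g, j)` of every `SumN h c` type `y` is supplied — `Supplies x y g j` — by a `SumP h c`
type `x ≠ y` (no `Detects` hypothesis is even needed: a block of two hubs is supplied too). -/
theorem sumN_supplied {h c : ℤ} (hch : c ≤ h) {y : Cell} (hy : SumN h c y) {g j : Fin 4} (hgj : g ≠ j) :
    ∃ x : Cell, SumP h c x ∧ x ≠ y ∧ Supplies x y g j := by
  -- one of the two block letters has co-level `< c` (pair sums are `≤ 2c − 1`); deepen it
  have hsum := (hy.2 g j hgj).1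
  obtain ⟨p, hp, hpc⟩ : ∃ p : Fin 4, (p = g ∨ p = j) ∧ (y p).colevel < c := by
    by_cases hg : (y g).colevel < c
    · exact ⟨g, Or.inl rfl, hg⟩
    · exact ⟨j, Or.inr rfl, by omega⟩
  obtain ⟨ℓ₀, h0A, h0c, h0n, h0ax⟩ := exists_down (hy.1 p).1 (by omega)
  refine ⟨Function.update y p ℓ₀, sumP_update_down hy p h0A h0c (by omega) h0ax, ?_, ?_⟩
  · intro heq
    have := congrArg (fun z : Cell => (z p).colevel) heq
    simp only [Function.update_self] at this
    omega
  · refine ⟨fun f hfg hfj => ?_, ?_, ?_⟩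
    · have hfp : f ≠ p := by rcases hp with rfl | rfl; exact hfg; exact hfj
      exact Function.update_of_ne hfp ..
    · by_cases hgp : g = p
      · right; rw [hgp, Function.update_self]; exact h0n
      · left; exact Function.update_of_ne hgp ..
    · by_cases hjp : j = p
      · right; rw [hjp, Function.update_self]; exact h0n
      · left; exact Function.update_of_ne hjp ..


/-! ### §8.4 Completeness, P side: every detecting block of a `SumP` type is witnessed from `SumN` (small axis projections) -/

/-- the N-room condition for the pair of slots `(p, q)`. -/
def PairN (h c : ℤ) (y : Cell) (p q : Fin 4) : Prop :=
  (y p).colevel + (y q).colevel ≤ 2 * c - 1 ∧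
    ((y p).colevel + (y q).colevel = 2 * c - 1 → ∀ s : Fin 4, s ≠ p → s ≠ q → y s = Letter.hub h) ∧
      ((y p).colevel + (y q).colevel = 2 * c - 2 → ∀ s : Fin 4, s ≠ p → s ≠ q → (y s).x * (y s).y = 0)

theorem PairN.symm {h c : ℤ} {y : Cell} {p q : Fin 4} (hpq : PairN h c y p q) : PairN h c y q p :=
  ⟨by have := hpq.1; omega, fun hs s hsq hsp => hpq.2.1 (by omega) s hsp hsq, fun hs s hsq hsp => hpq.2.2 (by omega) s hsp hsq⟩

/-- PROJECTION-OR-STAY: every letter on the alphabet has an axis letter equal to it (if it is the hub) or one null step above it, of at most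
half its co-level, of co-level `0` if the letter is axis, and different from it if the letter is charged. -/
theorem exists_proj {h : ℤ} {ℓ : Letter} (hℓ : ℓ.OnAlphabet h) :
    ∃ A : Letter, A.OnAlphabet h ∧ A.x * A.y = 0 ∧ (A = ℓ ∨ NullStep ℓ A) ∧ 2 * A.colevel ≤ ℓ.colevel ∧
      (ℓ.x * ℓ.y = 0 → A.colevel = 0) ∧ (0 < ℓ.colevel → A ≠ ℓ) := by
  rcases lt_or_ge 0 ℓ.colevel with hpos | h0
  · obtain ⟨A, hA, hax, hn, h2, hz⟩ := exists_axis_above hℓ hpos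
    refine ⟨A, hA, hax, Or.inr hn, h2, hz, fun _ hAe => ?_⟩
    have := hn.1; rw [hAe] at this; exact lt_irrefl _ this
  · have e0 : ℓ.colevel = 0 := le_antisymm h0 (colevel_nonneg ℓ)
    have eh := eq_hub_of_colevel_eq_zero hℓ e0
    refine ⟨ℓ, hℓ, ?_, Or.inl rfl, by omega, fun _ => e0, fun hp => absurd e0 (by omega)⟩
    rw [eh]; exact hub_axis h

/-- the data of the PROJECTION WITNESS `y` of a `SumP` type `x` for the block `(b₁, b₂)` (off-block slots `o₁, o₂`): block letters of `y`
are axis letters of at most half the co-level (co-level `0` over an axis letter of `x`), off-block letters are unchanged, the block is charged. -/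
structure ProjData (h c : ℤ) (x y : Cell) (b₁ b₂ o₁ o₂ : Fin 4) : Prop where
  hc : 0 < c
  hx : SumP h c x
  yA : ∀ f : Fin 4, (y f).OnAlphabet h
  hb : b₁ ≠ b₂
  hb1o1 : b₁ ≠ o₁
  hb1o2 : b₁ ≠ o₂
  hb2o1 : b₂ ≠ o₁
  hb2o2 : b₂ ≠ o₂
  ho : o₁ ≠ o₂
  cover : ∀ s : Fin 4, s = b₁ ∨ s = b₂ ∨ s = o₁ ∨ s = o₂
  ax1 : (y b₁).x * (y b₁).y = 0
  half1 : 2 * (y b₁).colevel ≤ (x b₁).colevel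
  zero1 : (x b₁).x * (x b₁).y = 0 → (y b₁).colevel = 0
  ax2 : (y b₂).x * (y b₂).y = 0
  half2 : 2 * (y b₂).colevel ≤ (x b₂).colevel
  zero2 : (x b₂).x * (x b₂).y = 0 → (y b₂).colevel = 0
  eo1 : y o₁ = x o₁
  eo2 : y o₂ = x o₂
  chg : 0 < (x b₁).colevel ∨ 0 < (x b₂).colevel

theorem ProjData.swapB {h c : ℤ} {x y : Cell} {b₁ b₂ o₁ o₂ : Fin 4} (P : ProjData h c x y b₁ b₂ o₁ o₂) :
    ProjData h c x y b₂ b₁ o₁ o₂ where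
  hc := P.hc
  hx := P.hx
  yA := P.yA
  hb := P.hb.symm
  hb1o1 := P.hb2o1
  hb1o2 := P.hb2o2
  hb2o1 := P.hb1o1
  hb2o2 := P.hb1o2
  ho := P.ho
  cover s := by
    rcases P.cover s with e | e | e | e
    · exact Or.inr (Or.inl e)
    · exact Or.inl e
    · exact Or.inr (Or.inr (Or.inl e))
    · exact Or.inr (Or.inr (Or.inr e))
  ax1 := P.ax2
  half1 := P.half2
  zero1 := P.zero2
  ax2 := P.ax1
  half2 := P.half1
  zero2 := P.zero1
  eo1 := P.eo1
  eo2 := P.eo2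
  chg := P.chg.symm

theorem ProjData.swapO {h c : ℤ} {x y : Cell} {b₁ b₂ o₁ o₂ : Fin 4} (P : ProjData h c x y b₁ b₂ o₁ o₂) :
    ProjData h c x y b₁ b₂ o₂ o₁ where
  hc := P.hc
  hx := P.hx
  yA := P.yA
  hb := P.hb
  hb1o1 := P.hb1o2
  hb1o2 := P.hb1o1
  hb2o1 := P.hb2o2
  hb2o2 := P.hb2o1
  ho := P.ho.symm
  cover s := by
    rcases P.cover s with e | e | e | e
    · exact Or.inl e
    · exact Or.inr (Or.inl e)
    · exact Or.inr (Or.inr (Or.inr e))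
    · exact Or.inr (Or.inr (Or.inl e))
  ax1 := P.ax1
  half1 := P.half1
  zero1 := P.zero1
  ax2 := P.ax2
  half2 := P.half2
  zero2 := P.zero2
  eo1 := P.eo2
  eo2 := P.eo1
  chg := P.chg

/-- block–block pair. -/
theorem ProjData.pairBB {h c : ℤ} {x y : Cell} {b₁ b₂ o₁ o₂ : Fin 4} (P : ProjData h c x y b₁ b₂ o₁ o₂) : PairN h c y b₁ b₂ := by
  have k1 := (P.hx.1 b₁).2
  have k2 := (P.hx.1 b₂).2
  have n1 := colevel_nonneg (y b₁)
  have n2 := colevel_nonneg (y b₂)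
  have hc := P.hc
  have h1 := P.half1
  have h2 := P.half2
  refine ⟨by omega, fun hs => by exfalso; omega, fun hs s hs1 hs2 => ?_⟩
  have hso : s = o₁ ∨ s = o₂ := by
    rcases P.cover s with e | e | e | e
    · exact absurd e hs1
    · exact absurd e hs2
    · exact Or.inl e
    · exact Or.inr e
  have hys : y s = x s := by rcases hso with e | e <;> rw [e]; exacts [P.eo1, P.eo2]
  rw [hys]
  rcases (show c = 1 ∨ c = 2 by omega) with e1 | e2
  · exact axis_of_colevel_le_one (by have := (P.hx.1 s).2; omega)
  · have e := (P.hx.2 b₁ b₂ P.hb).1 (by omega) s hs1 hs2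
    rw [e]; exact hub_axis h

/-- block–off pair `(b₁, o₁)` (the other three block–off pairs follow by `swapB` ∕ `swapO`). -/
theorem ProjData.pairBO {h c : ℤ} {x y : Cell} {b₁ b₂ o₁ o₂ : Fin 4} (P : ProjData h c x y b₁ b₂ o₁ o₂) : PairN h c y b₁ o₁ := by
  have kb1 := (P.hx.1 b₁).2
  have kb2 := (P.hx.1 b₂).2
  have ko1 := (P.hx.1 o₁).2
  have ko2 := (P.hx.1 o₂).2
  have nb1 := colevel_nonneg (y b₁)
  have nb2 := colevel_nonneg (y b₂)
  have nxb1 := colevel_nonneg (x b₁)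
  have nxb2 := colevel_nonneg (x b₂)
  have nxo1 := colevel_nonneg (x o₁)
  have hc := P.hc
  have h1 := P.half1
  have h2 := P.half2
  have eo1 : (y o₁).colevel = (x o₁).colevel := by rw [P.eo1]
  have others : ∀ s : Fin 4, s ≠ b₁ → s ≠ o₁ → s = b₂ ∨ s = o₂ := fun s h1' h2' => by
    rcases P.cover s with e | e | e | e
    · exact absurd e h1'
    · exact Or.inl e
    · exact absurd e h2'
    · exact Or.inr e
  have yb2hub : (y b₂).colevel = 0 → y b₂ = Letter.hub h := fun e => eq_hub_of_colevel_eq_zero (P.yA b₂) e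
  refine ⟨by rw [eo1]; omega, fun hs s hs1 hs2 => ?_, fun hs s hs1 hs2 => ?_⟩
  · -- sum `= 2c − 1` forces `c ≤ 2`; the other two letters are hubs
    rw [eo1] at hs
    have hc2 : c = 1 ∨ c = 2 := by omega
    rcases others s hs1 hs2 with e | e <;> rw [e]
    · rcases hc2 with e1 | e2
      · exact yb2hub (by omega)
      · have eb := (P.hx.2 b₁ o₁ P.hb1o1).1 (by omega) b₂ P.hb.symm P.hb2o1
        have : (x b₂).colevel = 0 := by rw [eb, hub_colevel]
        exact yb2hub (by omega)
    · rw [P.eo2]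
      rcases hc2 with e1 | e2
      · rcases P.chg with hb | hb
        · exact (P.hx.2 b₁ o₁ P.hb1o1).1 (by omega) o₂ P.hb1o2.symm P.ho.symm
        · exact (P.hx.2 b₂ o₁ P.hb2o1).1 (by omega) o₂ P.hb2o2.symm P.ho.symm
      · exact (P.hx.2 b₁ o₁ P.hb1o1).1 (by omega) o₂ P.hb1o2.symm P.ho.symm
  · -- sum `= 2c − 2` forces `c ≤ 4`; the other two letters are axis letters (`y b₂` by construction)
    rw [eo1] at hs
    rcases others s hs1 hs2 with e | e <;> rw [e]
    · exact P.ax2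
    · rw [P.eo2]
      rcases (show c = 1 ∨ c = 2 ∨ c = 3 ∨ c = 4 by omega) with e1 | e2 | e3 | e4
      · exact axis_of_colevel_le_one (by omega)
      · by_cases h4 : (x b₁).colevel + (x o₁).colevel = 2 * c
        · rw [(P.hx.2 b₁ o₁ P.hb1o1).1 h4 o₂ P.hb1o2.symm P.ho.symm]; exact hub_axis h
        by_cases h3 : (x b₁).colevel + (x o₁).colevel = 2 * c - 1
        · exact (P.hx.2 b₁ o₁ P.hb1o1).2 h3 o₂ P.hb1o2.symm P.ho.symm
        by_cases h4' : (x b₂).colevel + (x o₁).colevel = 2 * c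
        · rw [(P.hx.2 b₂ o₁ P.hb2o1).1 h4' o₂ P.hb2o2.symm P.ho.symm]; exact hub_axis h
        have h3' : (x b₂).colevel + (x o₁).colevel = 2 * c - 1 := by rcases P.chg with hb | hb <;> omega
        exact (P.hx.2 b₂ o₁ P.hb2o1).2 h3' o₂ P.hb2o2.symm P.ho.symm
      · by_cases h6 : (x b₁).colevel + (x o₁).colevel = 2 * c
        · rw [(P.hx.2 b₁ o₁ P.hb1o1).1 h6 o₂ P.hb1o2.symm P.ho.symm]; exact hub_axis h
        · exact (P.hx.2 b₁ o₁ P.hb1o1).2 (by omega) o₂ P.hb1o2.symm P.ho.symm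
      · rw [(P.hx.2 b₁ o₁ P.hb1o1).1 (by omega) o₂ P.hb1o2.symm P.ho.symm]; exact hub_axis h

/-- off–off pair. -/
theorem ProjData.pairOO {h c : ℤ} {x y : Cell} {b₁ b₂ o₁ o₂ : Fin 4} (P : ProjData h c x y b₁ b₂ o₁ o₂) : PairN h c y o₁ o₂ := by
  have ko1 := (P.hx.1 o₁).2
  have ko2 := (P.hx.1 o₂).2
  have e1 : (y o₁).colevel = (x o₁).colevel := by rw [P.eo1]
  have e2 : (y o₂).colevel = (x o₂).colevel := by rw [P.eo2]
  have hc := P.hc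
  have others : ∀ s : Fin 4, s ≠ o₁ → s ≠ o₂ → s = b₁ ∨ s = b₂ := fun s h1' h2' => by
    rcases P.cover s with e | e | e | e
    · exact Or.inl e
    · exact Or.inr e
    · exact absurd e h1'
    · exact absurd e h2'
  refine ⟨?_, fun hs s hs1 hs2 => ?_, fun hs s hs1 hs2 => ?_⟩
  · rw [e1, e2]
    by_contra hgt
    have h2c : (x o₁).colevel + (x o₂).colevel = 2 * c := by omega
    have eb1 := (P.hx.2 o₁ o₂ P.ho).1 h2c b₁ P.hb1o1 P.hb1o2
    have eb2 := (P.hx.2 o₁ o₂ P.ho).1 h2c b₂ P.hb2o1 P.hb2o2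
    have z1 : (x b₁).colevel = 0 := by rw [eb1, hub_colevel]
    have z2 : (x b₂).colevel = 0 := by rw [eb2, hub_colevel]
    rcases P.chg with h0 | h0 <;> omega
  · rw [e1, e2] at hs
    rcases others s hs1 hs2 with e | e <;> rw [e]
    · exact eq_hub_of_colevel_eq_zero (P.yA b₁) (P.zero1 ((P.hx.2 o₁ o₂ P.ho).2 hs b₁ P.hb1o1 P.hb1o2))
    · exact eq_hub_of_colevel_eq_zero (P.yA b₂) (P.zero2 ((P.hx.2 o₁ o₂ P.ho).2 hs b₂ P.hb2o1 P.hb2o2))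
  · rcases others s hs1 hs2 with e | e <;> rw [e]
    · exact P.ax1
    · exact P.ax2

/-- the projection witness is a `SumN` type. -/
theorem ProjData.sumN {h c : ℤ} {x y : Cell} {b₁ b₂ o₁ o₂ : Fin 4} (P : ProjData h c x y b₁ b₂ o₁ o₂) : SumN h c y := by
  have BB := P.pairBB
  have B1O1 := P.pairBO
  have B1O2 := P.swapO.pairBO
  have B2O1 := P.swapB.pairBO
  have B2O2 := P.swapB.swapO.pairBO
  have OO := P.pairOO
  have hcov := P.cover
  refine ⟨fun f => ⟨P.yA f, ?_⟩, fun p q hpq => ?_⟩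
  · rcases P.cover f with e | e | e | e <;> rw [e]
    · have := P.half1; have := (P.hx.1 b₁).2; have := colevel_nonneg (y b₁); omega
    · have := P.half2; have := (P.hx.1 b₂).2; have := colevel_nonneg (y b₂); omega
    · rw [P.eo1]; exact (P.hx.1 o₁).2
    · rw [P.eo2]; exact (P.hx.1 o₂).2
  · rcases hcov p with rfl | rfl | rfl | rfl <;> rcases hcov q with rfl | rfl | rfl | rfl
    all_goals first
      | exact absurd rfl hpq
      | exact BB | exact BB.symm | exact B1O1 | exact B1O1.symm | exact B1O2 | exact B1O2.symm
      | exact B2O1 | exact B2O1.symm | exact B2O2 | exact B2O2.symm | exact OO | exact OO.symm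

theorem exists_other_two (g j : Fin 4) (hgj : g ≠ j) :
    ∃ m m' : Fin 4, g ≠ m ∧ g ≠ m' ∧ j ≠ m ∧ j ≠ m' ∧ m ≠ m' ∧ ∀ s : Fin 4, s = g ∨ s = j ∨ s = m ∨ s = m' := by
  revert g j; decide

/-- **COMPLETENESS, P side.**  For `0 < c`, every detecting block `(g, j)` of every `SumP h c` type `x` is witnessed — `Supplies x y g j` — by a
`SumN h c` type `y ≠ x`: replace every charged block letter by its small axis projection. -/
theorem sumP_witnessed {h c : ℤ} (hc : 0 < c) {x : Cell} (hx : SumP h c x) {g j : Fin 4} (hgj : g ≠ j) (hdet : Detects x g j) :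
    ∃ y : Cell, SumN h c y ∧ y ≠ x ∧ Supplies x y g j := by
  obtain ⟨m, m', hgm, hgm', hjm, hjm', hmm', cover⟩ := exists_other_two g j hgj
  obtain ⟨Ag, hAgA, hAgax, hAgn, hAg2, hAg0, hAgne⟩ := exists_proj (hx.1 g).1
  obtain ⟨Aj, hAjA, hAjax, hAjn, hAj2, hAj0, hAjne⟩ := exists_proj (hx.1 j).1
  have hchg := colevel_pos_of_detects (fun f => (hx.1 f).1) hdet
  refine ⟨Function.update (Function.update x g Ag) j Aj, ?_⟩
  have yj : Function.update (Function.update x g Ag) j Aj j = Aj := Function.update_self ..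
  have yg : Function.update (Function.update x g Ag) j Aj g = Ag := by
    rw [Function.update_of_ne hgj, Function.update_self]
  have yo : ∀ s : Fin 4, s ≠ g → s ≠ j → Function.update (Function.update x g Ag) j Aj s = x s := fun s hs1 hs2 => by
    rw [Function.update_of_ne hs2, Function.update_of_ne hs1]
  have yA : ∀ f : Fin 4, (Function.update (Function.update x g Ag) j Aj f).OnAlphabet h := fun f => by
    rcases cover f with e | e | e | e <;> rw [e]
    · rw [yg]; exact hAgA
    · rw [yj]; exact hAjA
    · rw [yo m hgm.symm hjm.symm]; exact (hx.1 m).1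
    · rw [yo m' hgm'.symm hjm'.symm]; exact (hx.1 m').1
  have P : ProjData h c x (Function.update (Function.update x g Ag) j Aj) g j m m' :=
    { hc := hc
      hx := hx
      yA := yA
      hb := hgj
      hb1o1 := hgm
      hb1o2 := hgm'
      hb2o1 := hjm
      hb2o2 := hjm'
      ho := hmm'
      cover := cover
      ax1 := by rw [yg]; exact hAgax
      half1 := by rw [yg]; exact hAg2
      zero1 := fun h0 => by rw [yg]; exact hAg0 h0
      ax2 := by rw [yj]; exact hAjax
      half2 := by rw [yj]; exact hAj2
      zero2 := fun h0 => by rw [yj]; exact hAj0 h0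
      eo1 := yo m hgm.symm hjm.symm
      eo2 := yo m' hgm'.symm hjm'.symm
      chg := hchg }
  refine ⟨P.sumN, ?_, ?_⟩
  · intro heq
    rcases hchg with hp | hp
    · exact hAgne hp (by rw [← yg, heq])
    · exact hAjne hp (by rw [← yj, heq])
  · refine ⟨fun f hfg hfj => (yo f hfg hfj).symm, ?_, ?_⟩
    · rw [yg]
      rcases hAgn with e | n
      · left; rw [e]
      · right; exact n
    · rw [yj]
      rcases hAjn with e | n
      · left; rw [e]
      · right; exact n

/-! ### §8.5 Packaging: the SUM-RULE rooms are a RULE-D-consistent pair containing every design's supports -/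

/-- RULE D WITH DISTINCT PARTNERS for a pair of type rooms `(N, P)`: every detecting block of an `N`-type is supplied by a `P`-type `≠` it,
every detecting block of a `P`-type is witnessed by an `N`-type `≠` it. -/
def Consistent (N P : Cell → Prop) : Prop :=
  (∀ y : Cell, N y → ∀ g j : Fin 4, g ≠ j → Detects y g j → ∃ x : Cell, P x ∧ x ≠ y ∧ Supplies x y g j) ∧
    ∀ x : Cell, P x → ∀ g j : Fin 4, g ≠ j → Detects x g j → ∃ y : Cell, N y ∧ y ≠ x ∧ Supplies x y g j

/-- **THE SUM-RULE ROOMS ARE RULE-D-CONSISTENT AT EVERY RING** `1 ≤ c ≤ h`: no further type-local law follows from RULE D with distinct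
partners — the seven SUM clauses (`DeepLayerLaws` §6c) are the complete type-level content. -/
theorem sum_rooms_consistent {h c : ℤ} (hc : 0 < c) (hch : c ≤ h) : Consistent (SumN h c) (SumP h c) :=
  ⟨fun _ hy _ _ hgj _ => sumN_supplied hch hy hgj, fun _ hx _ _ hgj hdet => sumP_witnessed hc hx hgj hdet⟩

/-- … and they CONTAIN the supports of every `OnAlphabet h ∧ Disj ∧ RuleD` design inside ring `c` (soundness, §2), whose support pair is
itself consistent in this sense (`Disj` makes partners distinct). -/
theorem design_supports_in_sum_rooms {h c : ℤ} {D : Design} (hA : D.OnAlphabet h) (hdis : Disj D) (hr : RuleD D) (hR : RingLe c D)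
    (hc : 0 < c) : (∀ y ∈ D.suppN, SumN h c y) ∧ ∀ x ∈ D.suppP, SumP h c x :=
  ⟨fun _ hy => sumN_of_memN hA hdis hr hR hc hy, fun _ hx => sumP_of_memP hA hdis hr hR hc hx⟩

theorem design_supports_consistent {D : Design} (hdis : Disj D) (hr : RuleD D) :
    Consistent (fun y => y ∈ D.suppN) (fun x => x ∈ D.suppP) := by
  refine ⟨fun y hy g j hgj hdet => ?_, fun x hx g j hgj hdet => ?_⟩
  · obtain ⟨x, hx, hs⟩ := ruleDN_any hr hy hgj hdet
    exact ⟨x, hx, fun e => hdis x (e ▸ hy) hx, hs⟩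
  · obtain ⟨y, hy, hs⟩ := ruleDP_any hr.2 hx hgj hdet
    exact ⟨y, hy, fun e => hdis y hy (e ▸ hx), hs⟩


/-! ## §9 (v1.4) WEAK CONES ARE UP-CLOSED: `NotDead` ∕ `WeakLive` are transitive (integer Minkowski inequality), so one-slot weak cones
`SlotCone g ℓ = {z | NotDead ℓ (z g)}` and full cones `WeakLive x` are `UpClosed`; every such cone (and every ∧ ∕ ∨ combination, §5) is an
order-ideal Hall row `0 < m_P(U) ⇒ m_P(U) + k ≤ m_N(U)` — the row family that pairs a hook column `A_k@g` with the N-cells at `u_k ∕ H` in slot `g`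
(finer than the top-shell cut (D′), which is blind to hooks). -/

/-- integer Minkowski ∕ triangle inequality in squared form: `p²+q² ≤ d₁²`, `r²+s² ≤ d₂²`, `0 ≤ d₁, d₂` ⇒ `(p+r)²+(q+s)² ≤ (d₁+d₂)²`. -/
theorem sq_triangle {p q r s d₁ d₂ : ℤ} (h1 : 0 ≤ d₁) (h2 : 0 ≤ d₂) (hp : p ^ 2 + q ^ 2 ≤ d₁ ^ 2) (hr : r ^ 2 + s ^ 2 ≤ d₂ ^ 2) :
    (p + r) ^ 2 + (q + s) ^ 2 ≤ (d₁ + d₂) ^ 2 := by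
  have hcs : (p * r + q * s) ^ 2 ≤ (p ^ 2 + q ^ 2) * (r ^ 2 + s ^ 2) := by nlinarith [sq_nonneg (p * s - q * r)]
  have hprod : (p ^ 2 + q ^ 2) * (r ^ 2 + s ^ 2) ≤ d₁ ^ 2 * d₂ ^ 2 := mul_le_mul hp hr (by positivity) (by positivity)
  have hkey : p * r + q * s ≤ d₁ * d₂ := by
    have h3 : (p * r + q * s) ^ 2 ≤ (d₁ * d₂) ^ 2 := by rw [mul_pow]; exact hcs.trans hprod
    exact (abs_le_of_sq_le_sq' h3 (mul_nonneg h1 h2)).2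
  nlinarith [hkey, hp, hr]

/-- `NotDead` is transitive. -/
theorem notDead_trans {ℓ ℓ' ℓ'' : Letter} (h1 : NotDead ℓ ℓ') (h2 : NotDead ℓ' ℓ'') : NotDead ℓ ℓ'' := by
  rcases h1 with rfl | ⟨ha1, hd1⟩
  · exact h2
  rcases h2 with rfl | ⟨ha2, hd2⟩
  · exact Or.inr ⟨ha1, hd1⟩
  right
  refine ⟨lt_trans ha1 ha2, ?_⟩
  have key := sq_triangle (sub_nonneg.2 ha1.le) (sub_nonneg.2 ha2.le) hd1 hd2
  have e1 : ℓ''.x - ℓ.x = (ℓ'.x - ℓ.x) + (ℓ''.x - ℓ'.x) := by ring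
  have e2 : ℓ''.y - ℓ.y = (ℓ'.y - ℓ.y) + (ℓ''.y - ℓ'.y) := by ring
  have e3 : ℓ''.a - ℓ.a = (ℓ'.a - ℓ.a) + (ℓ''.a - ℓ'.a) := by ring
  rw [e1, e2, e3]; exact key

theorem notDead_refl (ℓ : Letter) : NotDead ℓ ℓ := Or.inl rfl

/-- `WeakLive` is a preorder on cells. -/
theorem weakLive_refl (x : Cell) : WeakLive x x := fun _ => notDead_refl _

theorem weakLive_trans {x y z : Cell} (h1 : WeakLive x y) (h2 : WeakLive y z) : WeakLive x z :=
  fun f => notDead_trans (h1 f) (h2 f)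

/-- the ONE-SLOT WEAK CONE above the letter `ℓ` at slot `g`. -/
def SlotCone (g : Fin 4) (ℓ : Letter) (z : Cell) : Prop := NotDead ℓ (z g)

theorem upClosed_slotCone (g : Fin 4) (ℓ : Letter) : UpClosed (SlotCone g ℓ) :=
  fun _ _ hw hx => notDead_trans hx (hw g)

/-- the full weak cone above a cell is up-closed. -/
theorem upClosed_weakLive (x : Cell) : UpClosed (WeakLive x) :=
  fun _ _ hw hy => weakLive_trans hy hw

/-- **one-slot cone Hall row**: `0 < m_P(SlotCone g ℓ) ⇒ m_P(SlotCone g ℓ) + k ≤ m_N(SlotCone g ℓ)` under `Hall⁺ₖ`. -/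
theorem hallPlusUp_slotCone (E : Design) (k : ℕ) (hH : HallPlusUp E k) (g : Fin 4) (ℓ : Letter) [DecidablePred (SlotCone g ℓ)]
    (hpos : 0 < massOn E.P (SlotCone g ℓ)) : massOn E.P (SlotCone g ℓ) + k ≤ massOn E.N (SlotCone g ℓ) :=
  hallPlusUp_cut E k hH _ (upClosed_slotCone g ℓ) hpos

/-- intersection of two one-slot cones (e.g. a hook column `A_k@g` together with a unit column at slot `j`). -/
theorem hallPlusUp_slotCone_and (E : Design) (k : ℕ) (hH : HallPlusUp E k) (g j : Fin 4) (ℓ ℓ' : Letter)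
    [DecidablePred fun c => SlotCone g ℓ c ∧ SlotCone j ℓ' c]
    (hpos : 0 < massOn E.P fun c => SlotCone g ℓ c ∧ SlotCone j ℓ' c) :
    (massOn E.P fun c => SlotCone g ℓ c ∧ SlotCone j ℓ' c) + k ≤ massOn E.N fun c => SlotCone g ℓ c ∧ SlotCone j ℓ' c :=
  hallPlusUp_cut E k hH _ (upClosed_and (upClosed_slotCone g ℓ) (upClosed_slotCone j ℓ')) hpos

/-- the full-cone row: the weak cone above any cell `x` (for a supported P-cell this is the SINGLETON Hall⁺ row `m(x) + k ≤ m_N(cone x)`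
with the P-mass of the whole cone on the left). -/
theorem hallPlusUp_cone (E : Design) (k : ℕ) (hH : HallPlusUp E k) (x : Cell) [DecidablePred (WeakLive x)]
    (hpos : 0 < massOn E.P (WeakLive x)) : massOn E.P (WeakLive x) + k ≤ massOn E.N (WeakLive x) :=
  hallPlusUp_cut E k hH _ (upClosed_weakLive x) hpos

/-- surplus-free versions from `HallUp`. -/
theorem hallUp_slotCone (E : Design) (hH : HallUp E) (g : Fin 4) (ℓ : Letter) [DecidablePred (SlotCone g ℓ)] :
    massOn E.P (SlotCone g ℓ) ≤ massOn E.N (SlotCone g ℓ) :=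
  hallUp_cut_on E hH _ (upClosedOn_of_upClosed E (upClosed_slotCone g ℓ))


/-! ## §10 (v1.5) THE RING-2 SUPPLIER TABLE (negation g21's room facts R2–R6, typed at design level, every height, no (A1))

In a ring-2 design (`RingLe 2 D`) on the height-`h` alphabet with `Disj ∧ RuleD`, the RULE-D partners of the five cell shapes that drive
`BBPAIR-LAW-negation-g21.md` §4 are pinned down by the SUM RULE: (R2) a supplier of a unit⁴ N-cell at a block deepens EXACTLY ONE block letter to a
top letter one null step below the unit (a hook; with `RingTwoMassLaw.no_bhook_P` it is an A-hook); (R3) a witness of a hook at a block avoiding the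
top slot replaces BOTH block units by hubs (the single cell `(T@g, H, H, u@c)`); (R4∕R6) a supplier of an N-cell with a top letter at `e`, the hub at
`a` and a unit at a third slot, at the block `(e, a)`, keeps the top and deepens the hub to a UNIT (never to a second top); (R4c) at the block
`(e, c)` with `c` a unit slot it deepens the unit to a top letter one null step below it; (R5) a witness of a two-top P-cell at a block (top, hub)
keeps the hub and RAISES the top by a null step.  Each comes with the existence half from RULE D.  R1 (the position types) is `sumN_of_memN` ∕
`sumP_of_memP` at `c = 2`. -/

section RingTwoSupplierTable

variable {h : ℤ} {D : Design}

/-- in ring 2 nothing lies a null step below a top letter. -/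
theorem ring2_eq_of_top {x y : Cell} (hA : D.OnAlphabet h) (hR : RingLe 2 D) (hx : x ∈ D.suppN ++ D.suppP) (hy : y ∈ D.suppN ++ D.suppP)
    {g : Fin 4} (htop : (y g).colevel = 2) (hs : x g = y g ∨ NullStep (x g) (y g)) : x g = y g := by
  rcases hs with e | hn
  · exact e
  · exact absurd hn (not_nullStep_of_colevel_le (hA x hx g) (hA y hy g) (by rw [htop]; exact hR x hx g))

/-- a letter a null step below a unit in ring 2 is a top letter. -/
theorem ring2_below_unit {x y : Cell} (hA : D.OnAlphabet h) (hR : RingLe 2 D) (hx : x ∈ D.suppN ++ D.suppP) (hy : y ∈ D.suppN ++ D.suppP)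
    {g : Fin 4} (hu : (y g).colevel = 1) (hn : NullStep (x g) (y g)) : (x g).colevel = 2 := by
  have h1 := nullStep_colevel_lt (hA x hx g) (hA y hy g) hn
  have h2 := hR x hx g
  omega

/-- **R2** (unit⁴ N-cell): every P-supplier at a block `(g, j)` agrees off the block and deepens exactly one of the two block units to a top
letter one null step below it. -/
theorem unit4_suppliers (hA : D.OnAlphabet h) (hdis : Disj D) (hr : RuleD D) (hR : RingLe 2 D)
    {y : Cell} (hy : y ∈ D.suppN) (hu : ∀ f, (y f).colevel = 1) {g j : Fin 4} (hgj : g ≠ j)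
    {x : Cell} (hx : x ∈ D.suppP) (hs : Supplies x y g j) :
    (∀ f, f ≠ g → f ≠ j → x f = y f) ∧
      ((x g = y g ∧ (x j).colevel = 2 ∧ NullStep (x j) (y j)) ∨ (x j = y j ∧ (x g).colevel = 2 ∧ NullStep (x g) (y g))) := by
  have hxs := mem_supp_of_memP D hx
  have hys := mem_supp_of_memN D hy
  refine ⟨hs.1, ?_⟩
  rcases hs.2.1 with eg | ng <;> rcases hs.2.2 with ej | nj
  · exact absurd (eq_of_supplies_eq hs eg ej) fun e => hdis y hy (e ▸ hx)
  · exact Or.inl ⟨eg, ring2_below_unit hA hR hxs hys (hu j) nj, nj⟩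
  · exact Or.inr ⟨ej, ring2_below_unit hA hR hxs hys (hu g) ng, ng⟩
  · exfalso
    have tg := ring2_below_unit hA hR hxs hys (hu g) ng
    have tj := ring2_below_unit hA hR hxs hys (hu j) nj
    obtain ⟨m, m', hgm, hgm', hjm, hjm', hmm', -⟩ := exists_other_two g j hgj
    have hm := (two_tops_P_hub hA hdis hr hR (by norm_num) hx hgj hmm' (Ne.symm hgm) (Ne.symm hjm) (Ne.symm hgm') (Ne.symm hjm') tg tj).1
    have e1 : x m = y m := hs.1 m (Ne.symm hgm) (Ne.symm hjm)
    have := hu m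
    rw [← e1, hm, hub_colevel] at this
    omega

/-- R2, existence half: a unit⁴ N-cell has, for every block, a P-supplier of that shape (RULE D). -/
theorem unit4_exists_hook (hA : D.OnAlphabet h) (hdis : Disj D) (hr : RuleD D) (hR : RingLe 2 D)
    {y : Cell} (hy : y ∈ D.suppN) (hu : ∀ f, (y f).colevel = 1) {g j : Fin 4} (hgj : g ≠ j) :
    ∃ x ∈ D.suppP, (∀ f, f ≠ g → f ≠ j → x f = y f) ∧
      ((x g = y g ∧ (x j).colevel = 2 ∧ NullStep (x j) (y j)) ∨ (x j = y j ∧ (x g).colevel = 2 ∧ NullStep (x g) (y g))) := by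
  obtain ⟨x, hx, hs⟩ := ruleDN_any hr hy hgj (detects_of_colevel_pos j (by rw [hu g]; norm_num))
  exact ⟨x, hx, unit4_suppliers hA hdis hr hR hy hu hgj hx hs⟩

/-- **R3** (hook P-cell: top letter at `g`, units elsewhere): every N-witness at a block `(a, b)` avoiding `g` replaces both block units by hubs
and keeps the other two letters — it is the single cell `(T@g, H@a, H@b, u@c)`. -/
theorem hook_witnesses (hA : D.OnAlphabet h) (hdis : Disj D) (hr : RuleD D) (hR : RingLe 2 D)
    {x : Cell} (hx : x ∈ D.suppP) {g a b c : Fin 4} (hag : a ≠ g) (hbg : b ≠ g) (hcg : c ≠ g) (hca : c ≠ a) (hcb : c ≠ b)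
    (htop : (x g).colevel = 2) (hu : ∀ f, f ≠ g → (x f).colevel = 1)
    {y : Cell} (hy : y ∈ D.suppN) (hs : Supplies x y a b) :
    y a = Letter.hub h ∧ y b = Letter.hub h ∧ y g = x g ∧ y c = x c := by
  have hxs := mem_supp_of_memP D hx
  have hys := mem_supp_of_memN D hy
  have eg : y g = x g := (hs.1 g (Ne.symm hag) (Ne.symm hbg)).symm
  have ec : y c = x c := (hs.1 c hca hcb).symm
  have tg : (y g).colevel = 2 := by rw [eg]; exact htop
  have uc : (y c).colevel = 1 := by rw [ec]; exact hu c hcg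
  -- a block letter of `y` that stayed a unit would make the pair (g, ·) sum to 3 and force `y c` to be the hub
  have key : ∀ s : Fin 4, s ≠ g → s ≠ c → (x s = y s ∨ NullStep (x s) (y s)) → y s = Letter.hub h := by
    intro s hsg hsc hss
    have hle : (y s).colevel ≤ 1 := by
      rcases hss with e | n
      · rw [← e]; exact le_of_eq (hu s hsg)
      · have := nullStep_colevel_lt (hA x hxs s) (hA y hys s) n; have := hu s hsg; omega
    have hnn := colevel_nonneg (y s)
    rcases (show (y s).colevel = 0 ∨ (y s).colevel = 1 by omega) with h0 | h1
    · exact eq_hub_of_colevel_eq_zero (hA y hys s) h0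
    · exfalso
      have := sum_rule_N_hub hA hdis hr hR (by norm_num) hy (Ne.symm hsg) hcg (Ne.symm hsc) (by rw [tg, h1]; norm_num)
      rw [this, hub_colevel] at uc; omega
  exact ⟨key a hag (Ne.symm hca) hs.2.1, key b hbg (Ne.symm hcb) hs.2.2, eg, ec⟩

/-- R3, existence half: the cell `(T@g, H@a, H@b, u@c)` lies in `supp N` for every such block. -/
theorem hook_forces_witness (hA : D.OnAlphabet h) (hdis : Disj D) (hr : RuleD D) (hR : RingLe 2 D)
    {x : Cell} (hx : x ∈ D.suppP) {g a b c : Fin 4} (hag : a ≠ g) (hbg : b ≠ g) (hab : a ≠ b) (hcg : c ≠ g) (hca : c ≠ a) (hcb : c ≠ b)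
    (htop : (x g).colevel = 2) (hu : ∀ f, f ≠ g → (x f).colevel = 1) :
    ∃ y ∈ D.suppN, y a = Letter.hub h ∧ y b = Letter.hub h ∧ y g = x g ∧ y c = x c := by
  obtain ⟨y, hy, hs⟩ := ruleDP_any hr.2 hx hab (detects_of_colevel_pos b (by rw [hu a hag]; norm_num))
  exact ⟨y, hy, hook_witnesses hA hdis hr hR hx hag hbg hcg hca hcb htop hu hy hs⟩

/-- **R4 ∕ R6** (N-cell with a top letter at `e`, the hub at `a`, a unit at `s`): every P-supplier at the block `(e, a)` keeps the top letter,
agrees off the block, and deepens the hub at `a` to a UNIT (an axis letter of co-level 1) — never to a second top letter. -/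
theorem topHub_suppliers (hA : D.OnAlphabet h) (hdis : Disj D) (hr : RuleD D) (hR : RingLe 2 D)
    {y : Cell} (hy : y ∈ D.suppN) {e a s : Fin 4} (hea : e ≠ a) (hse : s ≠ e) (hsa : s ≠ a)
    (htop : (y e).colevel = 2) (hhub : y a = Letter.hub h) (hunit : (y s).colevel = 1)
    {x : Cell} (hx : x ∈ D.suppP) (hsup : Supplies x y e a) :
    x e = y e ∧ (∀ f, f ≠ e → f ≠ a → x f = y f) ∧ (x a).colevel = 1 ∧ NullStep (x a) (Letter.hub h) ∧ (x a).x * (x a).y = 0 := by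
  have hxs := mem_supp_of_memP D hx
  have hys := mem_supp_of_memN D hy
  have ee : x e = y e := ring2_eq_of_top hA hR hxs hys htop hsup.2.1
  have na : NullStep (x a) (y a) := by
    rcases hsup.2.2 with ea | na
    · exact absurd (eq_of_supplies_eq hsup ee ea) fun h' => hdis y hy (h' ▸ hx)
    · exact na
  have hpos : 0 < (x a).colevel := by
    have h1 := nullStep_colevel_lt (hA x hxs a) (hA y hys a) na
    have h2 : (y a).colevel = 0 := by rw [hhub, hub_colevel]
    have h3 := colevel_nonneg (y a)
    omega
  rw [hhub] at na
  have hax := ((nullStep_hub_iff (hA x hxs a)).1 na).2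
  have hle := hR x hxs a
  rcases (show (x a).colevel = 1 ∨ (x a).colevel = 2 by omega) with h1 | h2
  · exact ⟨ee, hsup.1, h1, na, hax⟩
  · exfalso
    -- two tops at `e` and `a` force the other letters of `x` to be hubs, but `x s = y s` is a unit
    obtain ⟨m, m', hem, hem', ham, ham', hmm', hcov⟩ := exists_other_two e a hea
    have te : (x e).colevel = 2 := by rw [ee]; exact htop
    have hh := two_tops_P_hub hA hdis hr hR (by norm_num) hx hea hmm' (Ne.symm hem) (Ne.symm ham) (Ne.symm hem') (Ne.symm ham') te h2
    have es : x s = y s := hsup.1 s hse hsa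
    have hs0 : (x s).colevel = 0 := by
      rcases hcov s with h' | h' | h' | h'
      · exact absurd h' hse
      · exact absurd h' hsa
      · rw [h', hh.1, hub_colevel]
      · rw [h', hh.2, hub_colevel]
    rw [es] at hs0; omega

/-- R4 ∕ R6, existence half. -/
theorem topHub_forces_unit (hA : D.OnAlphabet h) (hdis : Disj D) (hr : RuleD D) (hR : RingLe 2 D)
    {y : Cell} (hy : y ∈ D.suppN) {e a s : Fin 4} (hea : e ≠ a) (hse : s ≠ e) (hsa : s ≠ a)
    (htop : (y e).colevel = 2) (hhub : y a = Letter.hub h) (hunit : (y s).colevel = 1) :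
    ∃ x ∈ D.suppP, x e = y e ∧ (∀ f, f ≠ e → f ≠ a → x f = y f) ∧ (x a).colevel = 1 ∧ NullStep (x a) (Letter.hub h) ∧
      (x a).x * (x a).y = 0 := by
  obtain ⟨x, hx, hs⟩ := ruleDN_any hr hy hea (detects_of_colevel_pos a (by rw [htop]; norm_num))
  exact ⟨x, hx, topHub_suppliers hA hdis hr hR hy hea hse hsa htop hhub hunit hx hs⟩

/-- **R4c** (same N-cell, block `(e, c)` with `c` a unit slot): every P-supplier keeps the top letter and deepens the unit at `c` to a top
letter one null step below it. -/
theorem topUnit_suppliers (hA : D.OnAlphabet h) (hdis : Disj D) (hR : RingLe 2 D)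
    {y : Cell} (hy : y ∈ D.suppN) {e c : Fin 4} (htop : (y e).colevel = 2) (hunit : (y c).colevel = 1)
    {x : Cell} (hx : x ∈ D.suppP) (hsup : Supplies x y e c) :
    x e = y e ∧ (∀ f, f ≠ e → f ≠ c → x f = y f) ∧ (x c).colevel = 2 ∧ NullStep (x c) (y c) := by
  have hxs := mem_supp_of_memP D hx
  have hys := mem_supp_of_memN D hy
  have ee : x e = y e := ring2_eq_of_top hA hR hxs hys htop hsup.2.1
  have nc : NullStep (x c) (y c) := by
    rcases hsup.2.2 with ec | nc
    · exact absurd (eq_of_supplies_eq hsup ee ec) fun h' => hdis y hy (h' ▸ hx)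
    · exact nc
  exact ⟨ee, hsup.1, ring2_below_unit hA hR hxs hys hunit nc, nc⟩

/-- **R5** (P-cell with top letters at `g` and `e` and the hub at `a`): every N-witness at the block `(g, a)` keeps the hub at `a`, agrees
off the block, and RAISES the top letter at `g` by a null step. -/
theorem twoTop_witnesses (hA : D.OnAlphabet h) (hdis : Disj D)
    {x : Cell} (hx : x ∈ D.suppP) {g a : Fin 4} (hhub : x a = Letter.hub h)
    {y : Cell} (hy : y ∈ D.suppN) (hsup : Supplies x y g a) :
    y a = Letter.hub h ∧ (∀ f, f ≠ g → f ≠ a → y f = x f) ∧ NullStep (x g) (y g) ∧ y g ≠ x g := by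
  have hys := mem_supp_of_memN D hy
  have ea : x a = y a := by
    rcases hsup.2.2 with ea | na
    · exact ea
    · rw [hhub] at na; exact absurd na (not_nullStep_hub (hA y hys a))
  have ng : NullStep (x g) (y g) := by
    rcases hsup.2.1 with eg | ng
    · exact absurd (eq_of_supplies_eq hsup eg ea) fun h' => hdis y hy (h' ▸ hx)
    · exact ng
  refine ⟨by rw [← ea, hhub], fun f hfg hfa => (hsup.1 f hfg hfa).symm, ng, ?_⟩
  intro e; have := ng.1; rw [e] at this; exact lt_irrefl _ this

/-- R5, existence half (the block `(g, a)` detects because the top letter is charged). -/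
theorem twoTop_forces_raised (hA : D.OnAlphabet h) (hdis : Disj D) (hr : RuleD D)
    {x : Cell} (hx : x ∈ D.suppP) {g a : Fin 4} (hga : g ≠ a) (htop : 0 < (x g).colevel) (hhub : x a = Letter.hub h) :
    ∃ y ∈ D.suppN, y a = Letter.hub h ∧ (∀ f, f ≠ g → f ≠ a → y f = x f) ∧ NullStep (x g) (y g) ∧ y g ≠ x g := by
  obtain ⟨y, hy, hs⟩ := ruleDP_any hr.2 hx hga (detects_of_colevel_pos a htop)
  exact ⟨y, hy, twoTop_witnesses hA hdis hx hhub hy hs⟩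

end RingTwoSupplierTable

/-! ## §11 THE PER-PAIR BB LAW — a slot-aware e-free identity (clause 2 of (A1) only; every height `η`)

`(η·one − h)^{⊗4} = Q ⊗ Q ⊗ one ⊗ one` with the letter polynomial `Q = pt − 2η·h + η²·one`, whose value on a letter of the height-`η`
alphabet is `Q_η(ℓ) = (η − a)² − |β|² = 2·|x·y|`.  Clause 2 of (A1) (e-free words of equal degree agree) makes every two-slot e-free
coefficient `T(σ@g ⊗ τ@h ⊗ one ⊗ one)` independent of the pair `{g,h}`, hence the signed mass `Σ_N m·|x_g y_g|·|x_h y_h| − Σ_P (same)` is the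
SAME for all six pairs (`bbpair_law`).  On a ring-2 design `|x_g y_g|·|x_h y_h|` is the indicator of «diagonal tops (B) at both `g` and `h`»,
so this is the per-pair refinement of `RingTwoMassLaw.unit4_balance'` (which is its sum over the six pairs): the P-mass of the cells with B's at
`{g,h}` does not depend on the pair (`bbpair_massP`, §11b). -/

section BBPairLaw

variable {D : Design}

/-- the signed Gaussian-integer functional `Σ_N m·ψ − Σ_P m·ψ` (so that `D.T w = slinG D (cellCoef · w)`). -/
def slinG (D : Design) (ψ : Cell → GaussianInt) : GaussianInt :=
  (D.N.map fun cm => (cm.2 : GaussianInt) * ψ cm.1).sum - (D.P.map fun cm => (cm.2 : GaussianInt) * ψ cm.1).sum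

/-- the signed integer functional `Σ_N m·φ − Σ_P m·φ`. -/
def slinZ (D : Design) (φ : Cell → ℤ) : ℤ :=
  (D.N.map fun cm => (cm.2 : ℤ) * φ cm.1).sum - (D.P.map fun cm => (cm.2 : ℤ) * φ cm.1).sum

theorem T_eq_slinG (D : Design) (w : Word) : D.T w = slinG D (fun c => cellCoef c w) := rfl

theorem lsumG_finsum {ι : Type*} (s : Finset ι) (L : List (Cell × ℕ)) (lam : ι → GaussianInt) (ψ : ι → Cell → GaussianInt) :
    (L.map fun cm => (cm.2 : GaussianInt) * ∑ i ∈ s, lam i * ψ i cm.1).sum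
      = ∑ i ∈ s, lam i * (L.map fun cm => (cm.2 : GaussianInt) * ψ i cm.1).sum := by
  induction L with
  | nil => simp
  | cons x t ih =>
    simp only [List.map_cons, List.sum_cons]
    rw [ih, Finset.mul_sum, ← Finset.sum_add_distrib]
    exact Finset.sum_congr rfl fun i _ => by ring

theorem slinG_finsum {ι : Type*} (s : Finset ι) (lam : ι → GaussianInt) (ψ : ι → Cell → GaussianInt) :
    slinG D (fun c => ∑ i ∈ s, lam i * ψ i c) = ∑ i ∈ s, lam i * slinG D (ψ i) := by
  simp only [slinG]
  rw [lsumG_finsum, lsumG_finsum, ← Finset.sum_sub_distrib]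
  exact Finset.sum_congr rfl fun i _ => by ring

theorem lsumG_congr_supp (L : List (Cell × ℕ)) {ψ χ : Cell → GaussianInt} (hL : ∀ cm ∈ L, 0 < cm.2 → ψ cm.1 = χ cm.1) :
    (L.map fun cm => (cm.2 : GaussianInt) * ψ cm.1).sum = (L.map fun cm => (cm.2 : GaussianInt) * χ cm.1).sum := by
  induction L with
  | nil => rfl
  | cons x t ih =>
    simp only [List.map_cons, List.sum_cons]
    rw [ih fun cm hcm => hL cm (List.mem_cons.mpr (Or.inr hcm))]
    rcases Nat.eq_zero_or_pos x.2 with h0 | hpos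
    · simp [h0]
    · rw [hL x (List.mem_cons.mpr (Or.inl rfl)) hpos]

theorem slinG_congr_supp {ψ χ : Cell → GaussianInt} (hN : ∀ cm ∈ D.N, 0 < cm.2 → ψ cm.1 = χ cm.1)
    (hP : ∀ cm ∈ D.P, 0 < cm.2 → ψ cm.1 = χ cm.1) : slinG D ψ = slinG D χ := by
  unfold slinG; rw [lsumG_congr_supp D.N hN, lsumG_congr_supp D.P hP]

theorem lsumG_intCast (L : List (Cell × ℕ)) (φ : Cell → ℤ) :
    (L.map fun cm => (cm.2 : GaussianInt) * ((φ cm.1 : ℤ) : GaussianInt)).sum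
      = (((L.map fun cm => (cm.2 : ℤ) * φ cm.1).sum : ℤ) : GaussianInt) := by
  induction L with
  | nil => simp
  | cons x t ih => simp only [List.map_cons, List.sum_cons, ih]; push_cast; ring

theorem slinG_intCast (φ : Cell → ℤ) : slinG D (fun c => ((φ c : ℤ) : GaussianInt)) = ((slinZ D φ : ℤ) : GaussianInt) := by
  simp only [slinG, slinZ]; rw [lsumG_intCast, lsumG_intCast]; push_cast; ring

theorem lsumZ_smul (L : List (Cell × ℕ)) (k : ℤ) (φ : Cell → ℤ) :
    (L.map fun cm => (cm.2 : ℤ) * (k * φ cm.1)).sum = k * (L.map fun cm => (cm.2 : ℤ) * φ cm.1).sum := by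
  induction L with
  | nil => simp
  | cons x t ih => simp only [List.map_cons, List.sum_cons, ih]; ring

theorem slinZ_smul (k : ℤ) (φ : Cell → ℤ) : slinZ D (fun c => k * φ c) = k * slinZ D φ := by
  simp only [slinZ]; rw [lsumZ_smul, lsumZ_smul]; ring

/-- the two-slot word: symbol `σ` at slot `g`, `τ` at slot `h`, `one` elsewhere. -/
def wd (σ τ : Sym) (g h : Fin 4) : Word := Function.update (Function.update (fun _ => Sym.one) g σ) h τ

theorem wd_at_h (σ τ : Sym) (g h : Fin 4) : wd σ τ g h h = τ := by simp [wd]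
theorem wd_at_g (σ τ : Sym) {g h : Fin 4} (hgh : g ≠ h) : wd σ τ g h g = σ := by
  simp [wd, Function.update_of_ne hgh]
theorem wd_other (σ τ : Sym) {g h f : Fin 4} (hfg : f ≠ g) (hfh : f ≠ h) : wd σ τ g h f = Sym.one := by
  simp [wd, Function.update_of_ne hfh, Function.update_of_ne hfg]

theorem wd_efree {σ τ : Sym} (hσ : σ.efree = true) (hτ : τ.efree = true) {g h : Fin 4} (hgh : g ≠ h) : (wd σ τ g h).efree := by
  intro f
  by_cases hfh : f = h
  · rw [hfh, wd_at_h]; exact hτ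
  by_cases hfg : f = g
  · rw [hfg, wd_at_g σ τ hgh]; exact hσ
  rw [wd_other σ τ hfg hfh]; rfl

theorem sum_two_slots {M : Type*} [AddCommMonoid M] (F : Fin 4 → M) {g h : Fin 4} (hgh : g ≠ h)
    (hF : ∀ f, f ≠ g → f ≠ h → F f = 0) : ∑ f : Fin 4, F f = F g + F h := by
  rw [← Finset.add_sum_erase Finset.univ F (Finset.mem_univ g),
    ← Finset.add_sum_erase (Finset.univ.erase g) F (Finset.mem_erase.mpr ⟨hgh.symm, Finset.mem_univ h⟩),
    Finset.sum_eq_zero fun f hf => ?_, add_zero]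
  obtain ⟨hfh, hf'⟩ := Finset.mem_erase.mp hf
  exact hF f (Finset.mem_erase.mp hf').1 hfh

theorem prod_two_slots {M : Type*} [CommMonoid M] (F : Fin 4 → M) {g h : Fin 4} (hgh : g ≠ h)
    (hF : ∀ f, f ≠ g → f ≠ h → F f = 1) : ∏ f : Fin 4, F f = F g * F h := by
  rw [← Finset.mul_prod_erase Finset.univ F (Finset.mem_univ g),
    ← Finset.mul_prod_erase (Finset.univ.erase g) F (Finset.mem_erase.mpr ⟨hgh.symm, Finset.mem_univ h⟩),
    Finset.prod_eq_one fun f hf => ?_, mul_one]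
  obtain ⟨hfh, hf'⟩ := Finset.mem_erase.mp hf
  exact hF f (Finset.mem_erase.mp hf').1 hfh

theorem wd_deg (σ τ : Sym) {g h : Fin 4} (hgh : g ≠ h) : (wd σ τ g h).deg = σ.deg + τ.deg := by
  unfold Word.deg
  rw [sum_two_slots (fun f => (wd σ τ g h f).deg) hgh fun f hfg hfh => by simp only [wd_other σ τ hfg hfh]; rfl]
  simp only [wd_at_g σ τ hgh, wd_at_h]

theorem cellCoef_wd (c : Cell) (σ τ : Sym) {g h : Fin 4} (hgh : g ≠ h) :
    cellCoef c (wd σ τ g h) = σ.coef (c g) * τ.coef (c h) := by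
  unfold cellCoef
  rw [prod_two_slots (fun f => (wd σ τ g h f).coef (c f)) hgh fun f hfg hfh => by simp only [wd_other σ τ hfg hfh]; rfl]
  simp only [wd_at_g σ τ hgh, wd_at_h]

/-- clause 2 of (A1) makes every two-slot e-free coefficient PAIR-INDEPENDENT. -/
theorem T_wd_indep (h1 : D.A1) {σ τ : Sym} (hσ : σ.efree = true) (hτ : τ.efree = true) {g h g' h' : Fin 4}
    (hgh : g ≠ h) (hgh' : g' ≠ h') : D.T (wd σ τ g h) = D.T (wd σ τ g' h') :=
  h1.2 _ _ (wd_efree hσ hτ hgh) (wd_efree hσ hτ hgh') (by rw [wd_deg σ τ hgh, wd_deg σ τ hgh'])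

/-- `Q_η(ℓ) = n(ℓ) − 2η·a + η²` — the value of the letter polynomial `pt − 2η·h + η²·one` on `ch(ℓ)`. -/
def Q (η : ℤ) (ℓ : Letter) : GaussianInt :=
  (ℓ.selfInt : GaussianInt) - 2 * (η : GaussianInt) * (ℓ.a : GaussianInt) + (η : GaussianInt) ^ 2

/-- the three e-free symbols and the coefficients of `Q` on them -/
def qsym : Fin 3 → Sym
  | 0 => Sym.pt
  | 1 => Sym.h
  | 2 => Sym.one
def qlam (η : ℤ) : Fin 3 → GaussianInt
  | 0 => 1
  | 1 => -2 * (η : GaussianInt)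
  | 2 => (η : GaussianInt) ^ 2

theorem qsym_efree (i : Fin 3) : (qsym i).efree = true := by
  fin_cases i <;> rfl

theorem Q_eq_sum (η : ℤ) (ℓ : Letter) : Q η ℓ = ∑ i : Fin 3, qlam η i * (qsym i).coef ℓ := by
  rw [Fin.sum_univ_three]
  show Q η ℓ = 1 * (ℓ.selfInt : GaussianInt) + -2 * (η : GaussianInt) * (ℓ.a : GaussianInt) + (η : GaussianInt) ^ 2 * 1
  unfold Q; ring

theorem slinG_QQ_eq (η : ℤ) {g h : Fin 4} (hgh : g ≠ h) :
    slinG D (fun c => Q η (c g) * Q η (c h))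
      = ∑ i : Fin 3, qlam η i * ∑ j : Fin 3, qlam η j * D.T (wd (qsym i) (qsym j) g h) := by
  have hfun : (fun c : Cell => Q η (c g) * Q η (c h))
      = fun c => ∑ i : Fin 3, qlam η i * ∑ j : Fin 3, qlam η j * cellCoef c (wd (qsym i) (qsym j) g h) := by
    funext c
    rw [Q_eq_sum, Q_eq_sum, Finset.sum_mul_sum]
    refine Finset.sum_congr rfl fun i _ => ?_
    rw [Finset.mul_sum]
    exact Finset.sum_congr rfl fun j _ => by rw [cellCoef_wd c _ _ hgh]; ring
  rw [hfun, slinG_finsum]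
  refine Finset.sum_congr rfl fun i _ => ?_
  rw [slinG_finsum]
  rfl

/-- **THE PER-PAIR BB LAW, tensor form (every height; clause 2 of (A1) only):** the signed mass `Σ_N m·Q_η(y_g)Q_η(y_h) − Σ_P m·Q_η(x_g)Q_η(x_h)`
does not depend on the pair `{g,h}`. -/
theorem slinG_QQ_indep (h1 : D.A1) (η : ℤ) {g h g' h' : Fin 4} (hgh : g ≠ h) (hgh' : g' ≠ h') :
    slinG D (fun c => Q η (c g) * Q η (c h)) = slinG D (fun c => Q η (c g') * Q η (c h')) := by
  rw [slinG_QQ_eq η hgh, slinG_QQ_eq η hgh']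
  refine Finset.sum_congr rfl fun i _ => ?_
  congr 1
  exact Finset.sum_congr rfl fun j _ => by rw [T_wd_indep h1 (qsym_efree i) (qsym_efree j) hgh hgh']

/-- on the height-`η` alphabet `Q_η(ℓ) = (η − a)² − |β|² = (|x| + |y|)² − x² − y² = 2·|x·y|`. -/
theorem Q_eq_of_onAlphabet {η : ℤ} {ℓ : Letter} (hℓ : ℓ.OnAlphabet η) : Q η ℓ = ((2 * |ℓ.x * ℓ.y| : ℤ) : GaussianInt) := by
  have hc : η - ℓ.a = |ℓ.x| + |ℓ.y| := by
    have := hℓ.1; unfold Letter.height at this; linarith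
  have e1 : (η - ℓ.a) ^ 2 = (|ℓ.x| + |ℓ.y|) ^ 2 := by rw [hc]
  have key : ℓ.selfInt - 2 * η * ℓ.a + η ^ 2 = 2 * |ℓ.x * ℓ.y| := by
    unfold Letter.selfInt Letter.bnorm
    rw [abs_mul]
    nlinarith [sq_abs ℓ.x, sq_abs ℓ.y, e1]
  unfold Q
  exact_mod_cast key

/-- the BB-pair density of a cell at the pair `{g,h}`: `|x_g·y_g|·|x_h·y_h|` (on a ring-2 design: the indicator of «B at g and B at h»). -/
def dd (g h : Fin 4) (c : Cell) : ℤ := |(c g).x * (c g).y| * |(c h).x * (c h).y|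

/-- **THE PER-PAIR BB LAW (integer form, every height):** on the height-`η` alphabet, clause 2 of (A1) alone gives
`Σ_N m·|x_g y_g|·|x_h y_h| − Σ_P m·|x_g y_g|·|x_h y_h|` independent of the pair `{g,h}`. -/
theorem bbpair_law {η : ℤ} (hA : D.OnAlphabet η) (h1 : D.A1) {g h g' h' : Fin 4} (hgh : g ≠ h) (hgh' : g' ≠ h') :
    slinZ D (dd g h) = slinZ D (dd g' h') := by
  have hQ : ∀ a b : Fin 4, slinG D (fun c => Q η (c a) * Q η (c b)) = ((4 * slinZ D (dd a b) : ℤ) : GaussianInt) := by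
    intro a b
    have hcell : ∀ c ∈ D.suppN ++ D.suppP, Q η (c a) * Q η (c b) = ((4 * dd a b c : ℤ) : GaussianInt) := by
      intro c hc
      rw [Q_eq_of_onAlphabet (hA c hc a), Q_eq_of_onAlphabet (hA c hc b)]
      unfold dd; push_cast; ring
    have e1 : slinG D (fun c => Q η (c a) * Q η (c b)) = slinG D (fun c => ((4 * dd a b c : ℤ) : GaussianInt)) :=
      slinG_congr_supp
        (fun cm hcm hpos => hcell cm.1 (List.mem_append.mpr (Or.inl ((mem_suppN_iff D cm.1).mpr ⟨cm.2, hcm, hpos⟩))))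
        (fun cm hcm hpos => hcell cm.1 (List.mem_append.mpr (Or.inr ((mem_suppP_iff D cm.1).mpr ⟨cm.2, hcm, hpos⟩))))
    rw [e1, slinG_intCast (D := D) (fun c => 4 * dd a b c), slinZ_smul]
  have e := slinG_QQ_indep h1 η hgh hgh'
  rw [hQ, hQ] at e
  have e4 : (4 * slinZ D (dd g h) : ℤ) = 4 * slinZ D (dd g' h') := by exact_mod_cast e
  linarith

end BBPairLaw

/-! ### §11b The ring-2 reading: the P-mass of «B at `g` and B at `h`» does not depend on the pair

On a `RingLe 2` design `|x·y| ≤ 1` for every support letter, with equality exactly for the diagonal tops `B = (a; ±1, ±1)`; so `dd g h` is the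
indicator of `BB g h` := «`x_g y_g ≠ 0 ∧ x_h y_h ≠ 0`» on the support, the N-side mass of `BB g h` vanishes (two top-ring letters in a supported
N-cell contradict `ring_top_unique_N`), and `bbpair_law` becomes: **`m_P(BB g h)` is the same number `k` for all six pairs** (`bbpair_massP`).
Summed over the pairs this is `RingTwoMassLaw.unit4_balance'` (`3σ = −2·m_P(HHDD)`, σ = `s(u⁴) − 2·m_P(A-hooks)`); the per-pair equality is the
new, slot-aware content (negation g21's L3, `BBPAIR-LAW-negation-g21.md` §3): `m_P(HHDD) = 6k`, `σ = −4k`. -/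

section BBPairRing

variable {η : ℤ} {D : Design}

/-- «B at `g` and B at `h`»: both letters have `x·y ≠ 0`. -/
abbrev BB (g h : Fin 4) (c : Cell) : Prop := (c g).x * (c g).y ≠ 0 ∧ (c h).x * (c h).y ≠ 0

theorem abs_xy_le_one_of_colevel {ℓ : Letter} (hc : ℓ.colevel ≤ 2) : |ℓ.x * ℓ.y| ≤ 1 := by
  unfold Letter.colevel at hc
  rw [abs_mul]
  nlinarith [abs_nonneg ℓ.x, abs_nonneg ℓ.y, sq_nonneg (|ℓ.x| - |ℓ.y|), mul_nonneg (abs_nonneg ℓ.x) (abs_nonneg ℓ.y)]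

theorem two_le_colevel_of_xy_ne {ℓ : Letter} (h : ℓ.x * ℓ.y ≠ 0) : 2 ≤ ℓ.colevel := by
  unfold Letter.colevel
  have hx : ℓ.x ≠ 0 := fun h0 => h (by rw [h0, zero_mul])
  have hy : ℓ.y ≠ 0 := fun h0 => h (by rw [h0, mul_zero])
  have := Int.one_le_abs hx
  have := Int.one_le_abs hy
  omega

theorem abs_xy_eq_one_of {ℓ : Letter} (hc : ℓ.colevel ≤ 2) (hne : ℓ.x * ℓ.y ≠ 0) : |ℓ.x * ℓ.y| = 1 :=
  le_antisymm (abs_xy_le_one_of_colevel hc) (Int.one_le_abs hne)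

theorem dd_eq_ite {g h : Fin 4} {c : Cell} (hg : (c g).colevel ≤ 2) (hh : (c h).colevel ≤ 2) :
    dd g h c = if BB g h c then 1 else 0 := by
  by_cases hb : BB g h c
  · rw [if_pos hb]
    unfold dd
    rw [abs_xy_eq_one_of hg hb.1, abs_xy_eq_one_of hh hb.2, one_mul]
  · rw [if_neg hb]
    unfold dd
    by_cases h1 : (c g).x * (c g).y = 0
    · rw [h1, abs_zero, zero_mul]
    · have h2 : (c h).x * (c h).y = 0 := by
        by_contra h2
        exact hb ⟨h1, h2⟩
      rw [h2, abs_zero, mul_zero]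

theorem massOn_cons_of_pos {a : Cell × ℕ} {t : List (Cell × ℕ)} {U : Cell → Prop} [DecidablePred U] (hU : U a.1) :
    massOn (a :: t) U = a.2 + massOn t U := by
  unfold massOn; simp [hU]

theorem massOn_cons_of_neg {a : Cell × ℕ} {t : List (Cell × ℕ)} {U : Cell → Prop} [DecidablePred U] (hU : ¬ U a.1) :
    massOn (a :: t) U = massOn t U := by
  unfold massOn; simp [hU]

/-- a density that is the indicator of `U` on the positive entries sums to the `U`-mass. -/
theorem lsumZ_ite (L : List (Cell × ℕ)) (U : Cell → Prop) [DecidablePred U] (φ : Cell → ℤ)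
    (hL : ∀ cm ∈ L, 0 < cm.2 → φ cm.1 = if U cm.1 then 1 else 0) :
    (L.map fun cm => (cm.2 : ℤ) * φ cm.1).sum = (massOn L U : ℤ) := by
  induction L with
  | nil => simp [massOn]
  | cons a t ih =>
    have iht := ih fun cm hcm => hL cm (List.mem_cons.mpr (Or.inr hcm))
    simp only [List.map_cons, List.sum_cons, iht]
    by_cases ha : U a.1
    · rw [massOn_cons_of_pos ha]
      rcases Nat.eq_zero_or_pos a.2 with h0 | hpos
      · simp [h0]
      · rw [hL a (List.mem_cons.mpr (Or.inl rfl)) hpos, if_pos ha]; push_cast; ring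
    · rw [massOn_cons_of_neg ha]
      rcases Nat.eq_zero_or_pos a.2 with h0 | hpos
      · simp [h0]
      · rw [hL a (List.mem_cons.mpr (Or.inl rfl)) hpos, if_neg ha]; ring

theorem slinZ_dd_eq (hR : RingLe 2 D) (g h : Fin 4) :
    slinZ D (dd g h) = (massOn D.N (BB g h) : ℤ) - (massOn D.P (BB g h) : ℤ) := by
  simp only [slinZ]
  rw [lsumZ_ite D.N (BB g h) (dd g h) fun cm hcm hpos => ?_, lsumZ_ite D.P (BB g h) (dd g h) fun cm hcm hpos => ?_]
  · have hc := mem_supp_of_memP D ((mem_suppP_iff D cm.1).mpr ⟨cm.2, hcm, hpos⟩)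
    exact dd_eq_ite (hR _ hc g) (hR _ hc h)
  · have hc := mem_supp_of_memN D ((mem_suppN_iff D cm.1).mpr ⟨cm.2, hcm, hpos⟩)
    exact dd_eq_ite (hR _ hc g) (hR _ hc h)

/-- no supported N-cell of a ring-2 RULE-D room has B's at two slots (two top-ring letters). -/
theorem massOn_N_BB_eq_zero (hA : D.OnAlphabet η) (hdis : Disj D) (hr : RuleD D) (hR : RingLe 2 D) {g h : Fin 4} (hgh : g ≠ h) :
    massOn D.N (BB g h) = 0 := by
  have key : ∀ cm ∈ D.N, 0 < cm.2 → ¬ BB g h cm.1 := by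
    intro cm hcm hpos hBB
    have hy : cm.1 ∈ D.suppN := (mem_suppN_iff D cm.1).mpr ⟨cm.2, hcm, hpos⟩
    have hc := mem_supp_of_memN D hy
    have cg : (cm.1 g).colevel = 2 := le_antisymm (hR _ hc g) (two_le_colevel_of_xy_ne hBB.1)
    have ch : (cm.1 h).colevel = 2 := le_antisymm (hR _ hc h) (two_le_colevel_of_xy_ne hBB.2)
    exact ring_top_unique_N hA hdis hr hR (by norm_num) hy hgh cg ch
  have h1 := massOn_add_massOn_not D.N (BB g h)
  have h2 := massOn_eq_total_of D.N (fun c => ¬ BB g h c) key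
  omega

/-- **THE PER-PAIR BB LAW on a ring-2 room (every height):** `OnAlphabet ∧ (A1) ∧ Disj ∧ RuleD ∧ RingLe 2` ⇒ the P-mass of the cells with B's at
the slots `g` and `h` is the same for all six pairs `{g,h}`. -/
theorem bbpair_massP (hA : D.OnAlphabet η) (h1 : D.A1) (hdis : Disj D) (hr : RuleD D) (hR : RingLe 2 D)
    {g h g' h' : Fin 4} (hgh : g ≠ h) (hgh' : g' ≠ h') : massOn D.P (BB g h) = massOn D.P (BB g' h') := by
  have e := bbpair_law hA h1 hgh hgh'
  rw [slinZ_dd_eq hR, slinZ_dd_eq hR, massOn_N_BB_eq_zero hA hdis hr hR hgh, massOn_N_BB_eq_zero hA hdis hr hR hgh'] at e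
  omega

/-- signed form: `Σ_N − Σ_P` of the BB-pair density is `−m_P(BB g h)` on a ring-2 room. -/
theorem slinZ_dd_eq_neg_massP (hA : D.OnAlphabet η) (hdis : Disj D) (hr : RuleD D) (hR : RingLe 2 D) {g h : Fin 4} (hgh : g ≠ h) :
    slinZ D (dd g h) = -(massOn D.P (BB g h) : ℤ) := by
  rw [slinZ_dd_eq hR, massOn_N_BB_eq_zero hA hdis hr hR hgh]; simp

end BBPairRing

/-! ### §11c The lower-degree companions at every ring: (P1) `Σ_N − Σ_P` of the co-level `c_g` is slot-independent; (P2) «CC = 2ΔB»: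
`Σ_N − Σ_P` of `c_g·c_h` equals `Σ_N − Σ_P` of `2|x_p y_p|` for every pair `g ≠ h` and EVERY slot `p` (negation g21's bonus law, typed for all
heights from clause 2 of (A1) alone: `(η·one − h)^{⊗2}` and `Q_η` have the same degree profile `t₂ − 2η t₁ + η² t₀`). -/

section LowerDegree

variable {D : Design}

/-- clause 2 for two-slot words with possibly different symbols of equal total degree. -/
theorem T_wd_eq (h1 : D.A1) {σ τ σ' τ' : Sym} (hσ : σ.efree = true) (hτ : τ.efree = true) (hσ' : σ'.efree = true) (hτ' : τ'.efree = true)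
    {g h g' h' : Fin 4} (hgh : g ≠ h) (hgh' : g' ≠ h') (hdeg : σ.deg + τ.deg = σ'.deg + τ'.deg) :
    D.T (wd σ τ g h) = D.T (wd σ' τ' g' h') :=
  h1.2 _ _ (wd_efree hσ hτ hgh) (wd_efree hσ' hτ' hgh') (by rw [wd_deg σ τ hgh, wd_deg σ' τ' hgh', hdeg])

/-- `C_η(ℓ) = η − a` — the value of `η·one − h` on `ch(ℓ)` (= the co-level on the height-`η` alphabet). -/
def Cc (η : ℤ) (ℓ : Letter) : GaussianInt := (η : GaussianInt) - (ℓ.a : GaussianInt)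

def csym : Fin 2 → Sym
  | 0 => Sym.one
  | 1 => Sym.h
def clam (η : ℤ) : Fin 2 → GaussianInt
  | 0 => (η : GaussianInt)
  | 1 => -1

theorem csym_efree (i : Fin 2) : (csym i).efree = true := by
  fin_cases i <;> rfl

theorem Cc_eq_sum (η : ℤ) (ℓ : Letter) : Cc η ℓ = ∑ i : Fin 2, clam η i * (csym i).coef ℓ := by
  rw [Fin.sum_univ_two]
  show Cc η ℓ = (η : GaussianInt) * 1 + -1 * (ℓ.a : GaussianInt)
  unfold Cc; ring

theorem slinG_CC_eq (η : ℤ) {g h : Fin 4} (hgh : g ≠ h) :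
    slinG D (fun c => Cc η (c g) * Cc η (c h))
      = ∑ i : Fin 2, clam η i * ∑ j : Fin 2, clam η j * D.T (wd (csym i) (csym j) g h) := by
  have hfun : (fun c : Cell => Cc η (c g) * Cc η (c h))
      = fun c => ∑ i : Fin 2, clam η i * ∑ j : Fin 2, clam η j * cellCoef c (wd (csym i) (csym j) g h) := by
    funext c
    rw [Cc_eq_sum, Cc_eq_sum, Finset.sum_mul_sum]
    refine Finset.sum_congr rfl fun i _ => ?_
    rw [Finset.mul_sum]
    exact Finset.sum_congr rfl fun j _ => by rw [cellCoef_wd c _ _ hgh]; ring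
  rw [hfun, slinG_finsum]
  refine Finset.sum_congr rfl fun i _ => ?_
  rw [slinG_finsum]
  rfl

theorem slinG_C_eq (η : ℤ) {g h : Fin 4} (hgh : g ≠ h) :
    slinG D (fun c => Cc η (c g)) = ∑ i : Fin 2, clam η i * D.T (wd (csym i) Sym.one g h) := by
  have hfun : (fun c : Cell => Cc η (c g)) = fun c => ∑ i : Fin 2, clam η i * cellCoef c (wd (csym i) Sym.one g h) := by
    funext c
    rw [Cc_eq_sum]
    exact Finset.sum_congr rfl fun i _ => by rw [cellCoef_wd c _ _ hgh]; simp [Sym.coef]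
  rw [hfun, slinG_finsum]
  rfl

theorem slinG_Q_eq (η : ℤ) {p p' : Fin 4} (hpp : p ≠ p') :
    slinG D (fun c => Q η (c p)) = ∑ i : Fin 3, qlam η i * D.T (wd (qsym i) Sym.one p p') := by
  have hfun : (fun c : Cell => Q η (c p)) = fun c => ∑ i : Fin 3, qlam η i * cellCoef c (wd (qsym i) Sym.one p p') := by
    funext c
    rw [Q_eq_sum]
    exact Finset.sum_congr rfl fun i _ => by rw [cellCoef_wd c _ _ hpp]; simp [Sym.coef]
  rw [hfun, slinG_finsum]
  rfl

/-- **(P1), tensor form:** `Σ_N − Σ_P` of `C_η` at slot `g` does not depend on `g`. -/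
theorem slinG_C_indep (h1 : D.A1) (η : ℤ) (g g' : Fin 4) :
    slinG D (fun c => Cc η (c g)) = slinG D (fun c => Cc η (c g')) := by
  obtain ⟨h, hgh⟩ := exists_ne g
  obtain ⟨h', hgh'⟩ := exists_ne g'
  rw [slinG_C_eq η (Ne.symm hgh), slinG_C_eq η (Ne.symm hgh')]
  exact Finset.sum_congr rfl fun i _ => by
    rw [T_wd_eq h1 (csym_efree i) rfl (csym_efree i) rfl (Ne.symm hgh) (Ne.symm hgh') rfl]

/-- **(P2) «CC = Q», tensor form:** for `g ≠ h` and any slot `p`, `Σ_N − Σ_P` of `C_η(·_g)·C_η(·_h)` equals `Σ_N − Σ_P` of `Q_η(·_p)`. -/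
theorem slinG_CC_eq_Q (h1 : D.A1) (η : ℤ) {g h : Fin 4} (hgh : g ≠ h) (p : Fin 4) :
    slinG D (fun c => Cc η (c g) * Cc η (c h)) = slinG D (fun c => Q η (c p)) := by
  obtain ⟨p', hpp⟩ := exists_ne p
  rw [slinG_CC_eq η hgh, slinG_Q_eq η (Ne.symm hpp), Fin.sum_univ_two, Fin.sum_univ_two, Fin.sum_univ_two, Fin.sum_univ_three]
  have e00 : D.T (wd (csym 0) (csym 0) g h) = D.T (wd (qsym 2) Sym.one p p') :=
    T_wd_eq h1 rfl rfl rfl rfl hgh (Ne.symm hpp) rfl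
  have e01 : D.T (wd (csym 0) (csym 1) g h) = D.T (wd (qsym 1) Sym.one p p') :=
    T_wd_eq h1 rfl rfl rfl rfl hgh (Ne.symm hpp) rfl
  have e10 : D.T (wd (csym 1) (csym 0) g h) = D.T (wd (qsym 1) Sym.one p p') :=
    T_wd_eq h1 rfl rfl rfl rfl hgh (Ne.symm hpp) rfl
  have e11 : D.T (wd (csym 1) (csym 1) g h) = D.T (wd (qsym 0) Sym.one p p') :=
    T_wd_eq h1 rfl rfl rfl rfl hgh (Ne.symm hpp) rfl
  rw [e00, e01, e10, e11]
  simp only [clam, qlam]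
  ring

theorem Cc_eq_of_onAlphabet {η : ℤ} {ℓ : Letter} (hℓ : ℓ.OnAlphabet η) : Cc η ℓ = ((ℓ.colevel : ℤ) : GaussianInt) := by
  rw [colevel_eq_of_onAlphabet hℓ]; unfold Cc; push_cast; ring

/-- **(P1), integer form (every height):** the signed co-level mass `Σ_N m·c(y_g) − Σ_P m·c(x_g)` is the same for every slot `g`. -/
theorem colevel_mass_slot_indep {η : ℤ} (hA : D.OnAlphabet η) (h1 : D.A1) (g g' : Fin 4) :
    slinZ D (fun c => (c g).colevel) = slinZ D (fun c => (c g').colevel) := by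
  have hG : ∀ a : Fin 4, slinG D (fun c => Cc η (c a)) = ((slinZ D (fun c => (c a).colevel) : ℤ) : GaussianInt) := by
    intro a
    have e1 : slinG D (fun c => Cc η (c a)) = slinG D (fun c => (((c a).colevel : ℤ) : GaussianInt)) :=
      slinG_congr_supp
        (fun cm hcm hpos => Cc_eq_of_onAlphabet
          (hA cm.1 (List.mem_append.mpr (Or.inl ((mem_suppN_iff D cm.1).mpr ⟨cm.2, hcm, hpos⟩))) a))
        (fun cm hcm hpos => Cc_eq_of_onAlphabet
          (hA cm.1 (List.mem_append.mpr (Or.inr ((mem_suppP_iff D cm.1).mpr ⟨cm.2, hcm, hpos⟩))) a))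
    rw [e1, slinG_intCast (D := D) (fun c => (c a).colevel)]
  have e := slinG_C_indep h1 η g g'
  rw [hG, hG] at e
  exact_mod_cast e

/-- **(P2) «CC = 2ΔB», integer form (every height):** for `g ≠ h` and every slot `p`,
`Σ_N m·c(y_g)c(y_h) − Σ_P m·c(x_g)c(x_h) = Σ_N m·2|x_p y_p| − Σ_P m·2|x_p y_p|` (on ring 2: `= 2·(m_N − m_P)(B at p)`; on ring 3 the right side
weighs B with 2 and the off-axis `D = (η−3; ±2, ±1), (η−3; ±1, ±2)` with 4). -/
theorem cc_mass_law {η : ℤ} (hA : D.OnAlphabet η) (h1 : D.A1) {g h : Fin 4} (hgh : g ≠ h) (p : Fin 4) :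
    slinZ D (fun c => (c g).colevel * (c h).colevel) = slinZ D (fun c => 2 * |(c p).x * (c p).y|) := by
  have eL : slinG D (fun c => Cc η (c g) * Cc η (c h)) = ((slinZ D (fun c => (c g).colevel * (c h).colevel) : ℤ) : GaussianInt) := by
    have e1 : slinG D (fun c => Cc η (c g) * Cc η (c h)) = slinG D (fun c => (((c g).colevel * (c h).colevel : ℤ) : GaussianInt)) :=
      slinG_congr_supp
        (fun cm hcm hpos => by
          have hc : cm.1 ∈ D.suppN ++ D.suppP := List.mem_append.mpr (Or.inl ((mem_suppN_iff D cm.1).mpr ⟨cm.2, hcm, hpos⟩))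
          rw [Cc_eq_of_onAlphabet (hA cm.1 hc g), Cc_eq_of_onAlphabet (hA cm.1 hc h)]; push_cast; ring)
        (fun cm hcm hpos => by
          have hc : cm.1 ∈ D.suppN ++ D.suppP := List.mem_append.mpr (Or.inr ((mem_suppP_iff D cm.1).mpr ⟨cm.2, hcm, hpos⟩))
          rw [Cc_eq_of_onAlphabet (hA cm.1 hc g), Cc_eq_of_onAlphabet (hA cm.1 hc h)]; push_cast; ring)
    rw [e1, slinG_intCast (D := D) (fun c => (c g).colevel * (c h).colevel)]
  have eR : slinG D (fun c => Q η (c p)) = ((slinZ D (fun c => 2 * |(c p).x * (c p).y|) : ℤ) : GaussianInt) := by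
    have e1 : slinG D (fun c => Q η (c p)) = slinG D (fun c => ((2 * |(c p).x * (c p).y| : ℤ) : GaussianInt)) :=
      slinG_congr_supp
        (fun cm hcm hpos => Q_eq_of_onAlphabet
          (hA cm.1 (List.mem_append.mpr (Or.inl ((mem_suppN_iff D cm.1).mpr ⟨cm.2, hcm, hpos⟩))) p))
        (fun cm hcm hpos => Q_eq_of_onAlphabet
          (hA cm.1 (List.mem_append.mpr (Or.inr ((mem_suppP_iff D cm.1).mpr ⟨cm.2, hcm, hpos⟩))) p))
    rw [e1, slinG_intCast (D := D) (fun c => 2 * |(c p).x * (c p).y|)]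
  have e := slinG_CC_eq_Q h1 η hgh p
  rw [eL, eR] at e
  exact_mod_cast e

end LowerDegree

/-! ## §12 THE RING-2 «N ∋ unit⁴» DOOR SKELETON (director R19.674 (1)(e)): negation g21's §5 arithmetic PROVED, its pen inputs DISPLAYED

`BBPAIR-LAW-negation-g21.md` claims: a ring-2 design through an N-cell `unit⁴` cannot meet the v4.2 door (`Σ_N m ≤ 58`, `Σ_P m ≤ 50`).  Its proof =
room facts R1–R6 (kernel: SUM RULE §6c∕§8 + §10) + laws L1–L5 + the counting §4 + the arithmetic §5.  This section types the LAST step so that what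
remains pen is exactly the list of displayed hypotheses: the six P-FAMILIES of §4 are cell predicates (`anyBB` = B at two slots, `famBHuu`, `famAHuu`,
`famTAHH` = AAHH ∪ ABHH, `famHook` = Auuu, `famU4`), their pairwise disjointness and `Σ families ≤ Σ_P m` are PROVED (`six_families_le_total`), and
`ring2_unit4_door_skeleton` derives `False` from: the door; L2+L3 in the form `2‖F⁺‖₁ + 4k ≥ 32` (`‖F‖₁ ≥ |Re μ| + |Im μ| ≥ 32`, `σ = −4k`); the box
certificate L5 (`|supp F⁺| ≤ 7 → k ≥ 2`); §4 (a)(b) (`Σ_N m ≥ 7·|supp F⁺| + 9`), (c) `m_P(AHuu) ≥ 9`, (d) `m_P(AAHH ∪ ABHH) ≥ 6`, (e) `m_P(BBHH) = 6k` and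
`k ≥ 1 → m_P(BHuu) ≥ 12`, (f) hooks `≥ 3|supp F⁺| + h¬` and `m_P(u⁴) + 2h¬ ≥ ‖F⁻‖₁ = ‖F⁺‖₁ + 4k`.  The integers `k, |supp F⁺|, ‖F⁺‖₁, h_in, h¬` are
ABSTRACT here (the F-layer is not typed in this file); `k` is tied to the kernel by §11b (`bbpair_massP`: the BB-pair P-mass is one number) and
`anyBB_massP` below (`m_P(B at two slots) = Σ_{6 pairs} m_P(BB g h) = 6·m_P(BB 0 1)`, the six pairs being support-disjoint by `not_three_tops_P`);
`ring2_unit4_door_closed_of` is the instance with `k := m_P(BB 0 1)` in which (e)'s first half is no longer a hypothesis.  HONEST LABEL: the skeleton proves only «these displayed inequalities are jointly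
inconsistent with the door»; each displayed hypothesis is a pen claim of negation g21 under ×2 audit (R19.674 (a)–(d)); nothing here is a digit of
record and nothing is proved toward HC ∕ HC_CM ∕ HC_AV ∕ №4 ∕ 26512 ∕ 18881 ∕ H2. -/

section DoorSkeleton

variable {η : ℤ} {D : Design}

/-- letter-kind counts of a cell (ring-2 reading: hub `c = 0`, unit `c = 1`, `A` = axis top, `B` = `x·y ≠ 0`). -/
def cntH (c : Cell) : ℕ := (Finset.univ.filter fun f : Fin 4 => (c f).colevel = 0).card
def cntU (c : Cell) : ℕ := (Finset.univ.filter fun f : Fin 4 => (c f).colevel = 1).card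
def cntA (c : Cell) : ℕ := (Finset.univ.filter fun f : Fin 4 => (c f).colevel = 2 ∧ (c f).x * (c f).y = 0).card
def cntB (c : Cell) : ℕ := (Finset.univ.filter fun f : Fin 4 => (c f).x * (c f).y ≠ 0).card

/-- the six P-families of negation §4: the BB-PAIR cells «B at two slots» (`anyBB`, the disjunction of the six `BB g h`; on a ring-2 RULE-D room
these are exactly the BBHH cells, `two_tops_P_hub`) and five letter-type families over-specified by kind counts so that disjointness is arithmetic:
`BHuu`, `AHuu`, `TAHH` = AAHH ∪ ABHH, `Hook` = Auuu, `U4` = u⁴. -/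
abbrev anyBB (c : Cell) : Prop := BB 0 1 c ∨ BB 0 2 c ∨ BB 0 3 c ∨ BB 1 2 c ∨ BB 1 3 c ∨ BB 2 3 c
abbrev famBHuu (c : Cell) : Prop := cntB c = 1 ∧ cntH c = 1 ∧ cntU c = 2
abbrev famAHuu (c : Cell) : Prop := cntB c = 0 ∧ cntA c = 1 ∧ cntH c = 1 ∧ cntU c = 2
abbrev famTAHH (c : Cell) : Prop := cntH c = 2 ∧ cntU c = 0 ∧ cntA c + cntB c = 2 ∧ 1 ≤ cntA c
abbrev famHook (c : Cell) : Prop := cntH c = 0 ∧ cntB c = 0 ∧ cntA c = 1 ∧ cntU c = 3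
abbrev famU4 (c : Cell) : Prop := cntH c = 0 ∧ cntA c = 0 ∧ cntB c = 0 ∧ cntU c = 4

theorem two_le_cntB_of_BB {g h : Fin 4} {c : Cell} (hgh : g ≠ h) (hb : BB g h c) : 2 ≤ cntB c := by
  unfold cntB
  have hsub : ({g, h} : Finset (Fin 4)) ⊆ Finset.univ.filter fun f : Fin 4 => (c f).x * (c f).y ≠ 0 := by
    intro f hf
    rcases Finset.mem_insert.mp hf with hf | hf
    · rw [hf]; exact Finset.mem_filter.mpr ⟨Finset.mem_univ _, hb.1⟩
    · rw [Finset.mem_singleton] at hf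
      rw [hf]; exact Finset.mem_filter.mpr ⟨Finset.mem_univ _, hb.2⟩
  have := Finset.card_le_card hsub
  rwa [Finset.card_pair hgh] at this

theorem two_le_cntB_of_anyBB {c : Cell} (h : anyBB c) : 2 ≤ cntB c := by
  rcases h with h | h | h | h | h | h <;> exact two_le_cntB_of_BB (by decide) h

/-- mass additivity over support-disjoint predicates. -/
theorem massOn_or_of_disj (L : List (Cell × ℕ)) (U V : Cell → Prop) [DecidablePred U] [DecidablePred V]
    (h : ∀ cm ∈ L, 0 < cm.2 → ¬ (U cm.1 ∧ V cm.1)) :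
    massOn L (fun c => U c ∨ V c) = massOn L U + massOn L V := by
  induction L with
  | nil => simp [massOn]
  | cons a t ih =>
    have iht := ih fun cm hcm => h cm (List.mem_cons.mpr (Or.inr hcm))
    by_cases hU : U a.1
    · by_cases hV : V a.1
      · have h0 : a.2 = 0 := by
          by_contra hne
          exact h a (List.mem_cons.mpr (Or.inl rfl)) (Nat.pos_of_ne_zero hne) ⟨hU, hV⟩
        rw [massOn_cons_of_pos (U := fun c => U c ∨ V c) (Or.inl hU), massOn_cons_of_pos hU, massOn_cons_of_pos hV, iht, h0]
        omega
      · rw [massOn_cons_of_pos (U := fun c => U c ∨ V c) (Or.inl hU), massOn_cons_of_pos hU, massOn_cons_of_neg hV, iht]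
        omega
    · by_cases hV : V a.1
      · rw [massOn_cons_of_pos (U := fun c => U c ∨ V c) (Or.inr hV), massOn_cons_of_neg hU, massOn_cons_of_pos hV, iht]
        omega
      · rw [massOn_cons_of_neg (U := fun c => U c ∨ V c) (fun h' => h'.elim hU hV), massOn_cons_of_neg hU, massOn_cons_of_neg hV, iht]

/-- **the six families are pairwise disjoint, so their P-masses add up inside `Σ_P m`** (no hypothesis on the design). -/
theorem six_families_le_total (L : List (Cell × ℕ)) :
    massOn L anyBB + massOn L famBHuu + massOn L famAHuu + massOn L famTAHH + massOn L famHook + massOn L famU4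
      ≤ (L.map Prod.snd).sum := by
  have e1 : massOn L (fun c => anyBB c ∨ famBHuu c) = massOn L anyBB + massOn L famBHuu :=
    massOn_or_of_disj L _ _ fun cm _ _ hc => by
      obtain ⟨h1, ⟨h2, _, _⟩⟩ := hc
      have := two_le_cntB_of_anyBB h1
      omega
  have e2 : massOn L (fun c => (anyBB c ∨ famBHuu c) ∨ famAHuu c)
      = massOn L (fun c => anyBB c ∨ famBHuu c) + massOn L famAHuu :=
    massOn_or_of_disj L _ _ fun cm _ _ hc => by
      obtain ⟨h1 | h1, ⟨b1, _, _, _⟩⟩ := hc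
      · have := two_le_cntB_of_anyBB h1
        omega
      · obtain ⟨a1, _, _⟩ := h1
        omega
  have e3 : massOn L (fun c => ((anyBB c ∨ famBHuu c) ∨ famAHuu c) ∨ famTAHH c)
      = massOn L (fun c => (anyBB c ∨ famBHuu c) ∨ famAHuu c) + massOn L famTAHH :=
    massOn_or_of_disj L _ _ fun cm _ _ hc => by
      obtain ⟨(h1 | h1) | h1, ⟨t1, t2, t3, t4⟩⟩ := hc
      · have := two_le_cntB_of_anyBB h1
        omega
      · obtain ⟨a1, a2, a3⟩ := h1
        omega
      · obtain ⟨a1, a2, a3, a4⟩ := h1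
        omega
  have e4 : massOn L (fun c => (((anyBB c ∨ famBHuu c) ∨ famAHuu c) ∨ famTAHH c) ∨ famHook c)
      = massOn L (fun c => ((anyBB c ∨ famBHuu c) ∨ famAHuu c) ∨ famTAHH c) + massOn L famHook :=
    massOn_or_of_disj L _ _ fun cm _ _ hc => by
      obtain ⟨((h1 | h1) | h1) | h1, ⟨k1, k2, k3, k4⟩⟩ := hc
      · have := two_le_cntB_of_anyBB h1
        omega
      · obtain ⟨a1, a2, a3⟩ := h1
        omega
      · obtain ⟨a1, a2, a3, a4⟩ := h1
        omega
      · obtain ⟨a1, a2, a3, a4⟩ := h1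
        omega
  have e5 : massOn L (fun c => ((((anyBB c ∨ famBHuu c) ∨ famAHuu c) ∨ famTAHH c) ∨ famHook c) ∨ famU4 c)
      = massOn L (fun c => (((anyBB c ∨ famBHuu c) ∨ famAHuu c) ∨ famTAHH c) ∨ famHook c) + massOn L famU4 :=
    massOn_or_of_disj L _ _ fun cm _ _ hc => by
      obtain ⟨(((h1 | h1) | h1) | h1) | h1, ⟨u1, u2, u3, u4⟩⟩ := hc
      · have := two_le_cntB_of_anyBB h1
        omega
      · obtain ⟨a1, a2, a3⟩ := h1
        omega
      · obtain ⟨a1, a2, a3, a4⟩ := h1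
        omega
      · obtain ⟨a1, a2, a3, a4⟩ := h1
        omega
      · obtain ⟨a1, a2, a3, a4⟩ := h1
        omega
  have htot := massOn_le_total L (fun c => ((((anyBB c ∨ famBHuu c) ∨ famAHuu c) ∨ famTAHH c) ∨ famHook c) ∨ famU4 c)
  rw [e5, e4, e3, e2, e1] at htot
  exact htot

/-- three B-slots in a supported P-cell are impossible on a ring-2 RULE-D room (`not_three_tops_P`). -/
theorem threeB_false (hA : D.OnAlphabet η) (hdis : Disj D) (hr : RuleD D) (hR : RingLe 2 D) {x : Cell} (hx : x ∈ D.suppP)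
    {a b d j : Fin 4} (hab : a ≠ b) (had : a ≠ d) (hbd : b ≠ d) (hja : j ≠ a) (hjb : j ≠ b) (hjd : j ≠ d)
    (ha : (x a).x * (x a).y ≠ 0) (hb : (x b).x * (x b).y ≠ 0) (hd : (x d).x * (x d).y ≠ 0) : False :=
  have hc := mem_supp_of_memP D hx
  not_three_tops_P hA hdis hr hR (by norm_num) hx hab had hbd hja hjb hjd
    (le_antisymm (hR _ hc a) (two_le_colevel_of_xy_ne ha)) (le_antisymm (hR _ hc b) (two_le_colevel_of_xy_ne hb))
    (le_antisymm (hR _ hc d) (two_le_colevel_of_xy_ne hd))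

/-- **`m_P(BB-pair cells) = 6k`** with `k := m_P(BB 0 1)` (kernel: §11b pair-independence + the six `BB g h` are support-disjoint on P). -/
theorem anyBB_massP (hA : D.OnAlphabet η) (h1 : D.A1) (hdis : Disj D) (hr : RuleD D) (hR : RingLe 2 D) :
    massOn D.P anyBB = 6 * massOn D.P (BB 0 1) := by
  have sp : ∀ cm ∈ D.P, 0 < cm.2 → cm.1 ∈ D.suppP := fun cm hcm hpos => (mem_suppP_iff D cm.1).mpr ⟨cm.2, hcm, hpos⟩
  have T : ∀ {x : Cell}, x ∈ D.suppP → ∀ (a b d j : Fin 4), a ≠ b → a ≠ d → b ≠ d → j ≠ a → j ≠ b → j ≠ d →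
      (x a).x * (x a).y ≠ 0 → (x b).x * (x b).y ≠ 0 → (x d).x * (x d).y ≠ 0 → False :=
    fun hx a b d j => threeB_false hA hdis hr hR hx
  have e5 : massOn D.P (fun c => BB 1 3 c ∨ BB 2 3 c) = massOn D.P (BB 1 3) + massOn D.P (BB 2 3) :=
    massOn_or_of_disj D.P _ _ fun cm hcm hpos hc =>
      T (sp cm hcm hpos) 1 3 2 0 (by decide) (by decide) (by decide) (by decide) (by decide) (by decide) hc.1.1 hc.1.2 hc.2.1
  have e4 : massOn D.P (fun c => BB 1 2 c ∨ (BB 1 3 c ∨ BB 2 3 c)) = massOn D.P (BB 1 2) + massOn D.P (fun c => BB 1 3 c ∨ BB 2 3 c) :=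
    massOn_or_of_disj D.P _ _ fun cm hcm hpos hc => by
      obtain ⟨h12, h | h⟩ := hc
      · exact T (sp cm hcm hpos) 1 2 3 0 (by decide) (by decide) (by decide) (by decide) (by decide) (by decide) h12.1 h12.2 h.2
      · exact T (sp cm hcm hpos) 1 2 3 0 (by decide) (by decide) (by decide) (by decide) (by decide) (by decide) h12.1 h12.2 h.2
  have e3 : massOn D.P (fun c => BB 0 3 c ∨ (BB 1 2 c ∨ (BB 1 3 c ∨ BB 2 3 c)))
      = massOn D.P (BB 0 3) + massOn D.P (fun c => BB 1 2 c ∨ (BB 1 3 c ∨ BB 2 3 c)) :=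
    massOn_or_of_disj D.P _ _ fun cm hcm hpos hc => by
      obtain ⟨h03, h | h | h⟩ := hc
      · exact T (sp cm hcm hpos) 0 3 1 2 (by decide) (by decide) (by decide) (by decide) (by decide) (by decide) h03.1 h03.2 h.1
      · exact T (sp cm hcm hpos) 0 3 1 2 (by decide) (by decide) (by decide) (by decide) (by decide) (by decide) h03.1 h03.2 h.1
      · exact T (sp cm hcm hpos) 0 3 2 1 (by decide) (by decide) (by decide) (by decide) (by decide) (by decide) h03.1 h03.2 h.1
  have e2 : massOn D.P (fun c => BB 0 2 c ∨ (BB 0 3 c ∨ (BB 1 2 c ∨ (BB 1 3 c ∨ BB 2 3 c))))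
      = massOn D.P (BB 0 2) + massOn D.P (fun c => BB 0 3 c ∨ (BB 1 2 c ∨ (BB 1 3 c ∨ BB 2 3 c))) :=
    massOn_or_of_disj D.P _ _ fun cm hcm hpos hc => by
      obtain ⟨h02, h | h | h | h⟩ := hc
      · exact T (sp cm hcm hpos) 0 2 3 1 (by decide) (by decide) (by decide) (by decide) (by decide) (by decide) h02.1 h02.2 h.2
      · exact T (sp cm hcm hpos) 0 2 1 3 (by decide) (by decide) (by decide) (by decide) (by decide) (by decide) h02.1 h02.2 h.1
      · exact T (sp cm hcm hpos) 0 2 1 3 (by decide) (by decide) (by decide) (by decide) (by decide) (by decide) h02.1 h02.2 h.1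
      · exact T (sp cm hcm hpos) 0 2 3 1 (by decide) (by decide) (by decide) (by decide) (by decide) (by decide) h02.1 h02.2 h.2
  have e1 : massOn D.P (fun c => BB 0 1 c ∨ (BB 0 2 c ∨ (BB 0 3 c ∨ (BB 1 2 c ∨ (BB 1 3 c ∨ BB 2 3 c)))))
      = massOn D.P (BB 0 1) + massOn D.P (fun c => BB 0 2 c ∨ (BB 0 3 c ∨ (BB 1 2 c ∨ (BB 1 3 c ∨ BB 2 3 c)))) :=
    massOn_or_of_disj D.P _ _ fun cm hcm hpos hc => by
      obtain ⟨h01, h | h | h | h | h⟩ := hc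
      · exact T (sp cm hcm hpos) 0 1 2 3 (by decide) (by decide) (by decide) (by decide) (by decide) (by decide) h01.1 h01.2 h.2
      · exact T (sp cm hcm hpos) 0 1 3 2 (by decide) (by decide) (by decide) (by decide) (by decide) (by decide) h01.1 h01.2 h.2
      · exact T (sp cm hcm hpos) 0 1 2 3 (by decide) (by decide) (by decide) (by decide) (by decide) (by decide) h01.1 h01.2 h.2
      · exact T (sp cm hcm hpos) 0 1 3 2 (by decide) (by decide) (by decide) (by decide) (by decide) (by decide) h01.1 h01.2 h.2
      · exact T (sp cm hcm hpos) 0 1 2 3 (by decide) (by decide) (by decide) (by decide) (by decide) (by decide) h01.1 h01.2 h.1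
  have k02 := bbpair_massP hA h1 hdis hr hR (g := 0) (h := 2) (g' := 0) (h' := 1) (by decide) (by decide)
  have k03 := bbpair_massP hA h1 hdis hr hR (g := 0) (h := 3) (g' := 0) (h' := 1) (by decide) (by decide)
  have k12 := bbpair_massP hA h1 hdis hr hR (g := 1) (h := 2) (g' := 0) (h' := 1) (by decide) (by decide)
  have k13 := bbpair_massP hA h1 hdis hr hR (g := 1) (h := 3) (g' := 0) (h' := 1) (by decide) (by decide)
  have k23 := bbpair_massP hA h1 hdis hr hR (g := 2) (h := 3) (g' := 0) (h' := 1) (by decide) (by decide)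
  have e : massOn D.P anyBB = massOn D.P (fun c => BB 0 1 c ∨ (BB 0 2 c ∨ (BB 0 3 c ∨ (BB 1 2 c ∨ (BB 1 3 c ∨ BB 2 3 c))))) := rfl
  rw [e, e1, e2, e3, e4, e5, k02, k03, k12, k13, k23]
  ring

/-- **THE DOOR SKELETON (negation g21 §5, proved; its inputs displayed).**  For ANY design and natural numbers `k` (the BB-pair constant of §11b),
`nP = |supp F⁺|`, `nF = ‖F⁺‖₁`, `hIn` (A-hooks under the sites of `supp F⁺`), `hOut` (A-hooks elsewhere), the displayed pen claims of
`BBPAIR-LAW-negation-g21.md` are jointly inconsistent with the v4.2 door.  What is proved here: the disjointness bookkeeping (`six_families_le_total`)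
and the branch arithmetic of §5 (Branch A `nP ≥ 8`: `Σ_N ≥ 65`; Branch B: `Σ_P ≥ 7k + 35 + 3·nP ≥ 52`, `≥ 91` if `nP = 0`). -/
theorem ring2_unit4_door_skeleton (D : Design) (k nP nF hIn hOut : ℕ)
    -- the door (`RingTwoMassLaw.ring2_door`: `Σ_N m ≤ 58`, `Σ_P m ≤ 50`)
    (doorN : (D.N.map Prod.snd).sum ≤ 58) (doorP : (D.P.map Prod.snd).sum ≤ 50)
    -- L2 + L3 [pen L2 = 16-coset law + `exists_dir`; L3 = §11 + `unit4_balance'`]: `‖F‖₁ = 2‖F⁺‖₁ + 4k ≥ 32`; `supp F⁺ = ∅ → ‖F⁺‖₁ = 0`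
    (hL2 : 32 ≤ 2 * nF + 4 * k) (hP0 : nP = 0 → nF = 0)
    -- L5, the box certificate [pen]: `|supp F⁺| ≤ 7 → k ≥ 2`
    (hL5 : nP ≤ 7 → 2 ≤ k)
    -- §4 (a)(b) [pen]: every F⁺-site carries `≥ 7` N-mass of `u⁴` cells and `N ⊇ 9` cells `AHHu`
    (hAB : 7 * nP + 9 ≤ (D.N.map Prod.snd).sum)
    -- §4 (e): `m_P(BB-pair cells) = 6k` [KERNEL for `k := m_P(BB 0 1)`: `anyBB_massP`], and `k ≥ 1 →` twelve `BHuu` P-cells [pen]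
    (hBB : massOn D.P anyBB = 6 * k) (hBHuu : 1 ≤ k → 12 ≤ massOn D.P famBHuu)
    -- §4 (c)(d) [pen]: nine `AHuu`, six `AAHH ∪ ABHH`
    (hAHuu : 9 ≤ massOn D.P famAHuu) (hTAHH : 6 ≤ massOn D.P famTAHH)
    -- §4 (f) [pen]: hooks under F⁺-sites `≥ 3·nP`, and the F⁻-carriers `m_P(u⁴) + 2·hOut ≥ ‖F⁻‖₁ = nF + 4k`
    (hHook : hIn + hOut ≤ massOn D.P famHook) (hIn3 : 3 * nP ≤ hIn) (hNeg : nF + 4 * k ≤ massOn D.P famU4 + 2 * hOut) :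
    False := by
  have hsum := six_families_le_total D.P
  by_cases hA : 8 ≤ nP
  · omega
  · have hk : 2 ≤ k := hL5 (by omega)
    have h12 := hBHuu (by omega)
    by_cases h0 : nP = 0
    · have := hP0 h0
      omega
    · omega

/-- the same with `k := m_P(BB 0 1)` — §4 (e)'s «`m_P(BBHH) = 6k`» is then KERNEL (`anyBB_massP`), one displayed hypothesis fewer. -/
theorem ring2_unit4_door_closed_of (hA : D.OnAlphabet η) (h1 : D.A1) (hdis : Disj D) (hr : RuleD D) (hR : RingLe 2 D)
    (nP nF hIn hOut : ℕ)
    (doorN : (D.N.map Prod.snd).sum ≤ 58) (doorP : (D.P.map Prod.snd).sum ≤ 50)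
    (hL2 : 32 ≤ 2 * nF + 4 * massOn D.P (BB 0 1)) (hP0 : nP = 0 → nF = 0)
    (hL5 : nP ≤ 7 → 2 ≤ massOn D.P (BB 0 1))
    (hAB : 7 * nP + 9 ≤ (D.N.map Prod.snd).sum)
    (hBHuu : 1 ≤ massOn D.P (BB 0 1) → 12 ≤ massOn D.P famBHuu)
    (hAHuu : 9 ≤ massOn D.P famAHuu) (hTAHH : 6 ≤ massOn D.P famTAHH)
    (hHook : hIn + hOut ≤ massOn D.P famHook) (hIn3 : 3 * nP ≤ hIn)
    (hNeg : nF + 4 * massOn D.P (BB 0 1) ≤ massOn D.P famU4 + 2 * hOut) : False :=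
  ring2_unit4_door_skeleton D (massOn D.P (BB 0 1)) nP nF hIn hOut doorN doorP hL2 hP0 hL5 hAB
    (anyBB_massP hA h1 hdis hr hR) hBHuu hAHuu hTAHH hHook hIn3 hNeg

end DoorSkeleton

/-! ### §12b BRANCH A IN KERNEL (R19.679 (A)): `|supp F⁺| ≥ 8 ⇒ Σ_N m ≥ 65` from R2 ∕ R3 alone

The sites of `supp F⁺` are supported unit⁴ N-cells `y` with `F(t) ≥ 1`, i.e. (negation §2, `m_P(u⁴_t) = 0` by `Disj`) `m_N(y) ≥ 1 + 2·m_P(hooks under y)`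
— this inequality is the ONLY displayed (pen) input below; a «hook under `y`» is a P-cell equal to `y` off one slot `g` and carrying at `g` a top
letter one null step below the unit `y g` (A- or B-hook; B-hooks are absent by `RingTwoMassLaw.no_bhook_P`, so on the room this is negation's
`2·m_P(A-hooks at t)`).  KERNEL: R2 (`unit4_exists_hook`) puts supported hooks under `y` at a vertex cover of `K₄`, hence at THREE slots
(`three_hook_slots`), so `m_P(hooks under y) ≥ 3` and `m_N(y) ≥ 7` per site; R3 (`hook_forces_witness`) turns the three hooks of ONE site into NINE
pairwise different supported N-cells `(T@g, H, H, u@c)` (`nine_witnesses_mass`), none of them a unit⁴ cell; summing over the distinct sites,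
`Σ_N m ≥ 7·|S| + 9` (`branchA_sigmaN`) and `|S| ≥ 8` contradicts the door `Σ_N m ≤ 58` (`branchA_closed`).  With dual's `door_law` (σ = 0 under the
door, `RingTwoMassLaw` v6 §14) and the box certificate L4∕L5 (pen, finite over `(ℤ∕4)⁴`: `|supp F⁺| ≤ 7 ∧ σ = 0 ⇒ μ = 0`), Branch A is all that is
left of the coarse ring-2 «N ∋ unit⁴» cell: `ring2_unit4_closed_of_branchA` displays exactly that residue. -/

section BranchA

variable {η : ℤ} {D : Design}

/-- a unit⁴ cell: all four letters of co-level 1. -/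
abbrev IsUnit4 (y : Cell) : Prop := ∀ f : Fin 4, (y f).colevel = 1

/-- `x` is a hook under `y` at slot `g`: a top letter one null step below `y g` at `g`, equal to `y` elsewhere. -/
def HookAt (y : Cell) (g : Fin 4) (x : Cell) : Prop := (x g).colevel = 2 ∧ NullStep (x g) (y g) ∧ ∀ f : Fin 4, f ≠ g → x f = y f

def HookUnder (y : Cell) (x : Cell) : Prop := ∃ g : Fin 4, HookAt y g x

/-- the R3 witness shape: top at `g`, unit at `c`, hubs elsewhere. -/
abbrev Wit (η : ℤ) (g c : Fin 4) (w : Cell) : Prop :=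
  (w g).colevel = 2 ∧ (w c).colevel = 1 ∧ ∀ f : Fin 4, f ≠ g → f ≠ c → w f = Letter.hub η

theorem massOn_mono (L : List (Cell × ℕ)) (U V : Cell → Prop) [DecidablePred U] [DecidablePred V]
    (h : ∀ cm ∈ L, 0 < cm.2 → U cm.1 → V cm.1) : massOn L U ≤ massOn L V := by
  induction L with
  | nil => simp [massOn]
  | cons a t ih =>
    have iht := ih fun cm hcm => h cm (List.mem_cons_of_mem a hcm)
    by_cases hU : U a.1
    · by_cases hV : V a.1
      · rw [massOn_cons_of_pos hU, massOn_cons_of_pos hV]; omega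
      · have h0 : a.2 = 0 := by
          by_contra hne; exact hV (h a List.mem_cons_self (Nat.pos_of_ne_zero hne) hU)
        rw [massOn_cons_of_pos hU, massOn_cons_of_neg hV, h0]; omega
    · by_cases hV : V a.1
      · rw [massOn_cons_of_neg hU, massOn_cons_of_pos hV]; omega
      · rw [massOn_cons_of_neg hU, massOn_cons_of_neg hV]; exact iht

theorem massOn_congr_iff (L : List (Cell × ℕ)) (U V : Cell → Prop) [DecidablePred U] [DecidablePred V] (h : ∀ c, U c ↔ V c) :
    massOn L U = massOn L V :=
  le_antisymm (massOn_mono L U V fun cm _ _ hc => (h cm.1).mp hc) (massOn_mono L V U fun cm _ _ hc => (h cm.1).mpr hc)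

theorem le_massOn_of_mem (L : List (Cell × ℕ)) (U : Cell → Prop) [DecidablePred U] {c : Cell} {m : ℕ} (hcm : (c, m) ∈ L) (hU : U c) :
    m ≤ massOn L U := by
  induction L with
  | nil => simp at hcm
  | cons a t ih =>
    rcases List.mem_cons.mp hcm with e | ht
    · rw [massOn_cons_of_pos (a := a) (by rw [← e]; exact hU), ← e]; omega
    · have := ih ht
      by_cases ha : U a.1
      · rw [massOn_cons_of_pos ha]; omega
      · rw [massOn_cons_of_neg ha]; exact this

theorem one_le_massOn_N (U : Cell → Prop) [DecidablePred U] {c : Cell} (hc : c ∈ D.suppN) (hU : U c) : 1 ≤ massOn D.N U := by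
  obtain ⟨m, hm, hpos⟩ := (mem_suppN_iff D c).mp hc
  exact le_trans hpos (le_massOn_of_mem D.N U hm hU)

theorem one_le_massOn_P (U : Cell → Prop) [DecidablePred U] {c : Cell} (hc : c ∈ D.suppP) (hU : U c) : 1 ≤ massOn D.P U := by
  obtain ⟨m, hm, hpos⟩ := (mem_suppP_iff D c).mp hc
  exact le_trans hpos (le_massOn_of_mem D.P U hm hU)

theorem massOn_eq_zero_of (L : List (Cell × ℕ)) (U : Cell → Prop) [DecidablePred U] (h : ∀ cm ∈ L, 0 < cm.2 → ¬ U cm.1) :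
    massOn L U = 0 := by
  induction L with
  | nil => simp [massOn]
  | cons a t ih =>
    have iht := ih fun cm hcm => h cm (List.mem_cons_of_mem a hcm)
    by_cases hU : U a.1
    · have h0 : a.2 = 0 := by
        by_contra hne; exact h a List.mem_cons_self (Nat.pos_of_ne_zero hne) hU
      rw [massOn_cons_of_pos hU, h0, iht]
    · rw [massOn_cons_of_neg hU, iht]

/-- the mass of a finite set of cells is the sum of the masses of its members. -/
theorem massOn_mem_finset (L : List (Cell × ℕ)) (S : Finset Cell) :
    massOn L (fun c => c ∈ S) = ∑ y ∈ S, massOn L (fun c => c = y) := by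
  induction S using Finset.induction_on with
  | empty =>
    rw [Finset.sum_empty]
    exact massOn_eq_zero_of L _ fun cm _ _ h => absurd h (Finset.notMem_empty _)
  | insert a s ha ih =>
    rw [Finset.sum_insert ha, ← ih, massOn_congr_iff L (fun c => c ∈ insert a s) (fun c => c = a ∨ c ∈ s) fun c => Finset.mem_insert]
    exact massOn_or_of_disj L _ _ fun cm _ _ hc => ha (hc.1 ▸ hc.2)

/-- R2 ⇒ supported hooks under a supported unit⁴ N-cell sit at a vertex cover of `K₄`, hence at three pairwise different slots. -/
theorem three_hook_slots (hA : D.OnAlphabet η) (hdis : Disj D) (hr : RuleD D) (hR : RingLe 2 D)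
    {y : Cell} (hy : y ∈ D.suppN) (hu : IsUnit4 y) :
    ∃ g₁ g₂ g₃ : Fin 4, g₁ ≠ g₂ ∧ g₁ ≠ g₃ ∧ g₂ ≠ g₃ ∧
      (∃ x ∈ D.suppP, HookAt y g₁ x) ∧ (∃ x ∈ D.suppP, HookAt y g₂ x) ∧ (∃ x ∈ D.suppP, HookAt y g₃ x) := by
  have hb : ∀ g j : Fin 4, g ≠ j → (∃ x ∈ D.suppP, HookAt y g x) ∨ (∃ x ∈ D.suppP, HookAt y j x) := by
    intro g j hgj
    obtain ⟨x, hx, hoff, hh⟩ := unit4_exists_hook hA hdis hr hR hy hu hgj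
    rcases hh with ⟨eg, tj, nj⟩ | ⟨ej, tg, ng⟩
    · refine Or.inr ⟨x, hx, tj, nj, fun f hfj => ?_⟩
      by_cases hfg : f = g
      · rw [hfg]; exact eg
      · exact hoff f hfg hfj
    · refine Or.inl ⟨x, hx, tg, ng, fun f hfg => ?_⟩
      by_cases hfj : f = j
      · rw [hfj]; exact ej
      · exact hoff f hfg hfj
  by_cases h0 : ∃ x ∈ D.suppP, HookAt y 0 x
  · by_cases h1 : ∃ x ∈ D.suppP, HookAt y 1 x
    · by_cases h2 : ∃ x ∈ D.suppP, HookAt y 2 x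
      · exact ⟨0, 1, 2, by decide, by decide, by decide, h0, h1, h2⟩
      · exact ⟨0, 1, 3, by decide, by decide, by decide, h0, h1, (hb 2 3 (by decide)).resolve_left h2⟩
    · exact ⟨0, 2, 3, by decide, by decide, by decide, h0, (hb 1 2 (by decide)).resolve_left h1,
        (hb 1 3 (by decide)).resolve_left h1⟩
  · exact ⟨1, 2, 3, by decide, by decide, by decide, (hb 0 1 (by decide)).resolve_left h0,
      (hb 0 2 (by decide)).resolve_left h0, (hb 0 3 (by decide)).resolve_left h0⟩

/-- hooks under a unit⁴ cell at different slots are different cells. -/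
theorem hookAt_disj {y : Cell} (hu : IsUnit4 y) {g g' : Fin 4} (hgg : g ≠ g') {x : Cell} (h1 : HookAt y g x) (h2 : HookAt y g' x) :
    False := by
  have e : x g = y g := h2.2.2 g hgg
  have t := h1.1
  rw [e, hu g] at t
  omega

/-- **per-site bound:** a supported unit⁴ N-cell has P-mass `≥ 3` of hooks under it (R2). -/
theorem three_le_hook_mass (hA : D.OnAlphabet η) (hdis : Disj D) (hr : RuleD D) (hR : RingLe 2 D)
    {y : Cell} [DecidablePred (HookUnder y)] (hy : y ∈ D.suppN) (hu : IsUnit4 y) : 3 ≤ massOn D.P (HookUnder y) := by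
  classical
  obtain ⟨g₁, g₂, g₃, h12, h13, h23, ⟨x₁, hx₁, k₁⟩, ⟨x₂, hx₂, k₂⟩, ⟨x₃, hx₃, k₃⟩⟩ := three_hook_slots hA hdis hr hR hy hu
  have e : massOn D.P (fun x => HookAt y g₁ x ∨ (HookAt y g₂ x ∨ HookAt y g₃ x))
      = massOn D.P (HookAt y g₁) + (massOn D.P (HookAt y g₂) + massOn D.P (HookAt y g₃)) := by
    rw [massOn_or_of_disj D.P _ _ (fun cm _ _ hc => hc.2.elim (hookAt_disj hu h12 hc.1) (hookAt_disj hu h13 hc.1)),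
      massOn_or_of_disj D.P _ _ (fun cm _ _ hc => hookAt_disj hu h23 hc.1 hc.2)]
  have m1 := one_le_massOn_P (HookAt y g₁) hx₁ k₁
  have m2 := one_le_massOn_P (HookAt y g₂) hx₂ k₂
  have m3 := one_le_massOn_P (HookAt y g₃) hx₃ k₃
  have hle : massOn D.P (fun x => HookAt y g₁ x ∨ (HookAt y g₂ x ∨ HookAt y g₃ x)) ≤ massOn D.P (HookUnder y) :=
    massOn_mono D.P _ _ fun cm _ _ hc => hc.elim (fun k => ⟨g₁, k⟩) fun hc => hc.elim (fun k => ⟨g₂, k⟩) fun k => ⟨g₃, k⟩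
  omega

theorem exists_three_others : ∀ g : Fin 4, ∃ a b c : Fin 4, a ≠ g ∧ b ≠ g ∧ c ≠ g ∧ a ≠ b ∧ a ≠ c ∧ b ≠ c := by
  decide

/-- R3 ⇒ a supported hook under a unit⁴ cell at `g` forces, for every `c ≠ g`, a supported N-cell of shape `Wit g c`. -/
theorem exists_wit (hA : D.OnAlphabet η) (hdis : Disj D) (hr : RuleD D) (hR : RingLe 2 D)
    {y : Cell} (hu : IsUnit4 y) {g : Fin 4} {x : Cell} (hx : x ∈ D.suppP) (hk : HookAt y g x) {c : Fin 4} (hcg : c ≠ g) :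
    ∃ w ∈ D.suppN, Wit η g c w := by
  obtain ⟨a, b, hga, hgb, hca, hcb, hab, hcov⟩ := exists_other_two g c (Ne.symm hcg)
  have hux : ∀ f, f ≠ g → (x f).colevel = 1 := fun f hf => by rw [hk.2.2 f hf]; exact hu f
  obtain ⟨w, hw, wa, wb, wg, wc⟩ :=
    hook_forces_witness hA hdis hr hR hx (Ne.symm hga) (Ne.symm hgb) hab hcg hca hcb hk.1 hux
  refine ⟨w, hw, by rw [wg]; exact hk.1, by rw [wc]; exact hux c hcg, fun f hfg hfc => ?_⟩
  rcases hcov f with e | e | e | e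
  · exact absurd e hfg
  · exact absurd e hfc
  · rw [e]; exact wa
  · rw [e]; exact wb

/-- witness shapes with different labels are different cells, and no witness is a unit⁴ cell. -/
theorem wit_disj {g c g' c' : Fin 4} (hcg : c ≠ g) (hne : g ≠ g' ∨ c ≠ c') {w : Cell} (h1 : Wit η g c w) (h2 : Wit η g' c' w) :
    False := by
  rcases hne with hgg | hcc
  · -- slot g carries a top letter for `h1` but a unit or a hub for `h2`
    by_cases hgc' : g = c'
    · have t := h1.1; rw [hgc', h2.2.1] at t; omega
    · have t := h1.1; rw [h2.2.2 g hgg hgc', hub_colevel] at t; omega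
  · by_cases hgg : g = g'
    · have t := h1.2.1
      have hcg' : c ≠ g' := fun e => hcg (e.trans hgg.symm)
      rw [h2.2.2 c hcg' hcc, hub_colevel] at t; omega
    · by_cases hgc' : g = c'
      · have t := h1.1; rw [hgc', h2.2.1] at t; omega
      · have t := h1.1; rw [h2.2.2 g hgg hgc', hub_colevel] at t; omega

theorem wit_not_unit4 {g c : Fin 4} {w : Cell} (h1 : Wit η g c w) (hu : IsUnit4 w) : False := by
  have t := h1.1; rw [hu g] at t; omega

/-- the nine witnesses of one site: for three pairwise different hook slots `g₁ g₂ g₃` under a unit⁴ cell, the N-mass of the witness shapes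
`Wit gᵢ c` (`c ≠ gᵢ`) is at least `9`. -/
abbrev WitG (η : ℤ) (g a b c : Fin 4) (w : Cell) : Prop := Wit η g a w ∨ (Wit η g b w ∨ Wit η g c w)

theorem three_le_witG (hA : D.OnAlphabet η) (hdis : Disj D) (hr : RuleD D) (hR : RingLe 2 D)
    {y : Cell} (hu : IsUnit4 y) {g : Fin 4} {x : Cell} (hx : x ∈ D.suppP) (hk : HookAt y g x)
    {a b c : Fin 4} (hag : a ≠ g) (hbg : b ≠ g) (hcg : c ≠ g) (hab : a ≠ b) (hac : a ≠ c) (hbc : b ≠ c) :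
    3 ≤ massOn D.N (WitG η g a b c) := by
  have e : massOn D.N (fun w => Wit η g a w ∨ (Wit η g b w ∨ Wit η g c w))
      = massOn D.N (Wit η g a) + (massOn D.N (Wit η g b) + massOn D.N (Wit η g c)) := by
    rw [massOn_or_of_disj D.N _ _ (fun cm _ _ hc => hc.2.elim (wit_disj hag (Or.inr hab) hc.1) (wit_disj hag (Or.inr hac) hc.1)),
      massOn_or_of_disj D.N _ _ (fun cm _ _ hc => wit_disj hbg (Or.inr hbc) hc.1 hc.2)]
  obtain ⟨wa, hwa, ka⟩ := exists_wit hA hdis hr hR hu hx hk hag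
  obtain ⟨wb, hwb, kb⟩ := exists_wit hA hdis hr hR hu hx hk hbg
  obtain ⟨wc, hwc, kc⟩ := exists_wit hA hdis hr hR hu hx hk hcg
  have m1 := one_le_massOn_N (Wit η g a) hwa ka
  have m2 := one_le_massOn_N (Wit η g b) hwb kb
  have m3 := one_le_massOn_N (Wit η g c) hwc kc
  show 3 ≤ massOn D.N (fun w => Wit η g a w ∨ (Wit η g b w ∨ Wit η g c w))
  omega

/-- **BRANCH A (kernel): `Σ_N m ≥ 7·|S| + 9`** for every nonempty finite set `S` of supported unit⁴ N-cells each satisfying the F⁺-site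
inequality `m_N(y) ≥ 1 + 2·m_P(hooks under y)` (displayed; = «`F(t) ≥ 1`» of negation §2 with `Disj`). -/
theorem branchA_sigmaN (hA : D.OnAlphabet η) (hdis : Disj D) (hr : RuleD D) (hR : RingLe 2 D)
    [hdec : ∀ y : Cell, DecidablePred (HookUnder y)]
    (S : Finset Cell) (hS : S.Nonempty) (hSN : ∀ y ∈ S, y ∈ D.suppN) (hSu : ∀ y ∈ S, IsUnit4 y)
    (hF : ∀ y ∈ S, 1 + 2 * massOn D.P (HookUnder y) ≤ massOn D.N (fun c => c = y)) :
    7 * S.card + 9 ≤ (D.N.map Prod.snd).sum := by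
  -- per site: `m_N(y) ≥ 7`
  have h7 : ∀ y ∈ S, 7 ≤ massOn D.N (fun c => c = y) := fun y hy => by
    have := three_le_hook_mass hA hdis hr hR (hSN y hy) (hSu y hy)
    have := hF y hy
    omega
  have hsites : 7 * S.card ≤ massOn D.N (fun c => c ∈ S) := by
    rw [massOn_mem_finset D.N S]
    have := Finset.sum_le_sum fun y hy => h7 y hy
    rw [Finset.sum_const, smul_eq_mul] at this
    linarith
  -- one site and its nine witnesses
  obtain ⟨y₀, hy₀⟩ := hS
  obtain ⟨g₁, g₂, g₃, h12, h13, h23, ⟨x₁, hx₁, k₁⟩, ⟨x₂, hx₂, k₂⟩, ⟨x₃, hx₃, k₃⟩⟩ :=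
    three_hook_slots hA hdis hr hR (hSN y₀ hy₀) (hSu y₀ hy₀)
  obtain ⟨a₁, b₁, c₁, ha₁, hb₁, hc₁, hab₁, hac₁, hbc₁⟩ := exists_three_others g₁
  obtain ⟨a₂, b₂, c₂, ha₂, hb₂, hc₂, hab₂, hac₂, hbc₂⟩ := exists_three_others g₂
  obtain ⟨a₃, b₃, c₃, ha₃, hb₃, hc₃, hab₃, hac₃, hbc₃⟩ := exists_three_others g₃
  have w1 := three_le_witG hA hdis hr hR (hSu y₀ hy₀) hx₁ k₁ ha₁ hb₁ hc₁ hab₁ hac₁ hbc₁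
  have w2 := three_le_witG hA hdis hr hR (hSu y₀ hy₀) hx₂ k₂ ha₂ hb₂ hc₂ hab₂ hac₂ hbc₂
  have w3 := three_le_witG hA hdis hr hR (hSu y₀ hy₀) hx₃ k₃ ha₃ hb₃ hc₃ hab₃ hac₃ hbc₃
  -- coarsen each witness group to «top letter at gᵢ»: on supported N-cells these are pairwise disjoint (`ring_top_unique_N`) and miss the sites
  have sp : ∀ cm ∈ D.N, 0 < cm.2 → cm.1 ∈ D.suppN := fun cm hcm hpos => (mem_suppN_iff D cm.1).mpr ⟨cm.2, hcm, hpos⟩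
  have cW : ∀ {g a b c : Fin 4}, massOn D.N (WitG η g a b c) ≤ massOn D.N (fun w => (w g).colevel = 2) :=
    fun {g a b c} => massOn_mono D.N _ _ fun cm _ _ hw => by
      rcases hw with k | k | k
      · exact k.1
      · exact k.1
      · exact k.1
  have e23 : massOn D.N (fun w => (w g₂).colevel = 2 ∨ (w g₃).colevel = 2)
      = massOn D.N (fun w => (w g₂).colevel = 2) + massOn D.N (fun w => (w g₃).colevel = 2) :=
    massOn_or_of_disj D.N _ _ fun cm hcm hpos hc => ring_top_unique_N hA hdis hr hR (by norm_num) (sp cm hcm hpos) h23 hc.1 hc.2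
  have e123 : massOn D.N (fun w => (w g₁).colevel = 2 ∨ ((w g₂).colevel = 2 ∨ (w g₃).colevel = 2))
      = massOn D.N (fun w => (w g₁).colevel = 2) + massOn D.N (fun w => (w g₂).colevel = 2 ∨ (w g₃).colevel = 2) :=
    massOn_or_of_disj D.N _ _ fun cm hcm hpos hc => hc.2.elim
      (fun k => ring_top_unique_N hA hdis hr hR (by norm_num) (sp cm hcm hpos) h12 hc.1 k)
      (fun k => ring_top_unique_N hA hdis hr hR (by norm_num) (sp cm hcm hpos) h13 hc.1 k)
  have eS : massOn D.N (fun w => w ∈ S ∨ ((w g₁).colevel = 2 ∨ ((w g₂).colevel = 2 ∨ (w g₃).colevel = 2)))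
      = massOn D.N (fun w => w ∈ S) + massOn D.N (fun w => (w g₁).colevel = 2 ∨ ((w g₂).colevel = 2 ∨ (w g₃).colevel = 2)) :=
    massOn_or_of_disj D.N _ _ fun cm _ _ hc => by
      obtain ⟨hmem, hw⟩ := hc
      have hu := hSu cm.1 hmem
      rcases hw with k | k | k
      · rw [hu g₁] at k; omega
      · rw [hu g₂] at k; omega
      · rw [hu g₃] at k; omega
  have htot := massOn_le_total D.N (fun w => w ∈ S ∨ ((w g₁).colevel = 2 ∨ ((w g₂).colevel = 2 ∨ (w g₃).colevel = 2)))
  rw [eS, e123, e23] at htot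
  have c1 := cW (g := g₁) (a := a₁) (b := b₁) (c := c₁)
  have c2 := cW (g := g₂) (a := a₂) (b := b₂) (c := c₂)
  have c3 := cW (g := g₃) (a := a₃) (b := b₃) (c := c₃)
  omega

/-- **BRANCH A CLOSED:** eight F⁺-sites are incompatible with the door `Σ_N m ≤ 58` (`7·8 + 9 = 65 > 58`). -/
theorem branchA_closed (hA : D.OnAlphabet η) (hdis : Disj D) (hr : RuleD D) (hR : RingLe 2 D)
    [hdec : ∀ y : Cell, DecidablePred (HookUnder y)]
    (S : Finset Cell) (hS8 : 8 ≤ S.card) (hSN : ∀ y ∈ S, y ∈ D.suppN) (hSu : ∀ y ∈ S, IsUnit4 y)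
    (hF : ∀ y ∈ S, 1 + 2 * massOn D.P (HookUnder y) ≤ massOn D.N (fun c => c = y))
    (doorN : (D.N.map Prod.snd).sum ≤ 58) : False := by
  have hne : S.Nonempty := Finset.card_pos.mp (by omega)
  have := branchA_sigmaN hA hdis hr hR S hne hSN hSu hF
  omega

/-- **THE COARSE RING-2 «N ∋ unit⁴» CELL AFTER R19.679, residue displayed:** given the door, the set `S` of F⁺-sites (supported unit⁴ N-cells with
`F ≥ 1`) has `|S| ≥ 8` by [σ = 0 under the door (dual `door_law`, kernel) + the box certificate L4∕L5 and L2 (pen, finite): `|S| ≤ 7 ⇒ μ = 0`];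
then Branch A (kernel, this file) closes the cell.  The two displayed hypotheses `hS8`, `hF` are exactly what remains pen. -/
theorem ring2_unit4_closed_of_branchA (hA : D.OnAlphabet η) (hdis : Disj D) (hr : RuleD D) (hR : RingLe 2 D)
    [hdec : ∀ y : Cell, DecidablePred (HookUnder y)]
    (doorN : (D.N.map Prod.snd).sum ≤ 58)
    (S : Finset Cell) (hSN : ∀ y ∈ S, y ∈ D.suppN) (hSu : ∀ y ∈ S, IsUnit4 y)
    (hF : ∀ y ∈ S, 1 + 2 * massOn D.P (HookUnder y) ≤ massOn D.N (fun c => c = y))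
    (hS8 : 8 ≤ S.card) : False :=
  branchA_closed hA hdis hr hR S hS8 hSN hSu hF doorN

end BranchA


end Summit.HodgeConjecture.HodgeConjecture.Cruxes.BlochSeedDiscOne.DeepLayerLaws
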